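import Literature.Analysis.FluidPDE.EyinkUniformDefectConsistency
import Literature.Analysis.FluidPDE.EyinkBalance
import Literature.Analysis.FluidPDE.DuchonRobertInviscidLimit
import HarnessLib

/-!
# The limits `ε → 0⁺` of Eyink's balance pairings, uniformly in the mollifier

Topic: Analysis/FluidPDE, proofs about the objects of `Literature.Analysis.FluidPDE.EyinkBalance`
(Eyink's mollified longitudinal/transverse velocities `u_X^ε`, energies `(u_X·u_X)^ε`, energy
fluxes `((u_X·u_X)u)^ε`, pressures `p_X^ε` and the balance pairings `𝓔_L^{ε,φ}(ψ)`,
`𝓔_T^{ε,φ}(ψ)` = `Torus.eyinkBalanceL/T`). Everything here is proved; the new notions are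
auxiliary (`Torus.stTranslate`, `Torus.stMeasure`, `Torus.projL`, `Torus.projT`, `Torus.coordFlip`,
`Torus.coordSwap`).

## Why this file exists

By `EyinkUniformDefect` + `EyinkUniformDefectConsistency`
(`Torus.hasFourFifthsLaw_of_forall_hasUniformEyinkDefect`) the accepted fact
`Torus.HasDuchonRobertDefect.hasFourFifthsLaw` holds in dimension `d ≥ 2` as soon as every `L³` weak
Euler solution has a *uniform Eyink defect* (`D_L^{ε,φ}(u) → D`, `D_T^{ε,φ}(u) → D` in `𝒟'`
**uniformly over spherically symmetric unit-ball mollifiers**). Eyink's proof of his Thm. 1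
obtains `D_X^{ε,φ} → D` from the balance equations (uuL-eq)/(uuT-eq) at scale `ε` (the named
facts `Torus.eyink_longitudinal_balance`, `Torus.eyink_transverse_balance`:
`𝓔_X^{ε,φ}(ψ) = c_X⁻¹ ∫∫ D_X^{ε,φ} ψ`) and the convergence of their left-hand sides. This file
proves that convergence **with a rate uniform in the mollifier**:

* `Torus.eyinkBalanceL_sub_lt`: for every `η > 0` there is `ε₀ > 0` such that for all spherically
  symmetric unit-ball mollifiers `φ` and all `ε ∈ (0, ε₀)`,
  `|𝓔_L^{ε,φ}(ψ) − (4/d) ∫₀ᵀ∫ [½|u|²∂ₜψ + (½|u|² + p)⟪u,∇ψ⟫]| < η`;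
* `Torus.eyinkBalanceT_sub_lt`: the same with `4(d−1)/d`;

for `u ∈ L³((0,T) × T^d)`, `p ∈ L^{3/2}((0,T) × T^d)` jointly measurable and `ψ` a test function
supported in `(0,T) × T^d` (no equation is used: this is pure real analysis). The assembly with
the two facts into `Torus.HasUniformEyinkDefect` (and hence the 4/5 law) is a sibling file.

## The printed argument (Eyink 2003, §2, proof of Thm. 1) and its formalisation

Eyink: "`u_L^ε − ⅓u = ∫ φ^ε(ℓ) ℓ̂⊗ℓ̂ [u(x+ℓ) − u(x)] dℓ`" ((uL-thirdu), using (third-delta)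
`∫ φ^ε ℓ̂⊗ℓ̂ = ⅓1`), "thus `‖u_L^ε − ⅓u‖_{L³} ≤ ∫ φ^ε(ℓ)‖u(·+ℓ) − u‖_{L³} dℓ`" ((norm-uL-thirdu)),
"`‖u(·+ℓ) − u‖_{L³} → 0` as `ℓ → 0`" (continuity of translation); the pressure likewise in `L^{3/2}`
((pT-eq)–(norm-pT-twothirdp)); "entirely similar arguments show `((u_X·u_X)u)^ε − (u_X·u_X)^ε u → 0`
strong in `L¹` … We leave that to the reader"; "the lefthand side of (uuL-eq) converges as `ε → 0`
to `(4/3){∂ₜ(½|u|²) + ∇·[(½|u|²+p)u]}`". The bounds depend on `φ` only through its support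
radius — this is the uniformity. Formalised at the level of **pairings** (never forming
`L³`-valued Bochner integrals): every term of `𝓔_X` is a kernel pairing
`∫∫∫ k(ξ) G(ξ̂; data(t,x+ξ), data(t,x)) dξ dx dt` on `((0,T) × T^d) × ℝ^d`, and

1. *Continuity of translation* `‖f(·, ·+ξ) − f‖_{L^q_{t,x}} → 0` (`tendsto_eLpNorm_comp_stTranslate_sub`,
   Mathlib's `Lp.compMeasurePreserving_continuous` along the shears `Torus.stTranslate`).
2. *Dominated integrability and the exchange estimate* (`integrable_kernel_mul_translate_mul`,
   `abs_integral_kernel_mul_sub_le`): `|∫∫ kG_ξ − ∫∫ kG₀| ≤ (sup_{|ξ|≤ε} |∫(G_ξ − G₀)|) ∫|k|` (Fubini).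
3. *Four term types* with Hölder `3,3/2` / `3,3,3` difference bounds (`typeI…IV_estimate`):
   linear in `u(t,x+ξ)` against an `L^{3/2}` weight; quadratic against an `L³` weight; cubic against
   a bounded weight; linear in `p(t,x+ξ)` against an `L³` weight.
4. *The constants*: the angular moments `∫ k(ξ) ξ̂ᵢξ̂ⱼ dξ = δᵢⱼ d⁻¹∫k` of a radial kernel
   (`integral_radial_mul_unit_mul_unit`, by the coordinate reflections/swaps `coordFlip`, `coordSwap`
   and `Σᵢ ξ̂ᵢ² = 1`), whence `∫ k⟪P_L(ξ̂)a, c⟫ = d⁻¹⟪a,c⟫`, `∫ k⟪P_T(ξ̂)a,c⟫ = ((d−1)/d)⟪a,c⟫`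
   (`P_L(ω) = ω⊗ω`, `P_T = 1 − ω⊗ω`); and the masses `∫ φ_T = (d−1)/d`, `∫ φ_L = 1/d`, `∫|φ_L| ≤ 2` of
   Eyink's kernels (`integrable_transverseKernel`: `∫_{s>1}∫ s⁻¹φ(sξ) dξ ds = d⁻¹∫φ` by scaling).
5. *The master estimate* `master_estimate`: for fixed data there are `K₁, K₂` with
   `|∫ S − c_X·4·∫[½|u|²∂ₜψ + (½|u|²+p)⟪u,∇ψ⟫]| ≤ K₁ m + K₂ m_P` for every admissible kernel pair,
   projection family and translation moduli `m` (of `u` in `L³`), `m_P` (of `p` in `L^{3/2}`) on the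
   support ball; `eyinkBalanceL/T_sub_lt` instantiate it with `(φ^ε, φ_L^ε, P_L)` and `(φ^ε, φ_T^ε, P_T)`
   after identifying Eyink's objects with the master form (`eyink_objectsL_eq`, `eyink_objectsT_eq`:
   `⟪u₊, ξ̂⟫² = ‖P_L(ξ̂)u₊‖²` off the null set `ξ = 0`).

## Design notes

* All hypotheses are the joint bounds `∫⁻₍₀,T₎∫⁻ ‖u‖ₑ³ < ∞`, `∫⁻₍₀,T₎∫⁻ ‖p‖ₑ^{3/2} < ∞` and joint
  measurability of the space–time lifts, as in the facts of `EyinkBalance` /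
  `DuchonRobertLocalBalance`; `d` nonempty (the statements are used for `d ≥ 2`).
* `Torus.stMeasure d T = vol|_{(0,T)} ⊗ vol_{T^d}` is a reducible abbreviation; product-measure and
  iterated forms are bridged by `integral_prod` (`energyFluxFunctional_eq_integral_prod`).
* The projection bounds are required only at unit directions `ξ̂` (`‖P_L(ξ̂)v‖ ≤ ‖v‖`,
  `‖P_T(ξ̂)v‖ ≤ 2‖v‖`), where `ξ̂ = ‖ξ‖⁻¹ξ` has junk value `0` at `ξ = 0`.
* Not here: the Euler equation (it enters only through the two balance facts, in the sibling
  assembly file), and the `d ≤ 1` cases of the accepted fact.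

## References

* G. L. Eyink, *Local 4/5-law and energy dissipation anomaly in turbulence*, Nonlinearity 16
  (2003) 137–145 = arXiv:nlin/0208004: §2, proof of Thm. 1 — (third-delta), (uL-thirdu),
  (norm-uL-thirdu), (pT-eq), (pT-twothirdp), (norm-pT-twothirdp), the `L¹` commutator remark, and
  the convergence of the left-hand sides of (uuL-eq)/(uuT-eq). [Eyink2003]
* M. Novack, *Scaling laws and exact results in turbulence*, Nonlinearity 37 (2024) 095002:
  Thm. 1 (`d ≥ 2`), `∫ T_L = d⁻¹δ`, `∫ T_T = ((d−1)/d)δ`. [Novack2024]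
* Mathlib: `MeasureTheory.Lp.compMeasurePreserving_continuous` /
  `Filter.Tendsto.compMeasurePreservingLp`, `ENNReal.lintegral_mul_le_Lp_mul_Lq`,
  `MeasureTheory.integral_prod`, `MeasureTheory.Measure.integral_comp_smul`,
  `integral_Ioi_rpow_of_lt`, `LinearIsometryEquiv.piLpCongrLeft/Right`,
  `LinearIsometryEquiv.measurePreserving`, `MeasureTheory.MemLp.mono_exponent`.
-/

noncomputable section

open MeasureTheory MeasureTheory.Measure TopologicalSpace Set Function Filter Topology Metric Module
open scoped InnerProductSpace RealInnerProductSpace ENNReal NNReal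

namespace Literature.Analysis.FluidPDE.Torus

variable {d : Type*} [Fintype d]

/-! ## Spatial translation of space–time fields and continuity of translation in `L^q` -/

section Translation

variable (d) in
/-- **Spatial translation of space–time points** through the covering map, as a continuous family
(in the separation `ξ ∈ ℝ^d`) of continuous self-maps of `ℝ × T^d`: `S_ξ(t,x) = (t, x + π(ξ))` — the
form in which Mathlib's continuity of `(g, f) ↦ g ∘ f` on `L^p × C(X,X)` yields continuity of
translation `‖u(·, · + ξ) − u‖_{L^q} → 0` (`tendsto_eLpNorm_comp_stTranslate_sub`). [folklore] -/
def stTranslate : C(EuclideanSpace ℝ d, C(ℝ × UnitAddTorus d, ℝ × UnitAddTorus d)) :=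
  (ContinuousMap.mk (fun z : EuclideanSpace ℝ d × (ℝ × UnitAddTorus d) =>
      (z.2.1, z.2.2 + FunctionSpaces.Torus.proj z.1))
    (by
      refine (continuous_fst.comp continuous_snd).prodMk ?_
      exact (continuous_snd.comp continuous_snd).add
        (FunctionSpaces.Torus.continuous_proj.comp continuous_fst))).curry

omit [Fintype d] in
/-- Unfolding the translation. [folklore] -/
theorem stTranslate_apply (ξ : EuclideanSpace ℝ d) (p : ℝ × UnitAddTorus d) :
    stTranslate d ξ p = (p.1, p.2 + FunctionSpaces.Torus.proj ξ) :=
  rfl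

omit [Fintype d] in
/-- At zero separation the translation is the identity. [folklore] -/
theorem stTranslate_zero_apply (p : ℝ × UnitAddTorus d) : stTranslate d 0 p = p := by
  rw [stTranslate_apply, FunctionSpaces.Torus.proj_zero, add_zero]

/-- Spatial translations preserve `μ ⊗ vol_{T^d}` for every s-finite time measure `μ`
(translation invariance of Haar measure on `T^d`). [folklore] -/
theorem measurePreserving_stTranslate (μ : Measure ℝ) [SFinite μ] (ξ : EuclideanSpace ℝ d) :
    MeasurePreserving (stTranslate d ξ) (μ.prod (volume : Measure (UnitAddTorus d)))
      (μ.prod (volume : Measure (UnitAddTorus d))) := by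
  have h := (MeasurePreserving.id μ).prod
    (measurePreserving_add_right (volume : Measure (UnitAddTorus d)) (FunctionSpaces.Torus.proj ξ))
  convert h using 1
  funext p
  rfl

/-- **Continuity of translation in `L^q((0,T) × T^d)`** (`1 ≤ q < ∞`): for `f ∈ L^q`,
`‖f(t, x + ξ) − f(t, x)‖_{L^q_{t,x}} → 0` as `ξ → 0` (Mathlib's `Lp.compMeasurePreserving_continuous`;
the "standard approximation argument" of Eyink 2003, §2: "`‖u(·+ℓ) − u‖_{L³} → 0` as `ℓ → 0`"). [folklore] -/
theorem tendsto_eLpNorm_comp_stTranslate_sub {T : ℝ} {F : Type*} [NormedAddCommGroup F]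
    {f : ℝ × UnitAddTorus d → F} {q : ℝ≥0∞} (hq : 1 ≤ q) (hq' : q ≠ ∞)
    (hf : MemLp f q (((volume : Measure ℝ).restrict (Ioo 0 T)).prod (volume : Measure (UnitAddTorus d)))) :
    Tendsto (fun ξ => eLpNorm (fun p => f (stTranslate d ξ p) - f p) q
      (((volume : Measure ℝ).restrict (Ioo 0 T)).prod (volume : Measure (UnitAddTorus d)))) (𝓝 0) (𝓝 0) := by
  set ν := ((volume : Measure ℝ).restrict (Ioo 0 T)).prod (volume : Measure (UnitAddTorus d)) with hν
  haveI : Fact (1 ≤ q) := ⟨hq⟩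
  haveI : ν.InnerRegularCompactLTTop := instInnerRegularCompactLTTopOfIsCompletelyPseudoMetrizableSpace _
  have hT : ∀ ξ, MeasurePreserving (stTranslate d ξ) ν ν := fun ξ => measurePreserving_stTranslate _ ξ
  have h := Filter.Tendsto.compMeasurePreservingLp (μ := ν) (ν := ν) (E := F) (p := q)
    (tendsto_const_nhds : Tendsto (fun _ : EuclideanSpace ℝ d => hf.toLp f) (𝓝 0) (𝓝 (hf.toLp f)))
    ((stTranslate d).continuous.tendsto 0) hT (hT 0) hq'
  rw [tendsto_iff_edist_tendsto_0] at h
  refine h.congr fun ξ => ?_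
  rw [Lp.edist_def]
  refine eLpNorm_congr_ae ?_
  have hr : ((hf.toLp f : _ → F) ∘ ⇑(stTranslate d ξ)) =ᵐ[ν] (f ∘ ⇑(stTranslate d ξ)) :=
    (hT ξ).quasiMeasurePreserving.ae_eq_comp hf.coeFn_toLp
  have h0 : ((hf.toLp f : _ → F) ∘ ⇑(stTranslate d 0)) =ᵐ[ν] (f ∘ ⇑(stTranslate d 0)) :=
    (hT 0).quasiMeasurePreserving.ae_eq_comp hf.coeFn_toLp
  filter_upwards [Lp.coeFn_compMeasurePreserving (hf.toLp f) (hT ξ),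
    Lp.coeFn_compMeasurePreserving (hf.toLp f) (hT 0), hr, h0] with y hy hy0 hy' hy0'
  rw [Pi.sub_apply, hy, hy0, hy', hy0']
  simp only [comp_apply, stTranslate_zero_apply]

/-- Metric form of continuity of translation for the cube norm: for `u ∈ L³((0,T) × T^d)` and
`η > 0` there is `δ > 0` with `∫∫ |u(t, x+ξ) − u(t,x)|³ < η³`… stated as
`(∫⁻ ‖u ∘ S_ξ − u‖ₑ³)^{1/3} < η` for `|ξ| < δ`. [folklore] -/
theorem exists_forall_lintegral_translate_sub_lt {T : ℝ} {F : Type*} [NormedAddCommGroup F]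
    {f : ℝ × UnitAddTorus d → F} {r : ℝ} (hr : 1 ≤ r)
    (hfm : AEStronglyMeasurable f (((volume : Measure ℝ).restrict (Ioo 0 T)).prod (volume : Measure (UnitAddTorus d))))
    (hf : ∫⁻ p, ‖f p‖ₑ ^ r ∂(((volume : Measure ℝ).restrict (Ioo 0 T)).prod (volume : Measure (UnitAddTorus d))) < ∞)
    {η : ℝ≥0∞} (hη : 0 < η) :
    ∃ δ > 0, ∀ ξ : EuclideanSpace ℝ d, ‖ξ‖ < δ →
      (∫⁻ p, ‖f (stTranslate d ξ p) - f p‖ₑ ^ r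
        ∂(((volume : Measure ℝ).restrict (Ioo 0 T)).prod (volume : Measure (UnitAddTorus d)))) ^ (1 / r) < η := by
  set ν := ((volume : Measure ℝ).restrict (Ioo 0 T)).prod (volume : Measure (UnitAddTorus d)) with hν
  have hr0 : 0 < r := one_pos.trans_le hr
  have hq : (1 : ℝ≥0∞) ≤ ENNReal.ofReal r := by
    rw [← ENNReal.ofReal_one]; exact ENNReal.ofReal_le_ofReal hr
  have hmem : MemLp f (ENNReal.ofReal r) ν := by
    refine ⟨hfm, ?_⟩
    rw [eLpNorm_eq_lintegral_rpow_enorm_toReal (by simp [hr0]) ENNReal.ofReal_ne_top,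
      ENNReal.toReal_ofReal hr0.le]
    exact ENNReal.rpow_lt_top_of_nonneg (by positivity) hf.ne
  have h := tendsto_eLpNorm_comp_stTranslate_sub hq ENNReal.ofReal_ne_top hmem
  obtain ⟨δ, hδ, hb⟩ := Metric.eventually_nhds_iff.1 (h.eventually (gt_mem_nhds hη))
  refine ⟨δ, hδ, fun ξ hξ => ?_⟩
  have := hb (by simpa [dist_zero_right] using hξ)
  rwa [eLpNorm_eq_lintegral_rpow_enorm_toReal (by simp [hr0]) ENNReal.ofReal_ne_top,
    ENNReal.toReal_ofReal hr0.le] at this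

end Translation

/-! ## Tonelli and Hölder bookkeeping on `((0,T) × T^d) × ℝ^d` -/

section Holder

variable {α : Type*} [MeasurableSpace α] (μ : Measure α)

/-- `eLpNorm`-free Hölder with exponents `3, 3/2`: `∫⁻ f g ≤ (∫⁻ f³)^{1/3} (∫⁻ g^{3/2})^{2/3}`. [folklore] -/
theorem lintegral_mul_le_L3_mul_L32 {f g : α → ℝ≥0∞} (hf : AEMeasurable f μ) (hg : AEMeasurable g μ) :
    ∫⁻ a, f a * g a ∂μ ≤ (∫⁻ a, f a ^ (3 : ℝ) ∂μ) ^ (1 / 3 : ℝ) * (∫⁻ a, g a ^ (3 / 2 : ℝ) ∂μ) ^ (2 / 3 : ℝ) := by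
  have hH : Real.HolderConjugate 3 (3 / 2 : ℝ) := ⟨by norm_num, by norm_num, by norm_num⟩
  have h := ENNReal.lintegral_mul_le_Lp_mul_Lq μ hH hf hg
  simp only [Pi.mul_apply] at h
  convert h using 3; norm_num

/-- Hölder with exponents `2, 2` applied to `3/2`-powers: `∫⁻ (g k)^{3/2} ≤ (∫⁻ g³)^{1/2} (∫⁻ k³)^{1/2}`. [folklore] -/
theorem lintegral_mul_rpow_three_halves_le {g k : α → ℝ≥0∞} (hg : AEMeasurable g μ) (hk : AEMeasurable k μ) :
    ∫⁻ a, (g a * k a) ^ (3 / 2 : ℝ) ∂μ ≤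
      (∫⁻ a, g a ^ (3 : ℝ) ∂μ) ^ (1 / 2 : ℝ) * (∫⁻ a, k a ^ (3 : ℝ) ∂μ) ^ (1 / 2 : ℝ) := by
  have hH : Real.HolderConjugate 2 2 := ⟨by norm_num, by norm_num, by norm_num⟩
  have h := ENNReal.lintegral_mul_le_Lp_mul_Lq μ hH (hg.pow_const (3 / 2 : ℝ)) (hk.pow_const (3 / 2 : ℝ))
  simp only [Pi.mul_apply] at h
  have e1 : ∀ a, (g a * k a) ^ (3 / 2 : ℝ) = g a ^ (3 / 2 : ℝ) * k a ^ (3 / 2 : ℝ) := fun a =>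
    ENNReal.mul_rpow_of_nonneg _ _ (by norm_num)
  have e2 : ∀ x : ℝ≥0∞, (x ^ (3 / 2 : ℝ)) ^ (2 : ℝ) = x ^ (3 : ℝ) := fun x => by
    rw [← ENNReal.rpow_mul]; norm_num
  simp only [e2] at h
  simp only [e1]
  exact h

/-- **Three-factor Hölder** with exponents `3, 3, 3`: `∫⁻ f g k ≤ (∫⁻ f³)^{1/3} (∫⁻ g³)^{1/3} (∫⁻ k³)^{1/3}`. [folklore] -/
theorem lintegral_mul_mul_le_L3 {f g k : α → ℝ≥0∞} (hf : AEMeasurable f μ) (hg : AEMeasurable g μ)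
    (hk : AEMeasurable k μ) :
    ∫⁻ a, f a * g a * k a ∂μ ≤
      (∫⁻ a, f a ^ (3 : ℝ) ∂μ) ^ (1 / 3 : ℝ) * (∫⁻ a, g a ^ (3 : ℝ) ∂μ) ^ (1 / 3 : ℝ) *
        (∫⁻ a, k a ^ (3 : ℝ) ∂μ) ^ (1 / 3 : ℝ) := by
  have h1 := lintegral_mul_le_L3_mul_L32 μ hf (hg.mul hk)
  have h2 := lintegral_mul_rpow_three_halves_le μ hg hk
  have e : ∀ a, f a * g a * k a = f a * (g a * k a) := fun a => mul_assoc _ _ _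
  simp only [e]
  refine h1.trans ?_
  rw [mul_assoc]
  gcongr
  calc (∫⁻ a, (g a * k a) ^ (3 / 2 : ℝ) ∂μ) ^ (2 / 3 : ℝ)
      ≤ ((∫⁻ a, g a ^ (3 : ℝ) ∂μ) ^ (1 / 2 : ℝ) * (∫⁻ a, k a ^ (3 : ℝ) ∂μ) ^ (1 / 2 : ℝ)) ^ (2 / 3 : ℝ) := by
        gcongr
    _ = (∫⁻ a, g a ^ (3 : ℝ) ∂μ) ^ (1 / 3 : ℝ) * (∫⁻ a, k a ^ (3 : ℝ) ∂μ) ^ (1 / 3 : ℝ) := by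
        rw [ENNReal.mul_rpow_of_nonneg _ _ (by norm_num), ← ENNReal.rpow_mul, ← ENNReal.rpow_mul]
        norm_num

end Holder

section Tonelli

variable {T : ℝ} {F : Type*} [NormedAddCommGroup F]

/-- Joint measurability of a translated space–time field on `((0,T) × T^d) × ℝ^d`:
`((t,x),ξ) ↦ u'(t, x + π(ξ))`. [folklore] -/
theorem aestronglyMeasurable_comp_stTranslate {u' : ℝ × UnitAddTorus d → F}
    (hu : AEStronglyMeasurable u' (((volume : Measure ℝ).restrict (Ioo 0 T)).prod (volume : Measure (UnitAddTorus d)))) :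
    AEStronglyMeasurable (fun q : (ℝ × UnitAddTorus d) × EuclideanSpace ℝ d => u' (stTranslate d q.2 q.1))
      ((((volume : Measure ℝ).restrict (Ioo 0 T)).prod (volume : Measure (UnitAddTorus d))).prod
        (volume : Measure (EuclideanSpace ℝ d))) := by
  have h := aestronglyMeasurable_translate (ν := (volume : Measure (EuclideanSpace ℝ d)))
    (u := curry u') (by simpa using hu) FunctionSpaces.Torus.measurable_proj
  exact h

/-- Measurability of a translated field at a fixed separation. [folklore] -/
theorem aestronglyMeasurable_comp_stTranslate_left {u' : ℝ × UnitAddTorus d → F}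
    (hu : AEStronglyMeasurable u' (((volume : Measure ℝ).restrict (Ioo 0 T)).prod (volume : Measure (UnitAddTorus d))))
    (ξ : EuclideanSpace ℝ d) :
    AEStronglyMeasurable (fun q => u' (stTranslate d ξ q))
      (((volume : Measure ℝ).restrict (Ioo 0 T)).prod (volume : Measure (UnitAddTorus d))) :=
  hu.comp_measurePreserving (measurePreserving_stTranslate _ ξ)

/-- The `L^r` mass of a translated field: `∫⁻ ‖u' ∘ S_ξ‖ₑ^r = ∫⁻ ‖u'‖ₑ^r` (measure preservation). [folklore] -/
theorem lintegral_enorm_rpow_comp_stTranslate (u' : ℝ × UnitAddTorus d → F) (r : ℝ) (ξ : EuclideanSpace ℝ d) :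
    ∫⁻ p, ‖u' (stTranslate d ξ p)‖ₑ ^ r ∂(((volume : Measure ℝ).restrict (Ioo 0 T)).prod (volume : Measure (UnitAddTorus d))) =
      ∫⁻ p, ‖u' p‖ₑ ^ r ∂(((volume : Measure ℝ).restrict (Ioo 0 T)).prod (volume : Measure (UnitAddTorus d))) := by
  have h := measurePreserving_stTranslate ((volume : Measure ℝ).restrict (Ioo 0 T)) ξ (d := d)
  have hemb : MeasurableEmbedding (stTranslate d ξ) := by
    have := (MeasurableEquiv.prodCongr (MeasurableEquiv.refl ℝ)
      (MeasurableEquiv.addRight (FunctionSpaces.Torus.proj ξ) :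
        UnitAddTorus d ≃ᵐ UnitAddTorus d)).measurableEmbedding
    convert this using 1
    funext p
    rfl
  exact h.lintegral_comp_emb hemb (fun p => ‖u' p‖ₑ ^ r)

/-- **Weighted Tonelli for translated fields** (real exponent):
`∫⁻ ((t,x),ξ) w(ξ) ‖u'(t, x + π(ξ))‖ₑ^r = (∫⁻ w) ∫⁻ ‖u'‖ₑ^r`. [folklore] -/
theorem lintegral_mul_enorm_rpow_comp_stTranslate {u' : ℝ × UnitAddTorus d → F}
    (hu : AEStronglyMeasurable u' (((volume : Measure ℝ).restrict (Ioo 0 T)).prod (volume : Measure (UnitAddTorus d))))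
    {w : EuclideanSpace ℝ d → ℝ≥0∞} (hw : AEMeasurable w volume) (r : ℝ) :
    ∫⁻ q, w q.2 * ‖u' (stTranslate d q.2 q.1)‖ₑ ^ r
        ∂((((volume : Measure ℝ).restrict (Ioo 0 T)).prod (volume : Measure (UnitAddTorus d))).prod
          (volume : Measure (EuclideanSpace ℝ d))) =
      (∫⁻ ξ, w ξ) * ∫⁻ p, ‖u' p‖ₑ ^ r ∂(((volume : Measure ℝ).restrict (Ioo 0 T)).prod (volume : Measure (UnitAddTorus d))) := by
  set ν := ((volume : Measure ℝ).restrict (Ioo 0 T)).prod (volume : Measure (UnitAddTorus d)) with hν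
  have hmeas : AEMeasurable (fun q : (ℝ × UnitAddTorus d) × EuclideanSpace ℝ d => w q.2 * ‖u' (stTranslate d q.2 q.1)‖ₑ ^ r)
      (ν.prod volume) :=
    (hw.comp_quasiMeasurePreserving quasiMeasurePreserving_snd).mul
      ((aestronglyMeasurable_comp_stTranslate hu).enorm.pow_const r)
  rw [lintegral_prod_symm _ hmeas]
  have hsec : ∀ ξ : EuclideanSpace ℝ d, ∫⁻ p, w ξ * ‖u' (stTranslate d ξ p)‖ₑ ^ r ∂ν = w ξ * ∫⁻ p, ‖u' p‖ₑ ^ r ∂ν := by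
    intro ξ
    have hm : AEStronglyMeasurable (fun p => u' (stTranslate d ξ p)) ν :=
      hu.comp_measurePreserving (measurePreserving_stTranslate _ ξ)
    rw [lintegral_const_mul'' _ (hm.enorm.pow_const r), lintegral_enorm_rpow_comp_stTranslate u' r ξ]
  simp only [hsec]
  rw [lintegral_mul_const'' _ hw]

/-- **Translation differences stay in `L^r`**: `∫⁻ ‖u' ∘ S_ξ − u'‖ₑ^r < ∞` for `u' ∈ L^r`, `r ≥ 1`. [folklore] -/
theorem lintegral_enorm_translate_sub_rpow_lt_top {u' : ℝ × UnitAddTorus d → F}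
    (hu : AEStronglyMeasurable u' (((volume : Measure ℝ).restrict (Ioo 0 T)).prod (volume : Measure (UnitAddTorus d))))
    {r : ℝ} (hr : 1 ≤ r)
    (hur : ∫⁻ q, ‖u' q‖ₑ ^ r ∂(((volume : Measure ℝ).restrict (Ioo 0 T)).prod (volume : Measure (UnitAddTorus d))) < ∞)
    (ξ : EuclideanSpace ℝ d) :
    ∫⁻ q, ‖u' (stTranslate d ξ q) - u' q‖ₑ ^ r
      ∂(((volume : Measure ℝ).restrict (Ioo 0 T)).prod (volume : Measure (UnitAddTorus d))) < ∞ := by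
  set ν := ((volume : Measure ℝ).restrict (Ioo 0 T)).prod (volume : Measure (UnitAddTorus d)) with hν
  have hr0 : 0 ≤ r := zero_le_one.trans hr
  have h1 : ∫⁻ q, ‖u' (stTranslate d ξ q) - u' q‖ₑ ^ r ∂ν ≤
      2 ^ (r - 1) * (∫⁻ q, ‖u' (stTranslate d ξ q)‖ₑ ^ r ∂ν + ∫⁻ q, ‖u' q‖ₑ ^ r ∂ν) := by
    calc ∫⁻ q, ‖u' (stTranslate d ξ q) - u' q‖ₑ ^ r ∂ν
        ≤ ∫⁻ q, 2 ^ (r - 1) * (‖u' (stTranslate d ξ q)‖ₑ ^ r + ‖u' q‖ₑ ^ r) ∂ν := by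
          refine lintegral_mono fun q => ?_
          exact (ENNReal.rpow_le_rpow (enorm_sub_le (E := F)) hr0).trans
            (ENNReal.rpow_add_le_mul_rpow_add_rpow _ _ hr)
      _ = _ := by
          rw [lintegral_const_mul' _ _ (ENNReal.rpow_ne_top_of_nonneg (by linarith) (by simp)),
            lintegral_add_left' ((aestronglyMeasurable_comp_stTranslate_left hu ξ).enorm.pow_const _)]
  refine h1.trans_lt ?_
  rw [lintegral_enorm_rpow_comp_stTranslate u' r ξ]
  exact ENNReal.mul_lt_top (ENNReal.rpow_lt_top_of_nonneg (by linarith) (by simp))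
    (ENNReal.add_lt_top.2 ⟨hur, hur⟩)

end Tonelli

/-! ## Kernel pairings on `((0,T) × T^d) × ℝ^d`: dominated integrability and the exchange estimate -/

section KernelPairing

variable {T : ℝ} {F₁ F₂ : Type*} [NormedAddCommGroup F₁] [NormedAddCommGroup F₂]

/-- **Dominated integrability of kernel pairings.** If `k ∈ L¹(ℝ^d)` and, for every separation
`ξ`, the translated factor `a ∘ S_ξ` pairs with `b` with a uniform bound
`∫⁻ ‖a(S_ξ p)‖ₑ ‖b(p)‖ₑ ≤ K < ∞` (Hölder and translation invariance in the applications), then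
`((t,x),ξ) ↦ |k(ξ)| ‖a(t, x+π(ξ))‖ ‖b(t,x)‖` is integrable on `((0,T) × T^d) × ℝ^d` (Tonelli). [folklore] -/
theorem integrable_kernel_mul_translate_mul {k : EuclideanSpace ℝ d → ℝ} (hk : Integrable k volume)
    {a : ℝ × UnitAddTorus d → F₁} {b : ℝ × UnitAddTorus d → F₂}
    (ha : AEStronglyMeasurable a (((volume : Measure ℝ).restrict (Ioo 0 T)).prod (volume : Measure (UnitAddTorus d))))
    (hb : AEStronglyMeasurable b (((volume : Measure ℝ).restrict (Ioo 0 T)).prod (volume : Measure (UnitAddTorus d))))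
    {K : ℝ≥0∞} (hK : K ≠ ∞)
    (hH : ∀ ξ : EuclideanSpace ℝ d, ∫⁻ p, ‖a (stTranslate d ξ p)‖ₑ * ‖b p‖ₑ
      ∂(((volume : Measure ℝ).restrict (Ioo 0 T)).prod (volume : Measure (UnitAddTorus d))) ≤ K) :
    Integrable (fun q : (ℝ × UnitAddTorus d) × EuclideanSpace ℝ d =>
        ‖k q.2‖ * (‖a (stTranslate d q.2 q.1)‖ * ‖b q.1‖))
      ((((volume : Measure ℝ).restrict (Ioo 0 T)).prod (volume : Measure (UnitAddTorus d))).prod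
        (volume : Measure (EuclideanSpace ℝ d))) := by
  set ν := ((volume : Measure ℝ).restrict (Ioo 0 T)).prod (volume : Measure (UnitAddTorus d)) with hν
  have hkm : AEStronglyMeasurable (fun q : (ℝ × UnitAddTorus d) × EuclideanSpace ℝ d => k q.2) (ν.prod volume) :=
    hk.aestronglyMeasurable.comp_snd
  have ham : AEStronglyMeasurable (fun q : (ℝ × UnitAddTorus d) × EuclideanSpace ℝ d => a (stTranslate d q.2 q.1))
      (ν.prod volume) := aestronglyMeasurable_comp_stTranslate ha
  have hbm : AEStronglyMeasurable (fun q : (ℝ × UnitAddTorus d) × EuclideanSpace ℝ d => b q.1) (ν.prod volume) :=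
    hb.comp_fst
  refine ⟨hkm.norm.mul (ham.norm.mul hbm.norm), ?_⟩
  simp only [HasFiniteIntegral, enorm_mul, enorm_norm]
  have hmeas : AEMeasurable (fun q : (ℝ × UnitAddTorus d) × EuclideanSpace ℝ d =>
      ‖k q.2‖ₑ * (‖a (stTranslate d q.2 q.1)‖ₑ * ‖b q.1‖ₑ)) (ν.prod volume) :=
    hkm.enorm.mul (ham.enorm.mul hbm.enorm)
  rw [lintegral_prod_symm _ hmeas]
  calc ∫⁻ ξ, ∫⁻ p, ‖k ξ‖ₑ * (‖a (stTranslate d ξ p)‖ₑ * ‖b p‖ₑ) ∂ν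
      = ∫⁻ ξ, ‖k ξ‖ₑ * ∫⁻ p, ‖a (stTranslate d ξ p)‖ₑ * ‖b p‖ₑ ∂ν := by
        refine lintegral_congr fun ξ => ?_
        rw [lintegral_const_mul'' _ ?_]
        exact ((ha.comp_measurePreserving (measurePreserving_stTranslate _ ξ)).enorm.mul hb.enorm)
    _ ≤ ∫⁻ ξ, ‖k ξ‖ₑ * K := lintegral_mono fun ξ => mul_le_mul' le_rfl (hH ξ)
    _ = (∫⁻ ξ, ‖k ξ‖ₑ) * K := lintegral_mul_const'' _ hk.aestronglyMeasurable.enorm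
    _ < ∞ := ENNReal.mul_lt_top hk.2 hK.lt_top

/-- Untranslated kernel pairings: `((t,x),ξ) ↦ |k(ξ)| g(t,x)` is integrable for `k ∈ L¹(ℝ^d)`,
`g ∈ L¹((0,T) × T^d)`. [folklore] -/
theorem integrable_kernel_mul_base {k : EuclideanSpace ℝ d → ℝ} (hk : Integrable k volume)
    {g : ℝ × UnitAddTorus d → ℝ}
    (hg : Integrable g (((volume : Measure ℝ).restrict (Ioo 0 T)).prod (volume : Measure (UnitAddTorus d)))) :
    Integrable (fun q : (ℝ × UnitAddTorus d) × EuclideanSpace ℝ d => ‖k q.2‖ * g q.1)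
      ((((volume : Measure ℝ).restrict (Ioo 0 T)).prod (volume : Measure (UnitAddTorus d))).prod
        (volume : Measure (EuclideanSpace ℝ d))) := by
  have := hg.mul_prod hk.norm
  refine this.congr (ae_of_all _ fun q => ?_)
  simp only
  ring

/-- **The exchange estimate.** For a kernel `k ∈ L¹(ℝ^d)` vanishing off the closed ball of radius
`ε`, and two kernel-free integrands `G`, `G₀` on `((0,T) × T^d) × ℝ^d` whose pairings with `k` are
integrable, a uniform bound `|∫ (G − G₀)(·,ξ)| ≤ M` over `|ξ| ≤ ε` gives
`|∫∫ k G − ∫∫ k G₀| ≤ M ∫|k|` (Fubini: `∫∫ k(G − G₀) = ∫ k(ξ) [∫ (G − G₀)(·,ξ)] dξ`). This is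
the mechanism of Eyink's bounds (norm-uL-thirdu), (norm-pT-twothirdp): the error is an average,
weighted by the kernel, of translation differences. [folklore] -/
theorem abs_integral_kernel_mul_sub_le {k : EuclideanSpace ℝ d → ℝ} (hk : Integrable k volume)
    {G G₀ : (ℝ × UnitAddTorus d) × EuclideanSpace ℝ d → ℝ} {ε M : ℝ}
    (hkG : Integrable (fun q => k q.2 * G q)
      ((((volume : Measure ℝ).restrict (Ioo 0 T)).prod (volume : Measure (UnitAddTorus d))).prod
        (volume : Measure (EuclideanSpace ℝ d))))
    (hkG₀ : Integrable (fun q => k q.2 * G₀ q)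
      ((((volume : Measure ℝ).restrict (Ioo 0 T)).prod (volume : Measure (UnitAddTorus d))).prod
        (volume : Measure (EuclideanSpace ℝ d))))
    (hksupp : ∀ ξ, ε < ‖ξ‖ → k ξ = 0)
    (hM : ∀ ξ : EuclideanSpace ℝ d, ‖ξ‖ ≤ ε →
      |∫ p, (G (p, ξ) - G₀ (p, ξ)) ∂(((volume : Measure ℝ).restrict (Ioo 0 T)).prod (volume : Measure (UnitAddTorus d)))| ≤ M) :
    |(∫ q, k q.2 * G q ∂((((volume : Measure ℝ).restrict (Ioo 0 T)).prod (volume : Measure (UnitAddTorus d))).prod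
        (volume : Measure (EuclideanSpace ℝ d)))) -
      ∫ q, k q.2 * G₀ q ∂((((volume : Measure ℝ).restrict (Ioo 0 T)).prod (volume : Measure (UnitAddTorus d))).prod
        (volume : Measure (EuclideanSpace ℝ d)))| ≤ M * ∫ ξ, |k ξ| := by
  set ν := ((volume : Measure ℝ).restrict (Ioo 0 T)).prod (volume : Measure (UnitAddTorus d)) with hν
  have hdiff : Integrable (fun q : (ℝ × UnitAddTorus d) × EuclideanSpace ℝ d => k q.2 * (G q - G₀ q)) (ν.prod volume) := by
    refine (hkG.sub hkG₀).congr (ae_of_all _ fun q => ?_)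
    simp only [Pi.sub_apply]
    ring
  rw [← integral_sub hkG hkG₀]
  have e1 : ∫ q, (k q.2 * G q - k q.2 * G₀ q) ∂(ν.prod volume) = ∫ q, k q.2 * (G q - G₀ q) ∂(ν.prod volume) :=
    integral_congr_ae (ae_of_all _ fun q => by ring)
  rw [e1, integral_prod_symm _ hdiff]
  have e2 : ∀ ξ : EuclideanSpace ℝ d, ∫ p, k ξ * (G (p, ξ) - G₀ (p, ξ)) ∂ν = k ξ * ∫ p, (G (p, ξ) - G₀ (p, ξ)) ∂ν :=
    fun ξ => integral_const_mul _ _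
  simp only [e2]
  calc |∫ ξ, k ξ * ∫ p, (G (p, ξ) - G₀ (p, ξ)) ∂ν|
      ≤ ∫ ξ, |k ξ * ∫ p, (G (p, ξ) - G₀ (p, ξ)) ∂ν| := by
        rw [← Real.norm_eq_abs]
        exact (norm_integral_le_integral_norm _).trans_eq (by simp only [Real.norm_eq_abs])
    _ ≤ ∫ ξ, M * |k ξ| := by
        refine integral_mono_of_nonneg (ae_of_all _ fun ξ => abs_nonneg _) (hk.abs.const_mul M)
          (ae_of_all _ fun ξ => ?_)
        simp only
        rw [abs_mul]
        by_cases hξ : ‖ξ‖ ≤ ε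
        · calc |k ξ| * |∫ p, (G (p, ξ) - G₀ (p, ξ)) ∂ν| ≤ |k ξ| * M :=
              mul_le_mul_of_nonneg_left (hM ξ hξ) (abs_nonneg _)
            _ = M * |k ξ| := mul_comm _ _
        · rw [hksupp ξ (not_le.1 hξ), abs_zero, zero_mul, mul_zero]
    _ = M * ∫ ξ, |k ξ| := integral_const_mul _ _

end KernelPairing

/-! ## Hölder bounds for products on `(0,T) × T^d` (integral form) -/

section HolderReal

variable {α : Type*} [MeasurableSpace α] {μ : Measure α}
  {F₁ F₂ F₃ : Type*} [NormedAddCommGroup F₁] [NormedAddCommGroup F₂] [NormedAddCommGroup F₃]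

/-- **Hölder `3, 3/2` in integral form**: for `f ∈ L³`, `g ∈ L^{3/2}` the product of norms is
integrable and `∫ ‖f‖‖g‖ ≤ (∫⁻‖f‖ₑ³)^{1/3} (∫⁻‖g‖ₑ^{3/2})^{2/3}` (as real numbers). [folklore] -/
theorem integrable_norm_mul_norm_of_L3_L32 {f : α → F₁} {g : α → F₂}
    (hf : AEStronglyMeasurable f μ) (hf3 : ∫⁻ a, ‖f a‖ₑ ^ (3 : ℝ) ∂μ < ∞)
    (hg : AEStronglyMeasurable g μ) (hg32 : ∫⁻ a, ‖g a‖ₑ ^ (3 / 2 : ℝ) ∂μ < ∞) :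
    Integrable (fun a => ‖f a‖ * ‖g a‖) μ ∧
      ∫ a, ‖f a‖ * ‖g a‖ ∂μ ≤
        ((∫⁻ a, ‖f a‖ₑ ^ (3 : ℝ) ∂μ) ^ (1 / 3 : ℝ) * (∫⁻ a, ‖g a‖ₑ ^ (3 / 2 : ℝ) ∂μ) ^ (2 / 3 : ℝ)).toReal := by
  have hH := lintegral_mul_le_L3_mul_L32 μ hf.enorm hg.enorm
  have hfin : (∫⁻ a, ‖f a‖ₑ ^ (3 : ℝ) ∂μ) ^ (1 / 3 : ℝ) * (∫⁻ a, ‖g a‖ₑ ^ (3 / 2 : ℝ) ∂μ) ^ (2 / 3 : ℝ) < ∞ :=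
    ENNReal.mul_lt_top (ENNReal.rpow_lt_top_of_nonneg (by norm_num) hf3.ne)
      (ENNReal.rpow_lt_top_of_nonneg (by norm_num) hg32.ne)
  have hint : Integrable (fun a => ‖f a‖ * ‖g a‖) μ := by
    refine ⟨hf.norm.mul hg.norm, ?_⟩
    simp only [HasFiniteIntegral, enorm_mul, enorm_norm]
    exact hH.trans_lt hfin
  refine ⟨hint, ?_⟩
  rw [integral_eq_lintegral_of_nonneg_ae (ae_of_all _ fun a => mul_nonneg (norm_nonneg _) (norm_nonneg _))
    hint.aestronglyMeasurable]
  have e : ∀ a, ENNReal.ofReal (‖f a‖ * ‖g a‖) = ‖f a‖ₑ * ‖g a‖ₑ := fun a => by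
    rw [ENNReal.ofReal_mul (norm_nonneg _), ofReal_norm, ofReal_norm]
  simp only [e]
  exact ENNReal.toReal_mono hfin.ne hH

/-- **Three-factor Hölder in integral form**: for `f, g, h ∈ L³` the product of norms is integrable
and `∫ ‖f‖‖g‖‖h‖ ≤ (∫⁻‖f‖ₑ³)^{1/3} (∫⁻‖g‖ₑ³)^{1/3} (∫⁻‖h‖ₑ³)^{1/3}`. [folklore] -/
theorem integrable_norm_mul_norm_mul_norm_of_L3 {f : α → F₁} {g : α → F₂} {h : α → F₃}
    (hf : AEStronglyMeasurable f μ) (hf3 : ∫⁻ a, ‖f a‖ₑ ^ (3 : ℝ) ∂μ < ∞)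
    (hg : AEStronglyMeasurable g μ) (hg3 : ∫⁻ a, ‖g a‖ₑ ^ (3 : ℝ) ∂μ < ∞)
    (hh : AEStronglyMeasurable h μ) (hh3 : ∫⁻ a, ‖h a‖ₑ ^ (3 : ℝ) ∂μ < ∞) :
    Integrable (fun a => ‖f a‖ * ‖g a‖ * ‖h a‖) μ ∧
      ∫ a, ‖f a‖ * ‖g a‖ * ‖h a‖ ∂μ ≤
        ((∫⁻ a, ‖f a‖ₑ ^ (3 : ℝ) ∂μ) ^ (1 / 3 : ℝ) * (∫⁻ a, ‖g a‖ₑ ^ (3 : ℝ) ∂μ) ^ (1 / 3 : ℝ) *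
          (∫⁻ a, ‖h a‖ₑ ^ (3 : ℝ) ∂μ) ^ (1 / 3 : ℝ)).toReal := by
  have hH := lintegral_mul_mul_le_L3 μ hf.enorm hg.enorm hh.enorm
  have hfin : (∫⁻ a, ‖f a‖ₑ ^ (3 : ℝ) ∂μ) ^ (1 / 3 : ℝ) * (∫⁻ a, ‖g a‖ₑ ^ (3 : ℝ) ∂μ) ^ (1 / 3 : ℝ) *
      (∫⁻ a, ‖h a‖ₑ ^ (3 : ℝ) ∂μ) ^ (1 / 3 : ℝ) < ∞ :=
    ENNReal.mul_lt_top (ENNReal.mul_lt_top (ENNReal.rpow_lt_top_of_nonneg (by norm_num) hf3.ne)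
      (ENNReal.rpow_lt_top_of_nonneg (by norm_num) hg3.ne)) (ENNReal.rpow_lt_top_of_nonneg (by norm_num) hh3.ne)
  have hint : Integrable (fun a => ‖f a‖ * ‖g a‖ * ‖h a‖) μ := by
    refine ⟨(hf.norm.mul hg.norm).mul hh.norm, ?_⟩
    simp only [HasFiniteIntegral, enorm_mul, enorm_norm]
    exact hH.trans_lt hfin
  refine ⟨hint, ?_⟩
  rw [integral_eq_lintegral_of_nonneg_ae (ae_of_all _ fun a => by positivity) hint.aestronglyMeasurable]
  have e : ∀ a, ENNReal.ofReal (‖f a‖ * ‖g a‖ * ‖h a‖) = ‖f a‖ₑ * ‖g a‖ₑ * ‖h a‖ₑ := fun a => by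
    rw [ENNReal.ofReal_mul (by positivity), ENNReal.ofReal_mul (norm_nonneg _), ofReal_norm, ofReal_norm, ofReal_norm]
  simp only [e]
  exact ENNReal.toReal_mono hfin.ne hH

end HolderReal

/-! ## The four difference estimates (translated versus untranslated integrands) -/

section Differences

variable {α : Type*} [MeasurableSpace α] {μ : Measure α}
  {E' : Type*} [NormedAddCommGroup E'] [InnerProductSpace ℝ E']

/-- **Type I difference** (linear in the translated velocity): for a bounded operator `A`
(`‖Av‖ ≤ C_A‖v‖`), `X, Y ∈ L³` and `c ∈ L^{3/2}`,
`|∫ ⟪AX, c⟫ − ⟪AY, c⟫| ≤ C_A (∫⁻‖X − Y‖ₑ³)^{1/3} (∫⁻‖c‖ₑ^{3/2})^{2/3}`. [folklore] -/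
theorem abs_integral_inner_sub_inner_le {X Y c : α → E'} (A : E' →L[ℝ] E') {CA : ℝ} (hCA : 0 ≤ CA)
    (hA : ∀ v, ‖A v‖ ≤ CA * ‖v‖)
    (hX : AEStronglyMeasurable X μ) (hY : AEStronglyMeasurable Y μ)
    (hXY3 : ∫⁻ a, ‖X a - Y a‖ₑ ^ (3 : ℝ) ∂μ < ∞)
    (hc : AEStronglyMeasurable c μ) (hc32 : ∫⁻ a, ‖c a‖ₑ ^ (3 / 2 : ℝ) ∂μ < ∞) :
    |∫ a, (⟪A (X a), c a⟫ - ⟪A (Y a), c a⟫) ∂μ| ≤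
      CA * ((∫⁻ a, ‖X a - Y a‖ₑ ^ (3 : ℝ) ∂μ) ^ (1 / 3 : ℝ) *
        (∫⁻ a, ‖c a‖ₑ ^ (3 / 2 : ℝ) ∂μ) ^ (2 / 3 : ℝ)).toReal := by
  have hXY : AEStronglyMeasurable (fun a => X a - Y a) μ := hX.sub hY
  obtain ⟨hint, hle⟩ := integrable_norm_mul_norm_of_L3_L32 hXY hXY3 hc hc32
  calc |∫ a, (⟪A (X a), c a⟫ - ⟪A (Y a), c a⟫) ∂μ|
      ≤ ∫ a, |⟪A (X a), c a⟫ - ⟪A (Y a), c a⟫| ∂μ := abs_integral_le_integral_abs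
    _ ≤ ∫ a, CA * (‖X a - Y a‖ * ‖c a‖) ∂μ := by
        refine integral_mono_of_nonneg (ae_of_all _ fun a => abs_nonneg _) (hint.const_mul CA)
          (ae_of_all _ fun a => ?_)
        simp only
        rw [← inner_sub_left, ← map_sub]
        calc |⟪A (X a - Y a), c a⟫| ≤ ‖A (X a - Y a)‖ * ‖c a‖ := abs_real_inner_le_norm _ _
          _ ≤ CA * ‖X a - Y a‖ * ‖c a‖ := by gcongr; exact hA _
          _ = CA * (‖X a - Y a‖ * ‖c a‖) := mul_assoc _ _ _
    _ = CA * ∫ a, ‖X a - Y a‖ * ‖c a‖ ∂μ := integral_const_mul _ _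
    _ ≤ _ := mul_le_mul_of_nonneg_left hle hCA

/-- **Type II difference** (quadratic in the translated velocity, weight in `L³`):
`|∫ (‖AX‖² − ‖AY‖²) G| ≤ C_A² [N(X−Y)N(X)N(G) + N(X−Y)N(Y)N(G)]`, `N(f) = (∫⁻‖f‖ₑ³)^{1/3}`. [folklore] -/
theorem abs_integral_normSq_sub_normSq_mul_le {X Y : α → E'} {G : α → ℝ} (A : E' →L[ℝ] E') {CA : ℝ}
    (hCA : 0 ≤ CA) (hA : ∀ v, ‖A v‖ ≤ CA * ‖v‖)
    (hX : AEStronglyMeasurable X μ) (hX3 : ∫⁻ a, ‖X a‖ₑ ^ (3 : ℝ) ∂μ < ∞)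
    (hY : AEStronglyMeasurable Y μ) (hY3 : ∫⁻ a, ‖Y a‖ₑ ^ (3 : ℝ) ∂μ < ∞)
    (hXY3 : ∫⁻ a, ‖X a - Y a‖ₑ ^ (3 : ℝ) ∂μ < ∞)
    (hG : AEStronglyMeasurable G μ) (hG3 : ∫⁻ a, ‖G a‖ₑ ^ (3 : ℝ) ∂μ < ∞) :
    |∫ a, (‖A (X a)‖ ^ 2 - ‖A (Y a)‖ ^ 2) * G a ∂μ| ≤
      CA ^ 2 * (((∫⁻ a, ‖X a - Y a‖ₑ ^ (3 : ℝ) ∂μ) ^ (1 / 3 : ℝ) * (∫⁻ a, ‖X a‖ₑ ^ (3 : ℝ) ∂μ) ^ (1 / 3 : ℝ) *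
          (∫⁻ a, ‖G a‖ₑ ^ (3 : ℝ) ∂μ) ^ (1 / 3 : ℝ)).toReal +
        ((∫⁻ a, ‖X a - Y a‖ₑ ^ (3 : ℝ) ∂μ) ^ (1 / 3 : ℝ) * (∫⁻ a, ‖Y a‖ₑ ^ (3 : ℝ) ∂μ) ^ (1 / 3 : ℝ) *
          (∫⁻ a, ‖G a‖ₑ ^ (3 : ℝ) ∂μ) ^ (1 / 3 : ℝ)).toReal) := by
  have hXY : AEStronglyMeasurable (fun a => X a - Y a) μ := hX.sub hY
  obtain ⟨hint1, hle1⟩ := integrable_norm_mul_norm_mul_norm_of_L3 hXY hXY3 hX hX3 hG hG3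
  obtain ⟨hint2, hle2⟩ := integrable_norm_mul_norm_mul_norm_of_L3 hXY hXY3 hY hY3 hG hG3
  calc |∫ a, (‖A (X a)‖ ^ 2 - ‖A (Y a)‖ ^ 2) * G a ∂μ|
      ≤ ∫ a, |(‖A (X a)‖ ^ 2 - ‖A (Y a)‖ ^ 2) * G a| ∂μ := abs_integral_le_integral_abs
    _ ≤ ∫ a, CA ^ 2 * (‖X a - Y a‖ * ‖X a‖ * ‖G a‖ + ‖X a - Y a‖ * ‖Y a‖ * ‖G a‖) ∂μ := by
        refine integral_mono_of_nonneg (ae_of_all _ fun a => abs_nonneg _) ((hint1.add hint2).const_mul _)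
          (ae_of_all _ fun a => ?_)
        simp only
        have hdiff : |‖A (X a)‖ - ‖A (Y a)‖| ≤ CA * ‖X a - Y a‖ := by
          calc |‖A (X a)‖ - ‖A (Y a)‖| ≤ ‖A (X a) - A (Y a)‖ := abs_norm_sub_norm_le _ _
            _ = ‖A (X a - Y a)‖ := by rw [map_sub]
            _ ≤ CA * ‖X a - Y a‖ := hA _
        have hsum : ‖A (X a)‖ + ‖A (Y a)‖ ≤ CA * ‖X a‖ + CA * ‖Y a‖ := add_le_add (hA _) (hA _)
        rw [abs_mul, sq_sub_sq, abs_mul, abs_of_nonneg (by positivity : 0 ≤ ‖A (X a)‖ + ‖A (Y a)‖)]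
        rw [Real.norm_eq_abs]
        calc (‖A (X a)‖ + ‖A (Y a)‖) * |‖A (X a)‖ - ‖A (Y a)‖| * |G a|
            ≤ (CA * ‖X a‖ + CA * ‖Y a‖) * (CA * ‖X a - Y a‖) * |G a| := by gcongr
          _ = CA ^ 2 * (‖X a - Y a‖ * ‖X a‖ * |G a| + ‖X a - Y a‖ * ‖Y a‖ * |G a|) := by ring
    _ = CA ^ 2 * ((∫ a, ‖X a - Y a‖ * ‖X a‖ * ‖G a‖ ∂μ) + ∫ a, ‖X a - Y a‖ * ‖Y a‖ * ‖G a‖ ∂μ) := by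
        rw [integral_const_mul, ← integral_add hint1 hint2]
    _ ≤ _ := by gcongr

/-- **Type III difference** (cubic in the translated velocity, bounded weight `‖H‖ ≤ C_H`):
`|∫ ‖AX‖²⟪X,H⟫ − ‖AY‖²⟪Y,H⟫| ≤ C_A² C_H [N(X−Y)(N(X)² + N(X)N(Y) + N(Y)²)]`. [folklore] -/
theorem abs_integral_normSq_mul_inner_sub_le {X Y H : α → E'} (A : E' →L[ℝ] E') {CA CH : ℝ}
    (hCA : 0 ≤ CA) (hA : ∀ v, ‖A v‖ ≤ CA * ‖v‖) (hCH : 0 ≤ CH) (hH : ∀ a, ‖H a‖ ≤ CH)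
    (hX : AEStronglyMeasurable X μ) (hX3 : ∫⁻ a, ‖X a‖ₑ ^ (3 : ℝ) ∂μ < ∞)
    (hY : AEStronglyMeasurable Y μ) (hY3 : ∫⁻ a, ‖Y a‖ₑ ^ (3 : ℝ) ∂μ < ∞)
    (hXY3 : ∫⁻ a, ‖X a - Y a‖ₑ ^ (3 : ℝ) ∂μ < ∞) :
    |∫ a, (‖A (X a)‖ ^ 2 * ⟪X a, H a⟫ - ‖A (Y a)‖ ^ 2 * ⟪Y a, H a⟫) ∂μ| ≤
      CA ^ 2 * CH *
        (((∫⁻ a, ‖X a - Y a‖ₑ ^ (3 : ℝ) ∂μ) ^ (1 / 3 : ℝ) * (∫⁻ a, ‖X a‖ₑ ^ (3 : ℝ) ∂μ) ^ (1 / 3 : ℝ) *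
            (∫⁻ a, ‖X a‖ₑ ^ (3 : ℝ) ∂μ) ^ (1 / 3 : ℝ)).toReal +
          ((∫⁻ a, ‖X a - Y a‖ₑ ^ (3 : ℝ) ∂μ) ^ (1 / 3 : ℝ) * (∫⁻ a, ‖X a‖ₑ ^ (3 : ℝ) ∂μ) ^ (1 / 3 : ℝ) *
            (∫⁻ a, ‖Y a‖ₑ ^ (3 : ℝ) ∂μ) ^ (1 / 3 : ℝ)).toReal +
          2 * ((∫⁻ a, ‖X a - Y a‖ₑ ^ (3 : ℝ) ∂μ) ^ (1 / 3 : ℝ) * (∫⁻ a, ‖Y a‖ₑ ^ (3 : ℝ) ∂μ) ^ (1 / 3 : ℝ) *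
            (∫⁻ a, ‖Y a‖ₑ ^ (3 : ℝ) ∂μ) ^ (1 / 3 : ℝ)).toReal) := by
  have hXY : AEStronglyMeasurable (fun a => X a - Y a) μ := hX.sub hY
  obtain ⟨hint1, hle1⟩ := integrable_norm_mul_norm_mul_norm_of_L3 hXY hXY3 hX hX3 hX hX3
  obtain ⟨hint2, hle2⟩ := integrable_norm_mul_norm_mul_norm_of_L3 hXY hXY3 hX hX3 hY hY3
  obtain ⟨hint3, hle3⟩ := integrable_norm_mul_norm_mul_norm_of_L3 hXY hXY3 hY hY3 hY hY3
  calc |∫ a, (‖A (X a)‖ ^ 2 * ⟪X a, H a⟫ - ‖A (Y a)‖ ^ 2 * ⟪Y a, H a⟫) ∂μ|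
      ≤ ∫ a, |‖A (X a)‖ ^ 2 * ⟪X a, H a⟫ - ‖A (Y a)‖ ^ 2 * ⟪Y a, H a⟫| ∂μ := abs_integral_le_integral_abs
    _ ≤ ∫ a, CA ^ 2 * CH * (‖X a - Y a‖ * ‖X a‖ * ‖X a‖ + ‖X a - Y a‖ * ‖X a‖ * ‖Y a‖ +
          2 * (‖X a - Y a‖ * ‖Y a‖ * ‖Y a‖)) ∂μ := by
        refine integral_mono_of_nonneg (ae_of_all _ fun a => abs_nonneg _)
          (((hint1.add hint2).add (hint3.const_mul 2)).const_mul _) (ae_of_all _ fun a => ?_)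
        simp only
        -- `‖AX‖²⟪X,H⟫ − ‖AY‖²⟪Y,H⟫ = (‖AX‖² − ‖AY‖²)⟪X,H⟫ + ‖AY‖²⟪X − Y, H⟫`
        have hsplit : ‖A (X a)‖ ^ 2 * ⟪X a, H a⟫ - ‖A (Y a)‖ ^ 2 * ⟪Y a, H a⟫ =
            (‖A (X a)‖ ^ 2 - ‖A (Y a)‖ ^ 2) * ⟪X a, H a⟫ + ‖A (Y a)‖ ^ 2 * ⟪X a - Y a, H a⟫ := by
          rw [inner_sub_left]; ring
        have hdiff : |‖A (X a)‖ - ‖A (Y a)‖| ≤ CA * ‖X a - Y a‖ := by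
          calc |‖A (X a)‖ - ‖A (Y a)‖| ≤ ‖A (X a) - A (Y a)‖ := abs_norm_sub_norm_le _ _
            _ = ‖A (X a - Y a)‖ := by rw [map_sub]
            _ ≤ CA * ‖X a - Y a‖ := hA _
        have hAY : ‖A (Y a)‖ ≤ CA * ‖Y a‖ := hA _
        have hAX : ‖A (X a)‖ ≤ CA * ‖X a‖ := hA _
        have hXH : |⟪X a, H a⟫| ≤ ‖X a‖ * CH :=
          (abs_real_inner_le_norm _ _).trans (mul_le_mul_of_nonneg_left (hH a) (norm_nonneg _))
        have h1 : |(‖A (X a)‖ ^ 2 - ‖A (Y a)‖ ^ 2) * ⟪X a, H a⟫| ≤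
            (CA * ‖X a‖ + CA * ‖Y a‖) * (CA * ‖X a - Y a‖) * (‖X a‖ * CH) := by
          rw [abs_mul, sq_sub_sq, abs_mul, abs_of_nonneg (by positivity : 0 ≤ ‖A (X a)‖ + ‖A (Y a)‖)]
          exact mul_le_mul (mul_le_mul (add_le_add hAX hAY) hdiff (abs_nonneg _) (by positivity)) hXH
            (abs_nonneg _) (by positivity)
        have h2 : |‖A (Y a)‖ ^ 2 * ⟪X a - Y a, H a⟫| ≤ (CA * ‖Y a‖) ^ 2 * (‖X a - Y a‖ * CH) := by
          rw [abs_mul, abs_of_nonneg (sq_nonneg _)]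
          gcongr
          exact (abs_real_inner_le_norm _ _).trans (by gcongr; exact hH a)
        rw [hsplit]
        calc |(‖A (X a)‖ ^ 2 - ‖A (Y a)‖ ^ 2) * ⟪X a, H a⟫ + ‖A (Y a)‖ ^ 2 * ⟪X a - Y a, H a⟫|
            ≤ |(‖A (X a)‖ ^ 2 - ‖A (Y a)‖ ^ 2) * ⟪X a, H a⟫| + |‖A (Y a)‖ ^ 2 * ⟪X a - Y a, H a⟫| :=
              abs_add_le _ _
          _ ≤ (CA * ‖X a‖ + CA * ‖Y a‖) * (CA * ‖X a - Y a‖) * (‖X a‖ * CH) +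
                (CA * ‖Y a‖) ^ 2 * (‖X a - Y a‖ * CH) := add_le_add h1 h2
          _ ≤ CA ^ 2 * CH * (‖X a - Y a‖ * ‖X a‖ * ‖X a‖ + ‖X a - Y a‖ * ‖X a‖ * ‖Y a‖ +
                2 * (‖X a - Y a‖ * ‖Y a‖ * ‖Y a‖)) := by
              nlinarith [norm_nonneg (X a - Y a), norm_nonneg (X a), norm_nonneg (Y a),
                mul_nonneg (mul_nonneg (sq_nonneg CA) hCH)
                  (mul_nonneg (mul_nonneg (norm_nonneg (X a - Y a)) (norm_nonneg (Y a))) (norm_nonneg (Y a)))]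
    _ = CA ^ 2 * CH * ((∫ a, ‖X a - Y a‖ * ‖X a‖ * ‖X a‖ ∂μ) + (∫ a, ‖X a - Y a‖ * ‖X a‖ * ‖Y a‖ ∂μ) +
          2 * ∫ a, ‖X a - Y a‖ * ‖Y a‖ * ‖Y a‖ ∂μ) := by
        have e1 : ∫ a, (‖X a - Y a‖ * ‖X a‖ * ‖X a‖ + ‖X a - Y a‖ * ‖X a‖ * ‖Y a‖ +
            2 * (‖X a - Y a‖ * ‖Y a‖ * ‖Y a‖)) ∂μ =
            (∫ a, (‖X a - Y a‖ * ‖X a‖ * ‖X a‖ + ‖X a - Y a‖ * ‖X a‖ * ‖Y a‖) ∂μ) +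
              ∫ a, 2 * (‖X a - Y a‖ * ‖Y a‖ * ‖Y a‖) ∂μ :=
          integral_add (hint1.add hint2) (hint3.const_mul 2)
        rw [integral_const_mul, e1, integral_add hint1 hint2, integral_const_mul]
    _ ≤ _ := by gcongr

/-- **Type IV difference** (linear in the translated pressure, weight in `L³`):
`|∫ (X − Y) G| ≤ (∫⁻‖X − Y‖ₑ^{3/2})^{2/3} (∫⁻‖G‖ₑ³)^{1/3}`. [folklore] -/
theorem abs_integral_sub_mul_le {X Y G : α → ℝ}
    (hX : AEStronglyMeasurable X μ) (hY : AEStronglyMeasurable Y μ)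
    (hXY : ∫⁻ a, ‖X a - Y a‖ₑ ^ (3 / 2 : ℝ) ∂μ < ∞)
    (hG : AEStronglyMeasurable G μ) (hG3 : ∫⁻ a, ‖G a‖ₑ ^ (3 : ℝ) ∂μ < ∞) :
    |∫ a, (X a - Y a) * G a ∂μ| ≤
      ((∫⁻ a, ‖G a‖ₑ ^ (3 : ℝ) ∂μ) ^ (1 / 3 : ℝ) * (∫⁻ a, ‖X a - Y a‖ₑ ^ (3 / 2 : ℝ) ∂μ) ^ (2 / 3 : ℝ)).toReal := by
  have hXY' : AEStronglyMeasurable (fun a => X a - Y a) μ := hX.sub hY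
  obtain ⟨hint, hle⟩ := integrable_norm_mul_norm_of_L3_L32 hG hG3 hXY' hXY
  calc |∫ a, (X a - Y a) * G a ∂μ| ≤ ∫ a, |(X a - Y a) * G a| ∂μ := abs_integral_le_integral_abs
    _ = ∫ a, ‖G a‖ * ‖X a - Y a‖ ∂μ := by
        refine integral_congr_ae (ae_of_all _ fun a => ?_)
        simp only [abs_mul, Real.norm_eq_abs]
        ring
    _ ≤ _ := hle

end Differences

/-! ## Kernels: rescaling, support in the ball of radius `ε`, the transverse kernel -/

section Kernels

/-- **Rescaling preserves the integral** of any kernel: `∫ g^ε = ∫ g` for `ε > 0`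
(`g^ε = ε^{-d} g(·/ε)`, `FluidPDE.mollifierScale`). [folklore] -/
theorem integral_mollifierScale_eq (g : EuclideanSpace ℝ d → ℝ) {ε : ℝ} (hε : 0 < ε) :
    ∫ ξ, FluidPDE.mollifierScale ε g ξ = ∫ ξ, g ξ := by
  simp only [FluidPDE.mollifierScale]
  rw [integral_const_mul, Measure.integral_comp_inv_smul_of_nonneg volume g hε.le, finrank_euclideanSpace,
    smul_eq_mul, ← mul_assoc, inv_mul_cancel₀ (pow_ne_zero _ hε.ne'), one_mul]

/-- Rescaling commutes with absolute values: `|g^ε| = |g|^ε` for `ε > 0`. [folklore] -/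
theorem abs_mollifierScale (g : EuclideanSpace ℝ d → ℝ) {ε : ℝ} (hε : 0 < ε) (ξ : EuclideanSpace ℝ d) :
    |FluidPDE.mollifierScale ε g ξ| = FluidPDE.mollifierScale ε (fun η => |g η|) ξ := by
  rw [FluidPDE.mollifierScale_apply, FluidPDE.mollifierScale_apply, abs_mul,
    abs_of_nonneg (inv_nonneg.2 (pow_nonneg hε.le _))]

/-- `∫ |g^ε| = ∫ |g|` for `ε > 0`. [folklore] -/
theorem integral_abs_mollifierScale (g : EuclideanSpace ℝ d → ℝ) {ε : ℝ} (hε : 0 < ε) :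
    ∫ ξ, |FluidPDE.mollifierScale ε g ξ| = ∫ ξ, |g ξ| := by
  simp only [abs_mollifierScale g hε]
  exact integral_mollifierScale_eq _ hε

/-- Rescaling preserves integrability (`ε > 0`). [folklore] -/
theorem integrable_mollifierScale {g : EuclideanSpace ℝ d → ℝ} (hg : Integrable g volume) {ε : ℝ} (hε : 0 < ε) :
    Integrable (FluidPDE.mollifierScale ε g) volume := by
  have h := (hg.comp_smul (inv_ne_zero hε.ne')).const_mul ((ε ^ Fintype.card d)⁻¹)
  exact h

/-- A kernel supported in the closed unit ball rescales to one supported in the closed ball of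
radius `ε`: `g^ε(ξ) = 0` for `|ξ| > ε` (`ε > 0`). [folklore] -/
theorem mollifierScale_eq_zero_of_unitBall_lt {g : EuclideanSpace ℝ d → ℝ} (hg : ∀ ξ, 1 < ‖ξ‖ → g ξ = 0) {ε : ℝ}
    (hε : 0 < ε) {ξ : EuclideanSpace ℝ d} (hξ : ε < ‖ξ‖) : FluidPDE.mollifierScale ε g ξ = 0 := by
  rw [FluidPDE.mollifierScale_apply, hg _ ?_, mul_zero]
  rw [norm_smul, Real.norm_eq_abs, abs_of_pos (inv_pos.2 hε), ← div_eq_inv_mul, one_lt_div hε]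
  exact hξ

/-! ### The transverse kernel `φ_T(ξ) = (d−1) ∫_{s>1} φ(sξ) ds/s` -/

/-- Joint continuity of `(ξ, s) ↦ s⁻¹ φ(sξ)` on `ℝ^d × (0,∞)`-free form: for continuous `φ` the map
`(ξ,s) ↦ s⁻¹ φ(s • ξ)` is measurable on `ℝ^d × ℝ`. [folklore] -/
theorem measurable_inv_mul_comp_smul {φ : EuclideanSpace ℝ d → ℝ} (hφ : Continuous φ) :
    Measurable (fun z : EuclideanSpace ℝ d × ℝ => z.2⁻¹ * φ (z.2 • z.1)) :=
  (measurable_snd.inv).mul (hφ.measurable.comp (measurable_snd.smul measurable_fst))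

/-- For `φ` vanishing off the closed unit ball, `s⁻¹ φ(sξ) = 0` whenever `s > 1` and `|ξ| > 1`…
more precisely whenever `s|ξ| > 1`; in particular `φ_T(ξ) = 0` for `|ξ| > 1`. [folklore] -/
theorem transverseKernel_eq_zero_of_lt {φ : EuclideanSpace ℝ d → ℝ} (hφ : ∀ ξ, 1 < ‖ξ‖ → φ ξ = 0)
    {ξ : EuclideanSpace ℝ d} (hξ : 1 < ‖ξ‖) :
    ((Fintype.card d : ℝ) - 1) * ∫ s in Ioi (1 : ℝ), s⁻¹ * φ (s • ξ) = 0 := by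
  have h : ∀ s ∈ Ioi (1 : ℝ), s⁻¹ * φ (s • ξ) = 0 := fun s hs => by
    have hs1 : (1 : ℝ) < s := hs
    rw [hφ _ ?_, mul_zero]
    rw [norm_smul, Real.norm_eq_abs, abs_of_pos (one_pos.trans hs1)]
    calc (1 : ℝ) = 1 * 1 := (mul_one 1).symm
      _ < s * ‖ξ‖ := mul_lt_mul'' hs1 hξ zero_le_one zero_le_one
  rw [setIntegral_congr_fun measurableSet_Ioi h, integral_zero, mul_zero]

/-- The integrand of `φ_T` is nonnegative for `φ ≥ 0` on `s > 1`… pointwise: `0 ≤ s⁻¹ φ(sξ)` for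
`s > 0`. [folklore] -/
theorem transverseKernel_nonneg {φ : EuclideanSpace ℝ d → ℝ} (hφ : ∀ ξ, 0 ≤ φ ξ) (hd : 1 ≤ Fintype.card d)
    (ξ : EuclideanSpace ℝ d) :
    0 ≤ ((Fintype.card d : ℝ) - 1) * ∫ s in Ioi (1 : ℝ), s⁻¹ * φ (s • ξ) := by
  refine mul_nonneg ?_ (setIntegral_nonneg measurableSet_Ioi fun s hs => ?_)
  · have : (1 : ℝ) ≤ Fintype.card d := by exact_mod_cast hd
    linarith
  · exact mul_nonneg (inv_nonneg.2 (zero_le_one.trans (le_of_lt hs))) (hφ _)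

/-- **The transverse integrand is integrable on `ℝ^d × (1,∞)` and its total integral is `(∫φ)/d`**:
`∫_{s>1} ∫_{ℝ^d} s⁻¹ φ(sξ) dξ ds = ∫_{s>1} s^{-d-1} ds ∫ φ = d⁻¹ ∫ φ` (scaling of Lebesgue measure), for a
continuous compactly supported `φ ≥ 0` (`d ≥ 1`). [folklore] -/
theorem integrable_transverseIntegrand {φ : EuclideanSpace ℝ d → ℝ} (hφc : Continuous φ)
    (hφs : HasCompactSupport φ) (hφ0 : ∀ ξ, 0 ≤ φ ξ) (hd : 1 ≤ Fintype.card d) :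
    Integrable (fun z : EuclideanSpace ℝ d × ℝ => z.2⁻¹ * φ (z.2 • z.1))
        ((volume : Measure (EuclideanSpace ℝ d)).prod ((volume : Measure ℝ).restrict (Ioi 1))) ∧
      ∫ z, z.2⁻¹ * φ (z.2 • z.1) ∂((volume : Measure (EuclideanSpace ℝ d)).prod ((volume : Measure ℝ).restrict (Ioi 1))) =
        (Fintype.card d : ℝ)⁻¹ * ∫ ξ, φ ξ := by
  set n : ℕ := Fintype.card d with hn
  have hn0 : (0 : ℝ) < n := by exact_mod_cast hd
  have hφint : Integrable φ volume := hφc.integrable_of_hasCompactSupport hφs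
  -- the section integrals in `ξ` at fixed `s > 0`
  have hsec : ∀ s : ℝ, 0 < s → ∫ ξ : EuclideanSpace ℝ d, s⁻¹ * φ (s • ξ) = s⁻¹ * (s ^ n)⁻¹ * ∫ ξ, φ ξ := by
    intro s hs
    rw [integral_const_mul, Measure.integral_comp_smul volume φ s, finrank_euclideanSpace, ← hn, smul_eq_mul,
      abs_of_nonneg (inv_nonneg.2 (pow_nonneg hs.le _)), mul_assoc]
  -- measurability on the product
  have hmeas : AEStronglyMeasurable (fun z : EuclideanSpace ℝ d × ℝ => z.2⁻¹ * φ (z.2 • z.1))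
      ((volume : Measure (EuclideanSpace ℝ d)).prod ((volume : Measure ℝ).restrict (Ioi 1))) :=
    (measurable_inv_mul_comp_smul hφc).aestronglyMeasurable
  -- nonnegativity a.e.
  have hnn : 0 ≤ᵐ[((volume : Measure (EuclideanSpace ℝ d)).prod ((volume : Measure ℝ).restrict (Ioi 1)))]
      fun z : EuclideanSpace ℝ d × ℝ => z.2⁻¹ * φ (z.2 • z.1) := by
    have : ∀ᵐ z : EuclideanSpace ℝ d × ℝ ∂((volume : Measure (EuclideanSpace ℝ d)).prod
        ((volume : Measure ℝ).restrict (Ioi 1))), z.2 ∈ Ioi (1 : ℝ) :=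
      (quasiMeasurePreserving_snd (μ := (volume : Measure (EuclideanSpace ℝ d)))
        (ν := (volume : Measure ℝ).restrict (Ioi 1))).ae (ae_restrict_mem measurableSet_Ioi)
    filter_upwards [this] with z hz
    exact mul_nonneg (inv_nonneg.2 (zero_le_one.trans (le_of_lt hz))) (hφ0 _)
  -- the iterated integral in the order `s` then `ξ` (Tonelli for the lintegral)
  have hlin : ∫⁻ z, ENNReal.ofReal (z.2⁻¹ * φ (z.2 • z.1))
      ∂((volume : Measure (EuclideanSpace ℝ d)).prod ((volume : Measure ℝ).restrict (Ioi 1))) =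
      ENNReal.ofReal ((Fintype.card d : ℝ)⁻¹ * ∫ ξ, φ ξ) := by
    rw [lintegral_prod_symm _ (measurable_inv_mul_comp_smul hφc).ennreal_ofReal.aemeasurable]
    have h1 : ∀ s ∈ Ioi (1 : ℝ), ∫⁻ ξ : EuclideanSpace ℝ d, ENNReal.ofReal (s⁻¹ * φ (s • ξ)) =
        ENNReal.ofReal (s⁻¹ * (s ^ n)⁻¹ * ∫ ξ, φ ξ) := by
      intro s hs
      have hs0 : 0 < s := one_pos.trans hs
      rw [← hsec s hs0, ← ofReal_integral_eq_lintegral_ofReal]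
      · exact (hφint.comp_smul hs0.ne').const_mul _
      · exact ae_of_all _ fun ξ => mul_nonneg (inv_nonneg.2 hs0.le) (hφ0 _)
    rw [setLIntegral_congr_fun measurableSet_Ioi h1]
    have h2 : ∀ s ∈ Ioi (1 : ℝ), ENNReal.ofReal (s⁻¹ * (s ^ n)⁻¹ * ∫ ξ, φ ξ) =
        ENNReal.ofReal (s ^ (-(n : ℝ) - 1) * ∫ ξ, φ ξ) := by
      intro s hs
      have hs0 : 0 < s := one_pos.trans hs
      congr 1
      rw [Real.rpow_sub hs0, Real.rpow_neg hs0.le, Real.rpow_natCast, Real.rpow_one]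
      field_simp
    rw [setLIntegral_congr_fun measurableSet_Ioi h2]
    have hI : ∫ s in Ioi (1 : ℝ), s ^ (-(n : ℝ) - 1) = (n : ℝ)⁻¹ := by
      rw [integral_Ioi_rpow_of_lt (by linarith) one_pos]
      rw [Real.one_rpow]
      have : (-(n : ℝ) - 1 + 1) = -(n : ℝ) := by ring
      rw [this]
      field_simp
    have hint : IntegrableOn (fun s : ℝ => s ^ (-(n : ℝ) - 1) * ∫ ξ, φ ξ) (Ioi 1) :=
      (integrableOn_Ioi_rpow_of_lt (by linarith) one_pos).mul_const _
    rw [← ofReal_integral_eq_lintegral_ofReal hint, integral_mul_const, hI]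
    exact ae_restrict_of_forall_mem measurableSet_Ioi fun s hs =>
      mul_nonneg (Real.rpow_nonneg (zero_le_one.trans (le_of_lt hs)) _) (integral_nonneg hφ0)
  have hfin : HasFiniteIntegral (fun z : EuclideanSpace ℝ d × ℝ => z.2⁻¹ * φ (z.2 • z.1))
      ((volume : Measure (EuclideanSpace ℝ d)).prod ((volume : Measure ℝ).restrict (Ioi 1))) := by
    rw [hasFiniteIntegral_iff_ofReal hnn, hlin]
    exact ENNReal.ofReal_lt_top
  refine ⟨⟨hmeas, hfin⟩, ?_⟩
  rw [integral_eq_lintegral_of_nonneg_ae hnn hmeas, hlin, ENNReal.toReal_ofReal]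
  exact mul_nonneg (inv_nonneg.2 hn0.le) (integral_nonneg hφ0)

/-- **Mass and integrability of the transverse kernel**: for a continuous compactly supported
`φ ≥ 0` (`d ≥ 1`), `ξ ↦ (d−1)∫_{s>1} φ(sξ) ds/s` is integrable with
`∫ φ_T = ((d−1)/d) ∫ φ` (`= (d−1)/d` for a mollifier; Eyink 2003, (pT-twothirdp): `p_T^ε → (2/3) p`). [folklore] -/
theorem integrable_transverseKernel {φ : EuclideanSpace ℝ d → ℝ} (hφc : Continuous φ)
    (hφs : HasCompactSupport φ) (hφ0 : ∀ ξ, 0 ≤ φ ξ) (hd : 1 ≤ Fintype.card d) :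
    Integrable (fun ξ : EuclideanSpace ℝ d => ((Fintype.card d : ℝ) - 1) * ∫ s in Ioi (1 : ℝ), s⁻¹ * φ (s • ξ)) volume ∧
      ∫ ξ : EuclideanSpace ℝ d, ((Fintype.card d : ℝ) - 1) * ∫ s in Ioi (1 : ℝ), s⁻¹ * φ (s • ξ) =
        ((Fintype.card d : ℝ) - 1) / Fintype.card d * ∫ ξ, φ ξ := by
  obtain ⟨hint, hval⟩ := integrable_transverseIntegrand hφc hφs hφ0 hd
  have h1 : Integrable (fun ξ : EuclideanSpace ℝ d => ∫ s in Ioi (1 : ℝ), s⁻¹ * φ (s • ξ)) volume :=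
    hint.integral_prod_left
  refine ⟨h1.const_mul _, ?_⟩
  rw [integral_const_mul, ← integral_prod _ hint, hval]
  ring

end Kernels

/-! ## Angular second moments of radial kernels: `∫ k(ξ) ξ̂ᵢ ξ̂ⱼ dξ = δᵢⱼ d⁻¹ ∫ k` -/

section Angular

/-- The coordinate sign flip `ξ ↦ (ξ₁, …, −ξᵢ, …, ξ_d)` as a linear isometry of `ℝ^d`. [folklore] -/
def coordFlip [DecidableEq d] (i : d) : EuclideanSpace ℝ d ≃ₗᵢ[ℝ] EuclideanSpace ℝ d :=
  LinearIsometryEquiv.piLpCongrRight 2 fun j =>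
    if j = i then LinearIsometryEquiv.neg ℝ else LinearIsometryEquiv.refl ℝ ℝ

/-- Coordinates of the sign flip. [folklore] -/
theorem coordFlip_apply [DecidableEq d] (i j : d) (x : EuclideanSpace ℝ d) :
    coordFlip i x j = if j = i then -x j else x j := by
  simp only [coordFlip, LinearIsometryEquiv.piLpCongrRight_apply]
  by_cases h : j = i
  · subst h; simp
  · simp [h]

/-- The coordinate swap `ξ ↦ ξ ∘ (i j)` as a linear isometry of `ℝ^d`. [folklore] -/
def coordSwap [DecidableEq d] (i j : d) : EuclideanSpace ℝ d ≃ₗᵢ[ℝ] EuclideanSpace ℝ d :=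
  LinearIsometryEquiv.piLpCongrLeft 2 ℝ ℝ (Equiv.swap i j)

/-- Coordinates of the swap: `(coordSwap i j x) k = x (swap i j k)`. [folklore] -/
theorem coordSwap_apply [DecidableEq d] (i j k : d) (x : EuclideanSpace ℝ d) :
    coordSwap i j x k = x (Equiv.swap i j k) := by
  have h := LinearIsometryEquiv.piLpCongrLeft_apply (p := 2) (𝕜 := ℝ) (E := ℝ) (Equiv.swap i j) x
  have : (coordSwap i j x) k = ((LinearIsometryEquiv.piLpCongrLeft 2 ℝ ℝ (Equiv.swap i j)) x).ofLp k := rfl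
  rw [this, h, Equiv.piCongrLeft'_apply, Equiv.symm_swap]

/-- **Invariance of radial angular integrals under linear isometries**: for a radial kernel `k`,
an isometry `R` of `ℝ^d` and any `F`, `∫ k(ξ) F(R ξ̂) dξ = ∫ k(ξ) F(ξ̂) dξ` (substitute `ξ = Rη`:
Lebesgue measure and `k` are invariant, `(Rη)^ = R η̂`). [folklore] -/
theorem integral_radial_mul_comp_isometry (R : EuclideanSpace ℝ d ≃ₗᵢ[ℝ] EuclideanSpace ℝ d)
    {k : EuclideanSpace ℝ d → ℝ} (hrad : ∀ x y, ‖x‖ = ‖y‖ → k x = k y) (F : EuclideanSpace ℝ d → ℝ) :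
    ∫ ξ, k ξ * F (R (‖ξ‖⁻¹ • ξ)) = ∫ ξ, k ξ * F (‖ξ‖⁻¹ • ξ) := by
  have hR : MeasurePreserving R volume volume := R.measurePreserving
  have h := hR.integral_comp' (f := R.toHomeomorph.toMeasurableEquiv) (fun ξ => k ξ * F (‖ξ‖⁻¹ • ξ))
  rw [← h]
  refine integral_congr_ae (ae_of_all _ fun η => ?_)
  have e1 : (R.toHomeomorph.toMeasurableEquiv : EuclideanSpace ℝ d → EuclideanSpace ℝ d) η = R η := rfl
  simp only [e1]
  rw [hrad (R η) η (R.norm_map η), R.norm_map, ← R.map_smul]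

/-- Coordinates of unit directions are bounded by one: `|ξ̂ᵢ| ≤ 1`. [folklore] -/
theorem abs_unitDir_apply_le (ξ : EuclideanSpace ℝ d) (i : d) : |(‖ξ‖⁻¹ • ξ) i| ≤ 1 := by
  have h := PiLp.norm_apply_le (‖ξ‖⁻¹ • ξ) i
  rw [Real.norm_eq_abs] at h
  exact h.trans (norm_unitDir_le ξ)

/-- The angular integrands `k(ξ) ξ̂ᵢ ξ̂ⱼ` of an integrable kernel are integrable (`|ξ̂ᵢ ξ̂ⱼ| ≤ 1`). [folklore] -/
theorem integrable_radial_mul_unit_mul_unit {k : EuclideanSpace ℝ d → ℝ} (hk : Integrable k volume) (i j : d) :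
    Integrable (fun ξ : EuclideanSpace ℝ d => k ξ * ((‖ξ‖⁻¹ • ξ) i * (‖ξ‖⁻¹ • ξ) j)) volume := by
  have hu : Measurable fun ξ : EuclideanSpace ℝ d => ‖ξ‖⁻¹ • ξ := measurable_unitDir
  have hmeas : AEStronglyMeasurable (fun ξ : EuclideanSpace ℝ d => k ξ * ((‖ξ‖⁻¹ • ξ) i * (‖ξ‖⁻¹ • ξ) j)) volume :=
    hk.aestronglyMeasurable.mul
      ((((EuclideanSpace.proj i).continuous.measurable.comp hu).mul
        ((EuclideanSpace.proj j).continuous.measurable.comp hu)).aestronglyMeasurable)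
  refine hk.norm.mono' hmeas (ae_of_all _ fun ξ => ?_)
  rw [norm_mul, Real.norm_eq_abs, Real.norm_eq_abs, abs_mul]
  refine mul_le_of_le_one_right (abs_nonneg _) ?_
  calc |(‖ξ‖⁻¹ • ξ) i| * |(‖ξ‖⁻¹ • ξ) j| ≤ 1 * 1 :=
        mul_le_mul (abs_unitDir_apply_le ξ i) (abs_unitDir_apply_le ξ j) (abs_nonneg _) zero_le_one
    _ = 1 := mul_one 1

/-- **Off-diagonal angular moments vanish**: `∫ k(ξ) ξ̂ᵢ ξ̂ⱼ dξ = 0` for `i ≠ j` and `k` radial (the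
sign flip of the `i`-th coordinate). [folklore] -/
theorem integral_radial_mul_unit_mul_unit_of_ne {k : EuclideanSpace ℝ d → ℝ}
    (hrad : ∀ x y, ‖x‖ = ‖y‖ → k x = k y) {i j : d} (hij : i ≠ j) :
    ∫ ξ, k ξ * ((‖ξ‖⁻¹ • ξ) i * (‖ξ‖⁻¹ • ξ) j) = 0 := by
  classical
  have h := integral_radial_mul_comp_isometry (coordFlip i) hrad (fun v => v i * v j)
  have hflip : ∀ v : EuclideanSpace ℝ d, (coordFlip i v) i * (coordFlip i v) j = -(v i * v j) := fun v => by
    rw [coordFlip_apply, coordFlip_apply, if_pos rfl, if_neg (Ne.symm hij)]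
    ring
  simp only [hflip, mul_neg, integral_neg] at h
  linarith

/-- **Diagonal angular moments agree**: `∫ k(ξ) ξ̂ᵢ² dξ = ∫ k(ξ) ξ̂ⱼ² dξ` for `k` radial (the swap
of the coordinates `i`, `j`). [folklore] -/
theorem integral_radial_mul_unit_sq_eq {k : EuclideanSpace ℝ d → ℝ}
    (hrad : ∀ x y, ‖x‖ = ‖y‖ → k x = k y) (i j : d) :
    ∫ ξ, k ξ * ((‖ξ‖⁻¹ • ξ) i * (‖ξ‖⁻¹ • ξ) i) = ∫ ξ, k ξ * ((‖ξ‖⁻¹ • ξ) j * (‖ξ‖⁻¹ • ξ) j) := by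
  classical
  have h := integral_radial_mul_comp_isometry (coordSwap i j) hrad (fun v => v i * v i)
  have hsw : ∀ v : EuclideanSpace ℝ d, (coordSwap i j v) i * (coordSwap i j v) i = v j * v j := fun v => by
    rw [coordSwap_apply, Equiv.swap_apply_left]
  simp only [hsw] at h
  exact h.symm

/-- **The trace of the angular moments is the mass**: `∑ᵢ ∫ k(ξ) ξ̂ᵢ² dξ = ∫ k` (`|ξ̂|² = 1` off the
null set `{0}`; `d` nonempty). [folklore] -/
theorem sum_integral_radial_mul_unit_sq [Nonempty d] {k : EuclideanSpace ℝ d → ℝ} (hk : Integrable k volume) :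
    ∑ i, ∫ ξ, k ξ * ((‖ξ‖⁻¹ • ξ) i * (‖ξ‖⁻¹ • ξ) i) = ∫ ξ, k ξ := by
  rw [← integral_finsetSum _ fun i _ => integrable_radial_mul_unit_mul_unit hk i i]
  refine integral_congr_ae ?_
  have h0 : ∀ᵐ ξ : EuclideanSpace ℝ d ∂volume, ξ ≠ 0 := by
    rw [ae_iff]; simp
  filter_upwards [h0] with ξ hξ
  rw [← Finset.mul_sum]
  have hnorm : ∑ i, (‖ξ‖⁻¹ • ξ) i * (‖ξ‖⁻¹ • ξ) i = ‖‖ξ‖⁻¹ • ξ‖ ^ 2 := by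
    rw [EuclideanSpace.norm_sq_eq]
    refine Finset.sum_congr rfl fun i _ => ?_
    rw [Real.norm_eq_abs, sq_abs, sq]
  rw [hnorm, norm_inv_norm_smul hξ, one_pow, mul_one]

/-- **The angular moments of a radial kernel**: `∫ k(ξ) ξ̂ᵢ ξ̂ⱼ dξ = δᵢⱼ d⁻¹ ∫ k`. [folklore] -/
theorem integral_radial_mul_unit_mul_unit [DecidableEq d] [Nonempty d] {k : EuclideanSpace ℝ d → ℝ} (hk : Integrable k volume)
    (hrad : ∀ x y, ‖x‖ = ‖y‖ → k x = k y) (i j : d) :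
    ∫ ξ, k ξ * ((‖ξ‖⁻¹ • ξ) i * (‖ξ‖⁻¹ • ξ) j) =
      if i = j then (Fintype.card d : ℝ)⁻¹ * ∫ ξ, k ξ else 0 := by
  classical
  by_cases hij : i = j
  · subst hij
    rw [if_pos rfl]
    have hsum := sum_integral_radial_mul_unit_sq hk
    have hall : ∀ l : d, ∫ ξ, k ξ * ((‖ξ‖⁻¹ • ξ) l * (‖ξ‖⁻¹ • ξ) l) = ∫ ξ, k ξ * ((‖ξ‖⁻¹ • ξ) i * (‖ξ‖⁻¹ • ξ) i) :=
      fun l => integral_radial_mul_unit_sq_eq hrad l i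
    simp only [hall, Finset.sum_const, Finset.card_univ, nsmul_eq_mul] at hsum
    have hn : (Fintype.card d : ℝ) ≠ 0 := by exact_mod_cast Fintype.card_ne_zero
    rw [← hsum, ← mul_assoc, inv_mul_cancel₀ hn, one_mul]
  · rw [if_neg hij]
    exact integral_radial_mul_unit_mul_unit_of_ne hrad hij

/-- Real Euclidean inner products as coordinate sums (local copy of the tree's
`Torus.inner_eq_sum_mul`, `CoarseGrainingEstimates`, kept private to avoid the import). [folklore] -/
private theorem real_inner_eq_sum_mul (a v : EuclideanSpace ℝ d) : ⟪a, v⟫ = ∑ i, a i * v i := by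
  rw [PiLp.inner_apply]
  refine Finset.sum_congr rfl fun i _ => ?_
  simp [mul_comm]

/-- **The second-moment identity for radial kernels**: for vectors `a, b`,
`∫ k(ξ) ⟪a, ξ̂⟫ ⟪ξ̂, b⟫ dξ = d⁻¹ (∫ k) ⟪a, b⟫` (`∫ φ ℓ̂ ⊗ ℓ̂ = d⁻¹ 1` for a radial `φ` of unit mass:
Eyink 2003, (third-delta) with `1/3` in `d = 3`; Novack 2024, `∫ T_L = d⁻¹ δ`). [cite: Eyink2003, §2 (third-delta)] -/
theorem integral_radial_mul_inner_unit_mul_inner_unit [Nonempty d] {k : EuclideanSpace ℝ d → ℝ}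
    (hk : Integrable k volume) (hrad : ∀ x y, ‖x‖ = ‖y‖ → k x = k y) (a b : EuclideanSpace ℝ d) :
    ∫ ξ, k ξ * (⟪a, ‖ξ‖⁻¹ • ξ⟫ * ⟪‖ξ‖⁻¹ • ξ, b⟫) = (Fintype.card d : ℝ)⁻¹ * (∫ ξ, k ξ) * ⟪a, b⟫ := by
  classical
  -- expand the inner products in coordinates
  have hexp : ∀ ξ : EuclideanSpace ℝ d, k ξ * (⟪a, ‖ξ‖⁻¹ • ξ⟫ * ⟪‖ξ‖⁻¹ • ξ, b⟫) =
      ∑ i, ∑ j, (a i * b j) * (k ξ * ((‖ξ‖⁻¹ • ξ) i * (‖ξ‖⁻¹ • ξ) j)) := by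
    intro ξ
    rw [real_inner_eq_sum_mul, real_inner_eq_sum_mul, Finset.sum_mul_sum, Finset.mul_sum]
    refine Finset.sum_congr rfl fun i _ => ?_
    rw [Finset.mul_sum]
    refine Finset.sum_congr rfl fun j _ => ?_
    ring
  simp_rw [hexp]
  rw [integral_finsetSum _ fun i _ => ?_]
  · have hinner : ∀ i : d, ∫ ξ, ∑ j, (a i * b j) * (k ξ * ((‖ξ‖⁻¹ • ξ) i * (‖ξ‖⁻¹ • ξ) j)) =
        a i * b i * ((Fintype.card d : ℝ)⁻¹ * ∫ ξ, k ξ) := by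
      intro i
      rw [integral_finsetSum _ fun j _ => (integrable_radial_mul_unit_mul_unit hk i j).const_mul _]
      simp only [integral_const_mul, integral_radial_mul_unit_mul_unit hk hrad, mul_ite, mul_zero]
      rw [Finset.sum_ite_eq]
      simp
    simp only [hinner]
    rw [real_inner_eq_sum_mul, Finset.mul_sum]
    refine Finset.sum_congr rfl fun i _ => ?_
    ring
  · exact integrable_finsetSum _ fun j _ => (integrable_radial_mul_unit_mul_unit hk i j).const_mul _

/-- The same identity in the form `∫ k(ξ) ⟪a, ξ̂⟫² dξ = d⁻¹ (∫ k) |a|²`. [folklore] -/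
theorem integral_radial_mul_inner_unit_sq [Nonempty d] {k : EuclideanSpace ℝ d → ℝ}
    (hk : Integrable k volume) (hrad : ∀ x y, ‖x‖ = ‖y‖ → k x = k y) (a : EuclideanSpace ℝ d) :
    ∫ ξ, k ξ * ⟪a, ‖ξ‖⁻¹ • ξ⟫ ^ 2 = (Fintype.card d : ℝ)⁻¹ * (∫ ξ, k ξ) * ‖a‖ ^ 2 := by
  have h := integral_radial_mul_inner_unit_mul_inner_unit hk hrad a a
  rw [real_inner_self_eq_norm_sq] at h
  rw [← h]
  refine integral_congr_ae (ae_of_all _ fun ξ => ?_)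
  simp only
  rw [sq, real_inner_comm a (‖ξ‖⁻¹ • ξ)]

end Angular

/-! ## The space–time measure and the four generic term estimates -/

section Generic

variable (d) in
/-- The space–time measure `vol|_{(0,T)} ⊗ vol_{T^d}` on `ℝ × T^d` (reducible abbreviation). [folklore] -/
abbrev stMeasure (T : ℝ) : Measure (ℝ × UnitAddTorus d) :=
  ((volume : Measure ℝ).restrict (Ioo 0 T)).prod (volume : Measure (UnitAddTorus d))

variable {T : ℝ}

/-- **Type I term estimate** (pairings linear in the translated velocity, `⟪A(ξ̂) u(t,x+ξ), c(t,x)⟫`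
with `c ∈ L^{3/2}`): the kernel pairing is integrable on `((0,T) × T^d) × ℝ^d`, and it differs from
`λ_A ∫ ⟪u, c⟫` (`∫ k(ξ) ⟪A(ξ̂)a, c⟫ dξ = λ_A ⟪a, c⟫`) by at most `C_A m ‖c‖_{3/2} ∫|k|`, where `m`
bounds the `L³` translation modulus of `u` on the support ball of `k` (Eyink 2003, (uL-thirdu)–
(norm-uL-thirdu)). [folklore] -/
theorem typeI_estimate {k : EuclideanSpace ℝ d → ℝ} (hk : Integrable k volume) {ε : ℝ}
    (hksupp : ∀ ξ, ε < ‖ξ‖ → k ξ = 0)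
    (A : EuclideanSpace ℝ d → EuclideanSpace ℝ d →L[ℝ] EuclideanSpace ℝ d) {CA : ℝ} (hCA : 0 ≤ CA)
    (hA : ∀ ξ v : EuclideanSpace ℝ d, ‖A (‖ξ‖⁻¹ • ξ) v‖ ≤ CA * ‖v‖)
    (hAc : Continuous fun z : EuclideanSpace ℝ d × EuclideanSpace ℝ d => A z.1 z.2)
    {lam : ℝ} (hAng : ∀ a c : EuclideanSpace ℝ d, ∫ ξ, k ξ * ⟪A (‖ξ‖⁻¹ • ξ) a, c⟫ = lam * ⟪a, c⟫)
    {u' c : ℝ × UnitAddTorus d → EuclideanSpace ℝ d}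
    (hu : AEStronglyMeasurable u' (stMeasure d T)) (hu3 : ∫⁻ q, ‖u' q‖ₑ ^ (3 : ℝ) ∂(stMeasure d T) < ∞)
    (hc : AEStronglyMeasurable c (stMeasure d T)) (hc32 : ∫⁻ q, ‖c q‖ₑ ^ (3 / 2 : ℝ) ∂(stMeasure d T) < ∞)
    {m : ℝ≥0∞} (hm : m ≠ ∞)
    (hmod : ∀ ξ : EuclideanSpace ℝ d, ‖ξ‖ ≤ ε →
      (∫⁻ q, ‖u' (stTranslate d ξ q) - u' q‖ₑ ^ (3 : ℝ) ∂(stMeasure d T)) ^ (1 / 3 : ℝ) ≤ m) :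
    Integrable (fun q : (ℝ × UnitAddTorus d) × EuclideanSpace ℝ d =>
        k q.2 * ⟪A (‖q.2‖⁻¹ • q.2) (u' (stTranslate d q.2 q.1)), c q.1⟫) ((stMeasure d T).prod volume) ∧
      |(∫ q, k q.2 * ⟪A (‖q.2‖⁻¹ • q.2) (u' (stTranslate d q.2 q.1)), c q.1⟫ ∂((stMeasure d T).prod volume)) -
          lam * ∫ q, ⟪u' q, c q⟫ ∂(stMeasure d T)| ≤
        CA * (m * (∫⁻ q, ‖c q‖ₑ ^ (3 / 2 : ℝ) ∂(stMeasure d T)) ^ (2 / 3 : ℝ)).toReal * ∫ ξ, |k ξ| := by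
  set ν := stMeasure d T with hν
  -- Hölder constant of `u` and `c`
  set Nc : ℝ≥0∞ := (∫⁻ q, ‖c q‖ₑ ^ (3 / 2 : ℝ) ∂ν) ^ (2 / 3 : ℝ) with hNc
  set Nu : ℝ≥0∞ := (∫⁻ q, ‖u' q‖ₑ ^ (3 : ℝ) ∂ν) ^ (1 / 3 : ℝ) with hNu
  have hNc_fin : Nc ≠ ∞ := (ENNReal.rpow_lt_top_of_nonneg (by norm_num) hc32.ne).ne
  have hNu_fin : Nu ≠ ∞ := (ENNReal.rpow_lt_top_of_nonneg (by norm_num) hu3.ne).ne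
  -- measurability of the two integrands
  have hunit : Measurable fun ξ : EuclideanSpace ℝ d => ‖ξ‖⁻¹ • ξ := measurable_unitDir
  have hAτm : AEStronglyMeasurable (fun q : (ℝ × UnitAddTorus d) × EuclideanSpace ℝ d =>
      A (‖q.2‖⁻¹ • q.2) (u' (stTranslate d q.2 q.1))) (ν.prod volume) :=
    hAc.comp_aestronglyMeasurable ((hunit.comp measurable_snd).aestronglyMeasurable.prodMk
      (aestronglyMeasurable_comp_stTranslate hu))
  have hA0m : AEStronglyMeasurable (fun q : (ℝ × UnitAddTorus d) × EuclideanSpace ℝ d =>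
      A (‖q.2‖⁻¹ • q.2) (u' q.1)) (ν.prod volume) :=
    hAc.comp_aestronglyMeasurable ((hunit.comp measurable_snd).aestronglyMeasurable.prodMk hu.comp_fst)
  have hkm : AEStronglyMeasurable (fun q : (ℝ × UnitAddTorus d) × EuclideanSpace ℝ d => k q.2) (ν.prod volume) :=
    hk.aestronglyMeasurable.comp_snd
  -- integrability of the translated pairing
  have hdomτ := integrable_kernel_mul_translate_mul (T := T) hk hu hc (K := Nu * Nc)
    (ENNReal.mul_ne_top hNu_fin hNc_fin) (fun ξ => by
      have h := lintegral_mul_le_L3_mul_L32 ν (aestronglyMeasurable_comp_stTranslate_left hu ξ).enorm hc.enorm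
      rwa [lintegral_enorm_rpow_comp_stTranslate u' 3 ξ] at h)
  have hintτ : Integrable (fun q : (ℝ × UnitAddTorus d) × EuclideanSpace ℝ d =>
      k q.2 * ⟪A (‖q.2‖⁻¹ • q.2) (u' (stTranslate d q.2 q.1)), c q.1⟫) (ν.prod volume) := by
    refine (hdomτ.const_mul CA).mono' (hkm.mul (hAτm.inner hc.comp_fst)) (ae_of_all _ fun q => ?_)
    rw [norm_mul, Real.norm_eq_abs]
    calc |k q.2| * ‖⟪A (‖q.2‖⁻¹ • q.2) (u' (stTranslate d q.2 q.1)), c q.1⟫‖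
        ≤ |k q.2| * (CA * ‖u' (stTranslate d q.2 q.1)‖ * ‖c q.1‖) := by
          gcongr
          rw [Real.norm_eq_abs]
          exact (abs_real_inner_le_norm _ _).trans (by gcongr; exact hA _ _)
      _ = CA * (‖k q.2‖ * (‖u' (stTranslate d q.2 q.1)‖ * ‖c q.1‖)) := by rw [Real.norm_eq_abs]; ring
  -- integrability of the untranslated pairing
  obtain ⟨hgint, -⟩ := integrable_norm_mul_norm_of_L3_L32 hu hu3 hc hc32
  have hdom0 := integrable_kernel_mul_base (T := T) hk (hgint.const_mul CA)
  have hint0 : Integrable (fun q : (ℝ × UnitAddTorus d) × EuclideanSpace ℝ d =>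
      k q.2 * ⟪A (‖q.2‖⁻¹ • q.2) (u' q.1), c q.1⟫) (ν.prod volume) := by
    refine hdom0.mono' (hkm.mul (hA0m.inner hc.comp_fst)) (ae_of_all _ fun q => ?_)
    rw [norm_mul, Real.norm_eq_abs]
    gcongr
    rw [Real.norm_eq_abs]
    calc |⟪A (‖q.2‖⁻¹ • q.2) (u' q.1), c q.1⟫| ≤ ‖A (‖q.2‖⁻¹ • q.2) (u' q.1)‖ * ‖c q.1‖ := abs_real_inner_le_norm _ _
      _ ≤ CA * ‖u' q.1‖ * ‖c q.1‖ := by gcongr; exact hA _ _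
      _ = CA * (‖u' q.1‖ * ‖c q.1‖) := mul_assoc _ _ _
  -- the untranslated pairing evaluates to `lam ∫ ⟪u, c⟫`
  have hbase : ∫ q, k q.2 * ⟪A (‖q.2‖⁻¹ • q.2) (u' q.1), c q.1⟫ ∂(ν.prod volume) = lam * ∫ q, ⟪u' q, c q⟫ ∂ν := by
    rw [integral_prod _ hint0]
    simp only [hAng]
    exact integral_const_mul _ _
  refine ⟨hintτ, ?_⟩
  rw [← hbase]
  -- the exchange estimate
  have hM := abs_integral_kernel_mul_sub_le (T := T) hk hintτ hint0 hksupp (M := CA * (m * Nc).toReal)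
    (fun ξ hξ => by
      have h := abs_integral_inner_sub_inner_le (μ := ν) (A (‖ξ‖⁻¹ • ξ)) hCA (hA _)
        (aestronglyMeasurable_comp_stTranslate_left hu ξ) hu
        (lintegral_enorm_translate_sub_rpow_lt_top hu (by norm_num) hu3 ξ) hc hc32
      refine h.trans ?_
      gcongr
      · exact ENNReal.mul_ne_top hm hNc_fin
      · exact hmod ξ hξ)
  exact hM

/-- `(x³)^{1} = x³`-type bookkeeping: `x ^ (3:ℕ)` as a real power. [folklore] -/
theorem ENNReal.pow_three_eq_rpow (x : ℝ≥0∞) : x ^ 3 = x ^ (3 : ℝ) := by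
  rw [← ENNReal.rpow_natCast x 3]
  norm_num

/-- **Type II term estimate** (pairings quadratic in the translated velocity,
`‖A(ξ̂) u(t,x+ξ)‖² G(t,x)` with `G ∈ L³`): integrability of the kernel pairing and
`|∫∫ k ‖A(ξ̂)u_ξ‖² G − λ_A ∫ |u|² G| ≤ 2 C_A² m ‖u‖₃ ‖G‖₃ ∫|k|`
(`∫ k(ξ)‖A(ξ̂)a‖² dξ = λ_A |a|²`). [folklore] -/
theorem typeII_estimate {k : EuclideanSpace ℝ d → ℝ} (hk : Integrable k volume) {ε : ℝ}
    (hksupp : ∀ ξ, ε < ‖ξ‖ → k ξ = 0)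
    (A : EuclideanSpace ℝ d → EuclideanSpace ℝ d →L[ℝ] EuclideanSpace ℝ d) {CA : ℝ} (hCA : 0 ≤ CA)
    (hA : ∀ ξ v : EuclideanSpace ℝ d, ‖A (‖ξ‖⁻¹ • ξ) v‖ ≤ CA * ‖v‖)
    (hAc : Continuous fun z : EuclideanSpace ℝ d × EuclideanSpace ℝ d => A z.1 z.2)
    {lam : ℝ} (hAng : ∀ a : EuclideanSpace ℝ d, ∫ ξ, k ξ * ‖A (‖ξ‖⁻¹ • ξ) a‖ ^ 2 = lam * ‖a‖ ^ 2)
    {u' : ℝ × UnitAddTorus d → EuclideanSpace ℝ d} {G : ℝ × UnitAddTorus d → ℝ}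
    (hu : AEStronglyMeasurable u' (stMeasure d T)) (hu3 : ∫⁻ q, ‖u' q‖ₑ ^ (3 : ℝ) ∂(stMeasure d T) < ∞)
    (hG : AEStronglyMeasurable G (stMeasure d T)) (hG3 : ∫⁻ q, ‖G q‖ₑ ^ (3 : ℝ) ∂(stMeasure d T) < ∞)
    {m : ℝ≥0∞} (hm : m ≠ ∞)
    (hmod : ∀ ξ : EuclideanSpace ℝ d, ‖ξ‖ ≤ ε →
      (∫⁻ q, ‖u' (stTranslate d ξ q) - u' q‖ₑ ^ (3 : ℝ) ∂(stMeasure d T)) ^ (1 / 3 : ℝ) ≤ m) :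
    Integrable (fun q : (ℝ × UnitAddTorus d) × EuclideanSpace ℝ d =>
        k q.2 * (‖A (‖q.2‖⁻¹ • q.2) (u' (stTranslate d q.2 q.1))‖ ^ 2 * G q.1)) ((stMeasure d T).prod volume) ∧
      |(∫ q, k q.2 * (‖A (‖q.2‖⁻¹ • q.2) (u' (stTranslate d q.2 q.1))‖ ^ 2 * G q.1) ∂((stMeasure d T).prod volume)) -
          lam * ∫ q, ‖u' q‖ ^ 2 * G q ∂(stMeasure d T)| ≤
        CA ^ 2 * (2 * (m * (∫⁻ q, ‖u' q‖ₑ ^ (3 : ℝ) ∂(stMeasure d T)) ^ (1 / 3 : ℝ) *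
          (∫⁻ q, ‖G q‖ₑ ^ (3 : ℝ) ∂(stMeasure d T)) ^ (1 / 3 : ℝ)).toReal) * ∫ ξ, |k ξ| := by
  set ν := stMeasure d T with hν
  set NG : ℝ≥0∞ := (∫⁻ q, ‖G q‖ₑ ^ (3 : ℝ) ∂ν) ^ (1 / 3 : ℝ) with hNG
  set Nu : ℝ≥0∞ := (∫⁻ q, ‖u' q‖ₑ ^ (3 : ℝ) ∂ν) ^ (1 / 3 : ℝ) with hNu
  have hNG_fin : NG ≠ ∞ := (ENNReal.rpow_lt_top_of_nonneg (by norm_num) hG3.ne).ne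
  have hNu_fin : Nu ≠ ∞ := (ENNReal.rpow_lt_top_of_nonneg (by norm_num) hu3.ne).ne
  have hunit : Measurable fun ξ : EuclideanSpace ℝ d => ‖ξ‖⁻¹ • ξ := measurable_unitDir
  have hAτm : AEStronglyMeasurable (fun q : (ℝ × UnitAddTorus d) × EuclideanSpace ℝ d =>
      A (‖q.2‖⁻¹ • q.2) (u' (stTranslate d q.2 q.1))) (ν.prod volume) :=
    hAc.comp_aestronglyMeasurable ((hunit.comp measurable_snd).aestronglyMeasurable.prodMk
      (aestronglyMeasurable_comp_stTranslate hu))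
  have hA0m : AEStronglyMeasurable (fun q : (ℝ × UnitAddTorus d) × EuclideanSpace ℝ d =>
      A (‖q.2‖⁻¹ • q.2) (u' q.1)) (ν.prod volume) :=
    hAc.comp_aestronglyMeasurable ((hunit.comp measurable_snd).aestronglyMeasurable.prodMk hu.comp_fst)
  have hkm : AEStronglyMeasurable (fun q : (ℝ × UnitAddTorus d) × EuclideanSpace ℝ d => k q.2) (ν.prod volume) :=
    hk.aestronglyMeasurable.comp_snd
  -- the square of the norm as the translated factor: per-`ξ` Hölder `3/2, 3`
  have hsqm : AEStronglyMeasurable (fun q : ℝ × UnitAddTorus d => ‖u' q‖ ^ 2) ν := (hu.norm.pow 2)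
  have hH : ∀ ξ : EuclideanSpace ℝ d, ∫⁻ q, ‖‖u' (stTranslate d ξ q)‖ ^ 2‖ₑ * ‖G q‖ₑ ∂ν ≤ Nu ^ 2 * NG := by
    intro ξ
    have hτsq : AEStronglyMeasurable (fun q => ‖u' (stTranslate d ξ q)‖ ^ 2) ν :=
      (aestronglyMeasurable_comp_stTranslate_left hu ξ).norm.pow 2
    have h := lintegral_mul_le_L3_mul_L32 ν hG.enorm hτsq.enorm
    have e1 : ∫⁻ q, ‖G q‖ₑ * ‖‖u' (stTranslate d ξ q)‖ ^ 2‖ₑ ∂ν = ∫⁻ q, ‖‖u' (stTranslate d ξ q)‖ ^ 2‖ₑ * ‖G q‖ₑ ∂ν :=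
      lintegral_congr fun q => mul_comm _ _
    have e2 : ∫⁻ q, ‖‖u' (stTranslate d ξ q)‖ ^ 2‖ₑ ^ (3 / 2 : ℝ) ∂ν = ∫⁻ q, ‖u' q‖ₑ ^ (3 : ℝ) ∂ν := by
      rw [← lintegral_enorm_rpow_comp_stTranslate u' 3 ξ]
      refine lintegral_congr fun q => ?_
      rw [enorm_norm_pow, ENNReal.sq_rpow_three_halves]
    rw [e1] at h
    rw [e2] at h
    refine h.trans (le_of_eq ?_)
    rw [hNG, hNu, ← ENNReal.rpow_natCast ((∫⁻ q, ‖u' q‖ₑ ^ (3 : ℝ) ∂ν) ^ (1 / 3 : ℝ)) 2, ← ENNReal.rpow_mul,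
      mul_comm]
    norm_num
  have hdomτ := integrable_kernel_mul_translate_mul (T := T) hk hsqm hG (K := Nu ^ 2 * NG)
    (ENNReal.mul_ne_top (ENNReal.pow_ne_top hNu_fin) hNG_fin) hH
  have hintτ : Integrable (fun q : (ℝ × UnitAddTorus d) × EuclideanSpace ℝ d =>
      k q.2 * (‖A (‖q.2‖⁻¹ • q.2) (u' (stTranslate d q.2 q.1))‖ ^ 2 * G q.1)) (ν.prod volume) := by
    refine (hdomτ.const_mul (CA ^ 2)).mono' (hkm.mul ((hAτm.norm.pow 2).mul hG.comp_fst))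
      (ae_of_all _ fun q => ?_)
    rw [norm_mul, norm_mul, Real.norm_eq_abs, Real.norm_eq_abs,
      abs_of_nonneg (sq_nonneg ‖A (‖q.2‖⁻¹ • q.2) (u' (stTranslate d q.2 q.1))‖)]
    have hq : ‖A (‖q.2‖⁻¹ • q.2) (u' (stTranslate d q.2 q.1))‖ ^ 2 ≤ CA ^ 2 * ‖u' (stTranslate d q.2 q.1)‖ ^ 2 := by
      rw [← mul_pow]; exact pow_le_pow_left₀ (norm_nonneg _) (hA _ _) 2
    calc |k q.2| * (‖A (‖q.2‖⁻¹ • q.2) (u' (stTranslate d q.2 q.1))‖ ^ 2 * ‖G q.1‖)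
        ≤ |k q.2| * (CA ^ 2 * ‖u' (stTranslate d q.2 q.1)‖ ^ 2 * ‖G q.1‖) := by gcongr
      _ = CA ^ 2 * (‖k q.2‖ * (‖‖u' (stTranslate d q.2 q.1)‖ ^ 2‖ * ‖G q.1‖)) := by
          simp only [Real.norm_eq_abs, abs_of_nonneg (sq_nonneg ‖u' (stTranslate d q.2 q.1)‖)]; ring
  -- untranslated pairing
  have hgint : Integrable (fun q : ℝ × UnitAddTorus d => ‖u' q‖ ^ 2 * ‖G q‖) ν := by
    obtain ⟨h1, -⟩ := integrable_norm_mul_norm_mul_norm_of_L3 hu hu3 hu hu3 hG hG3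
    refine h1.congr (ae_of_all _ fun q => ?_)
    simp only
    ring
  have hdom0 := integrable_kernel_mul_base (T := T) hk (hgint.const_mul (CA ^ 2))
  have hint0 : Integrable (fun q : (ℝ × UnitAddTorus d) × EuclideanSpace ℝ d =>
      k q.2 * (‖A (‖q.2‖⁻¹ • q.2) (u' q.1)‖ ^ 2 * G q.1)) (ν.prod volume) := by
    refine hdom0.mono' (hkm.mul ((hA0m.norm.pow 2).mul hG.comp_fst)) (ae_of_all _ fun q => ?_)
    rw [norm_mul, norm_mul, Real.norm_eq_abs, Real.norm_eq_abs, abs_of_nonneg (sq_nonneg ‖A (‖q.2‖⁻¹ • q.2) (u' q.1)‖)]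
    have hq : ‖A (‖q.2‖⁻¹ • q.2) (u' q.1)‖ ^ 2 ≤ CA ^ 2 * ‖u' q.1‖ ^ 2 := by
      rw [← mul_pow]; exact pow_le_pow_left₀ (norm_nonneg _) (hA _ _) 2
    calc |k q.2| * (‖A (‖q.2‖⁻¹ • q.2) (u' q.1)‖ ^ 2 * ‖G q.1‖)
        ≤ |k q.2| * (CA ^ 2 * ‖u' q.1‖ ^ 2 * ‖G q.1‖) := by gcongr
      _ = ‖k q.2‖ * (CA ^ 2 * (‖u' q.1‖ ^ 2 * ‖G q.1‖)) := by simp only [Real.norm_eq_abs]; ring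
  have hbase : ∫ q, k q.2 * (‖A (‖q.2‖⁻¹ • q.2) (u' q.1)‖ ^ 2 * G q.1) ∂(ν.prod volume) =
      lam * ∫ q, ‖u' q‖ ^ 2 * G q ∂ν := by
    rw [integral_prod _ hint0]
    have e : ∀ q : ℝ × UnitAddTorus d, ∫ ξ, k ξ * (‖A (‖ξ‖⁻¹ • ξ) (u' q)‖ ^ 2 * G q) = lam * (‖u' q‖ ^ 2 * G q) := by
      intro q
      have := hAng (u' q)
      calc ∫ ξ, k ξ * (‖A (‖ξ‖⁻¹ • ξ) (u' q)‖ ^ 2 * G q)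
          = (∫ ξ, k ξ * ‖A (‖ξ‖⁻¹ • ξ) (u' q)‖ ^ 2) * G q := by
            rw [← integral_mul_const]; exact integral_congr_ae (ae_of_all _ fun ξ => by ring)
        _ = lam * (‖u' q‖ ^ 2 * G q) := by rw [this]; ring
    simp only [e]
    exact integral_const_mul _ _
  refine ⟨hintτ, ?_⟩
  rw [← hbase]
  have hM := abs_integral_kernel_mul_sub_le (T := T) hk hintτ hint0 hksupp
    (M := CA ^ 2 * (2 * (m * Nu * NG).toReal))
    (fun ξ hξ => by
      have hτ := aestronglyMeasurable_comp_stTranslate_left hu ξ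
      have hτ3 : ∫⁻ q, ‖u' (stTranslate d ξ q)‖ₑ ^ (3 : ℝ) ∂ν < ∞ := by
        rw [lintegral_enorm_rpow_comp_stTranslate u' 3 ξ]; exact hu3
      have h := abs_integral_normSq_sub_normSq_mul_le (μ := ν) (A (‖ξ‖⁻¹ • ξ)) hCA (hA _) hτ hτ3 hu hu3
        (lintegral_enorm_translate_sub_rpow_lt_top hu (by norm_num) hu3 ξ) hG hG3
      show |∫ q, (‖A (‖ξ‖⁻¹ • ξ) (u' (stTranslate d ξ q))‖ ^ 2 * G q - ‖A (‖ξ‖⁻¹ • ξ) (u' q)‖ ^ 2 * G q) ∂ν| ≤ _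
      have e : ∫ q, (‖A (‖ξ‖⁻¹ • ξ) (u' (stTranslate d ξ q))‖ ^ 2 * G q - ‖A (‖ξ‖⁻¹ • ξ) (u' q)‖ ^ 2 * G q) ∂ν =
          ∫ q, (‖A (‖ξ‖⁻¹ • ξ) (u' (stTranslate d ξ q))‖ ^ 2 - ‖A (‖ξ‖⁻¹ • ξ) (u' q)‖ ^ 2) * G q ∂ν :=
        integral_congr_ae (ae_of_all _ fun q => (sub_mul _ _ _).symm)
      rw [e]
      refine h.trans ?_
      rw [lintegral_enorm_rpow_comp_stTranslate u' 3 ξ]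
      have hle : ((∫⁻ q, ‖u' (stTranslate d ξ q) - u' q‖ₑ ^ (3 : ℝ) ∂ν) ^ (1 / 3 : ℝ) * Nu * NG).toReal ≤
          (m * Nu * NG).toReal := by
        gcongr
        · exact ENNReal.mul_ne_top (ENNReal.mul_ne_top hm hNu_fin) hNG_fin
        · exact hmod ξ hξ
      nlinarith [hle, sq_nonneg CA])
  exact hM

/-- **Type III term estimate** (pairings cubic in the translated velocity,
`‖A(ξ̂) u_ξ‖² ⟪u_ξ, H⟫` with `H` bounded): integrability of the kernel pairing and
`|∫∫ k ‖A(ξ̂)u_ξ‖²⟪u_ξ,H⟫ − λ_A ∫ |u|²⟪u,H⟫| ≤ 4 C_A² C_H m ‖u‖₃² ∫|k|`. [folklore] -/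
theorem typeIII_estimate {k : EuclideanSpace ℝ d → ℝ} (hk : Integrable k volume) {ε : ℝ}
    (hksupp : ∀ ξ, ε < ‖ξ‖ → k ξ = 0)
    (A : EuclideanSpace ℝ d → EuclideanSpace ℝ d →L[ℝ] EuclideanSpace ℝ d) {CA : ℝ} (hCA : 0 ≤ CA)
    (hA : ∀ ξ v : EuclideanSpace ℝ d, ‖A (‖ξ‖⁻¹ • ξ) v‖ ≤ CA * ‖v‖)
    (hAc : Continuous fun z : EuclideanSpace ℝ d × EuclideanSpace ℝ d => A z.1 z.2)
    {lam : ℝ} (hAng : ∀ a : EuclideanSpace ℝ d, ∫ ξ, k ξ * ‖A (‖ξ‖⁻¹ • ξ) a‖ ^ 2 = lam * ‖a‖ ^ 2)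
    {u' H : ℝ × UnitAddTorus d → EuclideanSpace ℝ d}
    (hu : AEStronglyMeasurable u' (stMeasure d T)) (hu3 : ∫⁻ q, ‖u' q‖ₑ ^ (3 : ℝ) ∂(stMeasure d T) < ∞)
    (hHm : AEStronglyMeasurable H (stMeasure d T)) {CH : ℝ} (hCH : 0 ≤ CH) (hH : ∀ q, ‖H q‖ ≤ CH)
    {m : ℝ≥0∞} (hm : m ≠ ∞)
    (hmod : ∀ ξ : EuclideanSpace ℝ d, ‖ξ‖ ≤ ε →
      (∫⁻ q, ‖u' (stTranslate d ξ q) - u' q‖ₑ ^ (3 : ℝ) ∂(stMeasure d T)) ^ (1 / 3 : ℝ) ≤ m) :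
    Integrable (fun q : (ℝ × UnitAddTorus d) × EuclideanSpace ℝ d =>
        k q.2 * (‖A (‖q.2‖⁻¹ • q.2) (u' (stTranslate d q.2 q.1))‖ ^ 2 *
          ⟪u' (stTranslate d q.2 q.1), H q.1⟫)) ((stMeasure d T).prod volume) ∧
      |(∫ q, k q.2 * (‖A (‖q.2‖⁻¹ • q.2) (u' (stTranslate d q.2 q.1))‖ ^ 2 *
            ⟪u' (stTranslate d q.2 q.1), H q.1⟫) ∂((stMeasure d T).prod volume)) -
          lam * ∫ q, ‖u' q‖ ^ 2 * ⟪u' q, H q⟫ ∂(stMeasure d T)| ≤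
        CA ^ 2 * CH * (4 * (m * (∫⁻ q, ‖u' q‖ₑ ^ (3 : ℝ) ∂(stMeasure d T)) ^ (1 / 3 : ℝ) *
          (∫⁻ q, ‖u' q‖ₑ ^ (3 : ℝ) ∂(stMeasure d T)) ^ (1 / 3 : ℝ)).toReal) * ∫ ξ, |k ξ| := by
  set ν := stMeasure d T with hν
  set Nu : ℝ≥0∞ := (∫⁻ q, ‖u' q‖ₑ ^ (3 : ℝ) ∂ν) ^ (1 / 3 : ℝ) with hNu
  have hNu_fin : Nu ≠ ∞ := (ENNReal.rpow_lt_top_of_nonneg (by norm_num) hu3.ne).ne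
  have hunit : Measurable fun ξ : EuclideanSpace ℝ d => ‖ξ‖⁻¹ • ξ := measurable_unitDir
  have huτm : AEStronglyMeasurable (fun q : (ℝ × UnitAddTorus d) × EuclideanSpace ℝ d =>
      u' (stTranslate d q.2 q.1)) (ν.prod volume) := aestronglyMeasurable_comp_stTranslate hu
  have hAτm : AEStronglyMeasurable (fun q : (ℝ × UnitAddTorus d) × EuclideanSpace ℝ d =>
      A (‖q.2‖⁻¹ • q.2) (u' (stTranslate d q.2 q.1))) (ν.prod volume) :=
    hAc.comp_aestronglyMeasurable ((hunit.comp measurable_snd).aestronglyMeasurable.prodMk huτm)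
  have hA0m : AEStronglyMeasurable (fun q : (ℝ × UnitAddTorus d) × EuclideanSpace ℝ d =>
      A (‖q.2‖⁻¹ • q.2) (u' q.1)) (ν.prod volume) :=
    hAc.comp_aestronglyMeasurable ((hunit.comp measurable_snd).aestronglyMeasurable.prodMk hu.comp_fst)
  have hkm : AEStronglyMeasurable (fun q : (ℝ × UnitAddTorus d) × EuclideanSpace ℝ d => k q.2) (ν.prod volume) :=
    hk.aestronglyMeasurable.comp_snd
  -- translated factor `‖u‖³`, base factor `1`
  have hcubem : AEStronglyMeasurable (fun q : ℝ × UnitAddTorus d => ‖u' q‖ ^ 3) ν := (hu.norm.pow 3)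
  have hHb : ∀ ξ : EuclideanSpace ℝ d, ∫⁻ q, ‖‖u' (stTranslate d ξ q)‖ ^ 3‖ₑ * ‖(1 : ℝ)‖ₑ ∂ν ≤ Nu ^ 3 := by
    intro ξ
    have e : ∫⁻ q, ‖‖u' (stTranslate d ξ q)‖ ^ 3‖ₑ * ‖(1 : ℝ)‖ₑ ∂ν = ∫⁻ q, ‖u' q‖ₑ ^ (3 : ℝ) ∂ν := by
      rw [← lintegral_enorm_rpow_comp_stTranslate u' 3 ξ]
      refine lintegral_congr fun q => ?_
      rw [enorm_norm_pow, enorm_one, mul_one, ENNReal.pow_three_eq_rpow]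
    rw [e, hNu, ← ENNReal.rpow_natCast, ← ENNReal.rpow_mul]
    norm_num
  have hdomτ := integrable_kernel_mul_translate_mul (T := T) hk hcubem (aestronglyMeasurable_const (b := (1 : ℝ)))
    (K := Nu ^ 3) (ENNReal.pow_ne_top hNu_fin) hHb
  have hptA : ∀ (ξ v : EuclideanSpace ℝ d), ‖A (‖ξ‖⁻¹ • ξ) v‖ ^ 2 ≤ CA ^ 2 * ‖v‖ ^ 2 := fun ξ v => by
    rw [← mul_pow]; exact pow_le_pow_left₀ (norm_nonneg _) (hA _ _) 2
  have hintτ : Integrable (fun q : (ℝ × UnitAddTorus d) × EuclideanSpace ℝ d =>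
      k q.2 * (‖A (‖q.2‖⁻¹ • q.2) (u' (stTranslate d q.2 q.1))‖ ^ 2 * ⟪u' (stTranslate d q.2 q.1), H q.1⟫))
      (ν.prod volume) := by
    refine (hdomτ.const_mul (CA ^ 2 * CH)).mono' (hkm.mul ((hAτm.norm.pow 2).mul (huτm.inner hHm.comp_fst)))
      (ae_of_all _ fun q => ?_)
    rw [norm_mul, norm_mul, Real.norm_eq_abs, Real.norm_eq_abs,
      abs_of_nonneg (sq_nonneg ‖A (‖q.2‖⁻¹ • q.2) (u' (stTranslate d q.2 q.1))‖), Real.norm_eq_abs]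
    calc |k q.2| * (‖A (‖q.2‖⁻¹ • q.2) (u' (stTranslate d q.2 q.1))‖ ^ 2 * |⟪u' (stTranslate d q.2 q.1), H q.1⟫|)
        ≤ |k q.2| * (CA ^ 2 * ‖u' (stTranslate d q.2 q.1)‖ ^ 2 * (‖u' (stTranslate d q.2 q.1)‖ * CH)) := by
          gcongr
          · exact hptA _ _
          · exact (abs_real_inner_le_norm _ _).trans (by gcongr; exact hH _)
      _ = CA ^ 2 * CH * (‖k q.2‖ * (‖‖u' (stTranslate d q.2 q.1)‖ ^ 3‖ * ‖(1 : ℝ)‖)) := by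
          rw [Real.norm_eq_abs, Real.norm_eq_abs, abs_of_nonneg (pow_nonneg (norm_nonneg _) 3), norm_one]
          ring
  -- untranslated pairing
  have hgint : Integrable (fun q : ℝ × UnitAddTorus d => ‖u' q‖ ^ 3) ν := by
    refine integrable_norm_pow_three hu ?_
    have e : ∫⁻ q, ‖u' q‖ₑ ^ 3 ∂ν = ∫⁻ q, ‖u' q‖ₑ ^ (3 : ℝ) ∂ν := lintegral_congr fun q => ENNReal.pow_three_eq_rpow _
    rw [e]
    exact hu3
  have hdom0 := integrable_kernel_mul_base (T := T) hk (hgint.const_mul (CA ^ 2 * CH))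
  have hint0 : Integrable (fun q : (ℝ × UnitAddTorus d) × EuclideanSpace ℝ d =>
      k q.2 * (‖A (‖q.2‖⁻¹ • q.2) (u' q.1)‖ ^ 2 * ⟪u' q.1, H q.1⟫)) (ν.prod volume) := by
    refine hdom0.mono' (hkm.mul ((hA0m.norm.pow 2).mul (hu.comp_fst.inner hHm.comp_fst))) (ae_of_all _ fun q => ?_)
    rw [norm_mul, norm_mul, Real.norm_eq_abs, Real.norm_eq_abs, abs_of_nonneg (sq_nonneg ‖A (‖q.2‖⁻¹ • q.2) (u' q.1)‖),
      Real.norm_eq_abs]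
    calc |k q.2| * (‖A (‖q.2‖⁻¹ • q.2) (u' q.1)‖ ^ 2 * |⟪u' q.1, H q.1⟫|)
        ≤ |k q.2| * (CA ^ 2 * ‖u' q.1‖ ^ 2 * (‖u' q.1‖ * CH)) := by
          gcongr
          · exact hptA _ _
          · exact (abs_real_inner_le_norm _ _).trans (by gcongr; exact hH _)
      _ = ‖k q.2‖ * (CA ^ 2 * CH * ‖u' q.1‖ ^ 3) := by rw [Real.norm_eq_abs]; ring
  have hbase : ∫ q, k q.2 * (‖A (‖q.2‖⁻¹ • q.2) (u' q.1)‖ ^ 2 * ⟪u' q.1, H q.1⟫) ∂(ν.prod volume) =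
      lam * ∫ q, ‖u' q‖ ^ 2 * ⟪u' q, H q⟫ ∂ν := by
    rw [integral_prod _ hint0]
    have e : ∀ q : ℝ × UnitAddTorus d, ∫ ξ, k ξ * (‖A (‖ξ‖⁻¹ • ξ) (u' q)‖ ^ 2 * ⟪u' q, H q⟫) =
        lam * (‖u' q‖ ^ 2 * ⟪u' q, H q⟫) := by
      intro q
      have := hAng (u' q)
      calc ∫ ξ, k ξ * (‖A (‖ξ‖⁻¹ • ξ) (u' q)‖ ^ 2 * ⟪u' q, H q⟫)
          = (∫ ξ, k ξ * ‖A (‖ξ‖⁻¹ • ξ) (u' q)‖ ^ 2) * ⟪u' q, H q⟫ := by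
            rw [← integral_mul_const]; exact integral_congr_ae (ae_of_all _ fun ξ => by ring)
        _ = lam * (‖u' q‖ ^ 2 * ⟪u' q, H q⟫) := by rw [this]; ring
    simp only [e]
    exact integral_const_mul _ _
  refine ⟨hintτ, ?_⟩
  rw [← hbase]
  have hM := abs_integral_kernel_mul_sub_le (T := T) hk hintτ hint0 hksupp
    (M := CA ^ 2 * CH * (4 * (m * Nu * Nu).toReal))
    (fun ξ hξ => by
      have hτ := aestronglyMeasurable_comp_stTranslate_left hu ξ
      have hτ3 : ∫⁻ q, ‖u' (stTranslate d ξ q)‖ₑ ^ (3 : ℝ) ∂ν < ∞ := by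
        rw [lintegral_enorm_rpow_comp_stTranslate u' 3 ξ]; exact hu3
      have h := abs_integral_normSq_mul_inner_sub_le (μ := ν) (A (‖ξ‖⁻¹ • ξ)) hCA (hA _) hCH hH hτ hτ3 hu hu3
        (lintegral_enorm_translate_sub_rpow_lt_top hu (by norm_num) hu3 ξ)
      show |∫ q, (‖A (‖ξ‖⁻¹ • ξ) (u' (stTranslate d ξ q))‖ ^ 2 * ⟪u' (stTranslate d ξ q), H q⟫ -
          ‖A (‖ξ‖⁻¹ • ξ) (u' q)‖ ^ 2 * ⟪u' q, H q⟫) ∂ν| ≤ _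
      refine h.trans ?_
      rw [lintegral_enorm_rpow_comp_stTranslate u' 3 ξ]
      have hle : ((∫⁻ q, ‖u' (stTranslate d ξ q) - u' q‖ₑ ^ (3 : ℝ) ∂ν) ^ (1 / 3 : ℝ) * Nu * Nu).toReal ≤
          (m * Nu * Nu).toReal := by
        gcongr
        · exact ENNReal.mul_ne_top (ENNReal.mul_ne_top hm hNu_fin) hNu_fin
        · exact hmod ξ hξ
      nlinarith [hle, sq_nonneg CA, mul_nonneg (sq_nonneg CA) hCH])
  exact hM

/-- **Type IV term estimate** (pairings linear in a translated scalar `p ∈ L^{3/2}` against a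
weight `G ∈ L³`, any kernel `k ∈ L¹(ℝ^d)` vanishing off the ball of radius `ε`): integrability
and `|∫∫ k p_ξ G − (∫k) ∫ p G| ≤ m_p ‖G‖₃ ∫|k|` with the `L^{3/2}` translation modulus `m_p`
(Eyink 2003, (pT-twothirdp)–(norm-pT-twothirdp)). [folklore] -/
theorem typeIV_estimate {k : EuclideanSpace ℝ d → ℝ} (hk : Integrable k volume) {ε : ℝ}
    (hksupp : ∀ ξ, ε < ‖ξ‖ → k ξ = 0)
    {p' G : ℝ × UnitAddTorus d → ℝ}
    (hp : AEStronglyMeasurable p' (stMeasure d T)) (hp32 : ∫⁻ q, ‖p' q‖ₑ ^ (3 / 2 : ℝ) ∂(stMeasure d T) < ∞)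
    (hG : AEStronglyMeasurable G (stMeasure d T)) (hG3 : ∫⁻ q, ‖G q‖ₑ ^ (3 : ℝ) ∂(stMeasure d T) < ∞)
    {mP : ℝ≥0∞} (hmP : mP ≠ ∞)
    (hmod : ∀ ξ : EuclideanSpace ℝ d, ‖ξ‖ ≤ ε →
      (∫⁻ q, ‖p' (stTranslate d ξ q) - p' q‖ₑ ^ (3 / 2 : ℝ) ∂(stMeasure d T)) ^ (2 / 3 : ℝ) ≤ mP) :
    Integrable (fun q : (ℝ × UnitAddTorus d) × EuclideanSpace ℝ d =>
        k q.2 * (p' (stTranslate d q.2 q.1) * G q.1)) ((stMeasure d T).prod volume) ∧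
      |(∫ q, k q.2 * (p' (stTranslate d q.2 q.1) * G q.1) ∂((stMeasure d T).prod volume)) -
          (∫ ξ, k ξ) * ∫ q, p' q * G q ∂(stMeasure d T)| ≤
        ((∫⁻ q, ‖G q‖ₑ ^ (3 : ℝ) ∂(stMeasure d T)) ^ (1 / 3 : ℝ) * mP).toReal * ∫ ξ, |k ξ| := by
  set ν := stMeasure d T with hν
  set NG : ℝ≥0∞ := (∫⁻ q, ‖G q‖ₑ ^ (3 : ℝ) ∂ν) ^ (1 / 3 : ℝ) with hNG
  set Np : ℝ≥0∞ := (∫⁻ q, ‖p' q‖ₑ ^ (3 / 2 : ℝ) ∂ν) ^ (2 / 3 : ℝ) with hNp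
  have hNG_fin : NG ≠ ∞ := (ENNReal.rpow_lt_top_of_nonneg (by norm_num) hG3.ne).ne
  have hNp_fin : Np ≠ ∞ := (ENNReal.rpow_lt_top_of_nonneg (by norm_num) hp32.ne).ne
  have hpτm : AEStronglyMeasurable (fun q : (ℝ × UnitAddTorus d) × EuclideanSpace ℝ d =>
      p' (stTranslate d q.2 q.1)) (ν.prod volume) := aestronglyMeasurable_comp_stTranslate hp
  have hkm : AEStronglyMeasurable (fun q : (ℝ × UnitAddTorus d) × EuclideanSpace ℝ d => k q.2) (ν.prod volume) :=
    hk.aestronglyMeasurable.comp_snd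
  have hH : ∀ ξ : EuclideanSpace ℝ d, ∫⁻ q, ‖p' (stTranslate d ξ q)‖ₑ * ‖G q‖ₑ ∂ν ≤ NG * Np := by
    intro ξ
    have h := lintegral_mul_le_L3_mul_L32 ν hG.enorm (aestronglyMeasurable_comp_stTranslate_left hp ξ).enorm
    rw [lintegral_enorm_rpow_comp_stTranslate p' (3 / 2) ξ] at h
    calc ∫⁻ q, ‖p' (stTranslate d ξ q)‖ₑ * ‖G q‖ₑ ∂ν = ∫⁻ q, ‖G q‖ₑ * ‖p' (stTranslate d ξ q)‖ₑ ∂ν :=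
          lintegral_congr fun q => mul_comm _ _
      _ ≤ NG * Np := h
  have hdomτ := integrable_kernel_mul_translate_mul (T := T) hk hp hG (K := NG * Np)
    (ENNReal.mul_ne_top hNG_fin hNp_fin) hH
  have hintτ : Integrable (fun q : (ℝ × UnitAddTorus d) × EuclideanSpace ℝ d =>
      k q.2 * (p' (stTranslate d q.2 q.1) * G q.1)) (ν.prod volume) := by
    refine hdomτ.mono' (hkm.mul (hpτm.mul hG.comp_fst)) (ae_of_all _ fun q => ?_)
    rw [norm_mul, norm_mul]
  obtain ⟨hgint, -⟩ := integrable_norm_mul_norm_of_L3_L32 hG hG3 hp hp32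
  have hdom0 := integrable_kernel_mul_base (T := T) hk hgint
  have hint0 : Integrable (fun q : (ℝ × UnitAddTorus d) × EuclideanSpace ℝ d =>
      k q.2 * (p' q.1 * G q.1)) (ν.prod volume) := by
    refine hdom0.mono' (hkm.mul (hp.comp_fst.mul hG.comp_fst)) (ae_of_all _ fun q => ?_)
    rw [norm_mul, norm_mul, mul_comm ‖p' q.1‖]
  have hbase : ∫ q, k q.2 * (p' q.1 * G q.1) ∂(ν.prod volume) = (∫ ξ, k ξ) * ∫ q, p' q * G q ∂ν := by
    rw [integral_prod _ hint0]
    have e : ∀ q : ℝ × UnitAddTorus d, ∫ ξ, k ξ * (p' q * G q) = (∫ ξ, k ξ) * (p' q * G q) := fun q =>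
      integral_mul_const _ _
    simp only [e]
    rw [integral_const_mul]
  refine ⟨hintτ, ?_⟩
  rw [← hbase]
  have hM := abs_integral_kernel_mul_sub_le (T := T) hk hintτ hint0 hksupp (M := (NG * mP).toReal)
    (fun ξ hξ => by
      have h := abs_integral_sub_mul_le (μ := ν) (aestronglyMeasurable_comp_stTranslate_left hp ξ) hp
        (lintegral_enorm_translate_sub_rpow_lt_top hp (by norm_num) hp32 ξ) hG hG3
      show |∫ q, (p' (stTranslate d ξ q) * G q - p' q * G q) ∂ν| ≤ _
      have e : ∫ q, (p' (stTranslate d ξ q) * G q - p' q * G q) ∂ν = ∫ q, (p' (stTranslate d ξ q) - p' q) * G q ∂ν :=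
        integral_congr_ae (ae_of_all _ fun q => by ring)
      rw [e]
      refine h.trans ?_
      gcongr
      · exact ENNReal.mul_ne_top hNG_fin hmP
      · exact hmod ξ hξ)
  exact hM

end Generic

/-! ## The longitudinal and transverse projections `ω ⊗ ω`, `1 − ω ⊗ ω` -/

section Projections

/-- The **longitudinal projection** `P_L(ω) v = ⟪ω, v⟫ ω` (`= (ω ⊗ ω) v`; Eyink 2003, (u-LT):
`u_L = (ℓ̂ ⊗ ℓ̂) u`), as a continuous linear map depending on the direction `ω`. [cite: Eyink2003, §2 (u-LT)] -/
def projL (ω : EuclideanSpace ℝ d) : EuclideanSpace ℝ d →L[ℝ] EuclideanSpace ℝ d :=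
  (innerSL ℝ ω).smulRight ω

/-- The **transverse projection** `P_T(ω) v = v − ⟪ω, v⟫ ω` (`= (1 − ω ⊗ ω) v`; Eyink 2003, (u-LT)). [cite: Eyink2003, §2 (u-LT)] -/
def projT (ω : EuclideanSpace ℝ d) : EuclideanSpace ℝ d →L[ℝ] EuclideanSpace ℝ d :=
  ContinuousLinearMap.id ℝ (EuclideanSpace ℝ d) - projL ω

/-- Unfolding `projL`. [folklore] -/
@[simp]
theorem projL_apply (ω v : EuclideanSpace ℝ d) : projL ω v = ⟪ω, v⟫ • ω := rfl

/-- Unfolding `projT`. [folklore] -/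
@[simp]
theorem projT_apply (ω v : EuclideanSpace ℝ d) : projT ω v = v - ⟪ω, v⟫ • ω := rfl

/-- `‖P_L(ω) v‖ ≤ ‖v‖` for `|ω| ≤ 1`. [folklore] -/
theorem norm_projL_le {ω : EuclideanSpace ℝ d} (hω : ‖ω‖ ≤ 1) (v : EuclideanSpace ℝ d) : ‖projL ω v‖ ≤ 1 * ‖v‖ := by
  rw [projL_apply, norm_smul, Real.norm_eq_abs, one_mul]
  calc |⟪ω, v⟫| * ‖ω‖ ≤ (‖ω‖ * ‖v‖) * 1 := mul_le_mul (abs_real_inner_le_norm _ _) hω (norm_nonneg _) (by positivity)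
    _ ≤ (1 * ‖v‖) * 1 := by gcongr
    _ = ‖v‖ := by ring

/-- `‖P_T(ω) v‖ ≤ 2‖v‖` for `|ω| ≤ 1`. [folklore] -/
theorem norm_projT_le {ω : EuclideanSpace ℝ d} (hω : ‖ω‖ ≤ 1) (v : EuclideanSpace ℝ d) : ‖projT ω v‖ ≤ 2 * ‖v‖ := by
  rw [projT_apply]
  calc ‖v - ⟪ω, v⟫ • ω‖ ≤ ‖v‖ + ‖⟪ω, v⟫ • ω‖ := norm_sub_le _ _
    _ = ‖v‖ + ‖projL ω v‖ := by rw [projL_apply]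
    _ ≤ ‖v‖ + 1 * ‖v‖ := by gcongr; exact norm_projL_le hω v
    _ = 2 * ‖v‖ := by ring

/-- The unit direction has norm at most one, so the projection bounds apply to `ω = ξ̂`. [folklore] -/
theorem norm_projL_unit_le (ξ v : EuclideanSpace ℝ d) : ‖projL (‖ξ‖⁻¹ • ξ) v‖ ≤ 1 * ‖v‖ :=
  norm_projL_le (norm_unitDir_le ξ) v

/-- `‖P_T(ξ̂) v‖ ≤ 2‖v‖`. [folklore] -/
theorem norm_projT_unit_le (ξ v : EuclideanSpace ℝ d) : ‖projT (‖ξ‖⁻¹ • ξ) v‖ ≤ 2 * ‖v‖ :=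
  norm_projT_le (norm_unitDir_le ξ) v

/-- Joint continuity of `(ω, v) ↦ P_L(ω) v`. [folklore] -/
theorem continuous_projL : Continuous fun z : EuclideanSpace ℝ d × EuclideanSpace ℝ d => projL z.1 z.2 := by
  simp only [projL_apply]
  fun_prop

/-- Joint continuity of `(ω, v) ↦ P_T(ω) v`. [folklore] -/
theorem continuous_projT : Continuous fun z : EuclideanSpace ℝ d × EuclideanSpace ℝ d => projT z.1 z.2 := by
  simp only [projT_apply]
  fun_prop

/-- The same bounds for the families `ξ ↦ P_•(ξ̂)` in the form consumed by the term estimates. [folklore] -/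
theorem norm_projL_unit_le' (ω v : EuclideanSpace ℝ d) : ‖projL (‖ω‖⁻¹ • ω) v‖ ≤ 1 * ‖v‖ := norm_projL_unit_le ω v

/-! ### Angular integrals of the projections against a radial kernel -/

variable [Nonempty d]

/-- `∫ k(ξ) ⟪P_L(ξ̂) a, c⟫ dξ = d⁻¹ (∫k) ⟪a, c⟫` for a radial integrable `k`
(Eyink 2003, (third-delta): `∫ φ ℓ̂ ⊗ ℓ̂ = ⅓ 1`). [cite: Eyink2003, §2 (third-delta)] -/
theorem integral_mul_inner_projL {k : EuclideanSpace ℝ d → ℝ} (hk : Integrable k volume)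
    (hrad : ∀ x y, ‖x‖ = ‖y‖ → k x = k y) (a c : EuclideanSpace ℝ d) :
    ∫ ξ, k ξ * ⟪projL (‖ξ‖⁻¹ • ξ) a, c⟫ = (Fintype.card d : ℝ)⁻¹ * (∫ ξ, k ξ) * ⟪a, c⟫ := by
  have h := integral_radial_mul_inner_unit_mul_inner_unit hk hrad a c
  rw [← h]
  refine integral_congr_ae (ae_of_all _ fun ξ => ?_)
  simp only
  rw [projL_apply, real_inner_smul_left, real_inner_comm a (‖ξ‖⁻¹ • ξ)]

/-- `∫ k(ξ) ‖P_L(ξ̂) a‖² dξ = d⁻¹ (∫k) |a|²` (`|ξ̂| = 1` off the null set `{0}`). [folklore] -/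
theorem integral_mul_norm_projL_sq {k : EuclideanSpace ℝ d → ℝ} (hk : Integrable k volume)
    (hrad : ∀ x y, ‖x‖ = ‖y‖ → k x = k y) (a : EuclideanSpace ℝ d) :
    ∫ ξ, k ξ * ‖projL (‖ξ‖⁻¹ • ξ) a‖ ^ 2 = (Fintype.card d : ℝ)⁻¹ * (∫ ξ, k ξ) * ‖a‖ ^ 2 := by
  have h := integral_radial_mul_inner_unit_sq hk hrad a
  rw [← h]
  refine integral_congr_ae ?_
  have h0 : ∀ᵐ ξ : EuclideanSpace ℝ d ∂volume, ξ ≠ 0 := by rw [ae_iff]; simp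
  filter_upwards [h0] with ξ hξ
  simp only [projL_apply]
  rw [norm_smul, norm_inv_norm_smul hξ, mul_one, Real.norm_eq_abs, sq_abs, real_inner_comm a]

omit [Nonempty d] in
/-- The angular integrand `k ⟪a,c⟫`-type pieces are integrable: `k(ξ) ⟪P_L(ξ̂) a, c⟫`. [folklore] -/
theorem integrable_mul_inner_projL {k : EuclideanSpace ℝ d → ℝ} (hk : Integrable k volume) (a c : EuclideanSpace ℝ d) :
    Integrable (fun ξ : EuclideanSpace ℝ d => k ξ * ⟪projL (‖ξ‖⁻¹ • ξ) a, c⟫) volume := by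
  have hu : Measurable fun ξ : EuclideanSpace ℝ d => ‖ξ‖⁻¹ • ξ := measurable_unitDir
  have hm : AEStronglyMeasurable (fun ξ : EuclideanSpace ℝ d => k ξ * ⟪projL (‖ξ‖⁻¹ • ξ) a, c⟫) volume := by
    refine hk.aestronglyMeasurable.mul ?_
    have : Continuous fun ω : EuclideanSpace ℝ d => ⟪projL ω a, c⟫ :=
      (continuous_projL.comp (continuous_id.prodMk continuous_const)).inner continuous_const
    exact (this.measurable.comp hu).aestronglyMeasurable
  refine (hk.norm.mul_const (‖a‖ * ‖c‖)).mono' hm (ae_of_all _ fun ξ => ?_)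
  rw [norm_mul, Real.norm_eq_abs, Real.norm_eq_abs]
  gcongr
  calc |⟪projL (‖ξ‖⁻¹ • ξ) a, c⟫| ≤ ‖projL (‖ξ‖⁻¹ • ξ) a‖ * ‖c‖ := abs_real_inner_le_norm _ _
    _ ≤ 1 * ‖a‖ * ‖c‖ := by gcongr; exact norm_projL_unit_le ξ a
    _ = ‖a‖ * ‖c‖ := by ring

omit [Nonempty d] in
/-- `k(ξ) ‖P_L(ξ̂) a‖²` is integrable. [folklore] -/
theorem integrable_mul_norm_projL_sq {k : EuclideanSpace ℝ d → ℝ} (hk : Integrable k volume) (a : EuclideanSpace ℝ d) :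
    Integrable (fun ξ : EuclideanSpace ℝ d => k ξ * ‖projL (‖ξ‖⁻¹ • ξ) a‖ ^ 2) volume := by
  have hu : Measurable fun ξ : EuclideanSpace ℝ d => ‖ξ‖⁻¹ • ξ := measurable_unitDir
  have hm : AEStronglyMeasurable (fun ξ : EuclideanSpace ℝ d => k ξ * ‖projL (‖ξ‖⁻¹ • ξ) a‖ ^ 2) volume := by
    refine hk.aestronglyMeasurable.mul ?_
    have : Continuous fun ω : EuclideanSpace ℝ d => ‖projL ω a‖ ^ 2 :=
      (continuous_projL.comp (continuous_id.prodMk continuous_const)).norm.pow 2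
    exact (this.measurable.comp hu).aestronglyMeasurable
  refine (hk.norm.mul_const (‖a‖ ^ 2)).mono' hm (ae_of_all _ fun ξ => ?_)
  rw [norm_mul, Real.norm_eq_abs, Real.norm_eq_abs, abs_of_nonneg (sq_nonneg ‖projL (‖ξ‖⁻¹ • ξ) a‖)]
  gcongr
  calc ‖projL (‖ξ‖⁻¹ • ξ) a‖ ≤ 1 * ‖a‖ := norm_projL_unit_le ξ a
    _ = ‖a‖ := one_mul _

/-- `∫ k(ξ) ⟪P_T(ξ̂) a, c⟫ dξ = ((d−1)/d) (∫k) ⟪a, c⟫` (`u_T^ε → ⅔ u`, Eyink 2003, §2). [folklore] -/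
theorem integral_mul_inner_projT {k : EuclideanSpace ℝ d → ℝ} (hk : Integrable k volume)
    (hrad : ∀ x y, ‖x‖ = ‖y‖ → k x = k y) (a c : EuclideanSpace ℝ d) :
    ∫ ξ, k ξ * ⟪projT (‖ξ‖⁻¹ • ξ) a, c⟫ = ((Fintype.card d : ℝ) - 1) / Fintype.card d * (∫ ξ, k ξ) * ⟪a, c⟫ := by
  have hL := integral_mul_inner_projL hk hrad a c
  have e : ∀ ξ : EuclideanSpace ℝ d, k ξ * ⟪projT (‖ξ‖⁻¹ • ξ) a, c⟫ = k ξ * ⟪a, c⟫ - k ξ * ⟪projL (‖ξ‖⁻¹ • ξ) a, c⟫ := by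
    intro ξ
    rw [projT_apply, inner_sub_left, ← projL_apply, mul_sub]
  simp_rw [e]
  rw [integral_sub (hk.mul_const _) (integrable_mul_inner_projL hk a c), integral_mul_const, hL]
  have hn : (Fintype.card d : ℝ) ≠ 0 := by exact_mod_cast Fintype.card_ne_zero
  field_simp

/-- `∫ k(ξ) ‖P_T(ξ̂) a‖² dξ = ((d−1)/d) (∫k) |a|²`. [folklore] -/
theorem integral_mul_norm_projT_sq {k : EuclideanSpace ℝ d → ℝ} (hk : Integrable k volume)
    (hrad : ∀ x y, ‖x‖ = ‖y‖ → k x = k y) (a : EuclideanSpace ℝ d) :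
    ∫ ξ, k ξ * ‖projT (‖ξ‖⁻¹ • ξ) a‖ ^ 2 = ((Fintype.card d : ℝ) - 1) / Fintype.card d * (∫ ξ, k ξ) * ‖a‖ ^ 2 := by
  have hL := integral_mul_norm_projL_sq hk hrad a
  -- off the origin `‖P_T a‖² = ‖a‖² − ‖P_L a‖²`
  have hae : (fun ξ : EuclideanSpace ℝ d => k ξ * ‖projT (‖ξ‖⁻¹ • ξ) a‖ ^ 2) =ᵐ[volume]
      fun ξ => k ξ * ‖a‖ ^ 2 - k ξ * ‖projL (‖ξ‖⁻¹ • ξ) a‖ ^ 2 := by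
    have h0 : ∀ᵐ ξ : EuclideanSpace ℝ d ∂volume, ξ ≠ 0 := by rw [ae_iff]; simp
    filter_upwards [h0] with ξ hξ
    have hω : ‖‖ξ‖⁻¹ • ξ‖ = 1 := norm_inv_norm_smul hξ
    rw [projT_apply, projL_apply, ← mul_sub]
    congr 1
    have hPL : ‖⟪‖ξ‖⁻¹ • ξ, a⟫ • (‖ξ‖⁻¹ • ξ)‖ ^ 2 = ⟪‖ξ‖⁻¹ • ξ, a⟫ ^ 2 := by
      rw [norm_smul, hω, mul_one, Real.norm_eq_abs, sq_abs]
    rw [norm_sub_sq_real, hPL, inner_smul_right, real_inner_comm (‖ξ‖⁻¹ • ξ) a]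
    ring
  rw [integral_congr_ae hae, integral_sub (hk.mul_const _) (integrable_mul_norm_projL_sq hk a), integral_mul_const, hL]
  have hn : (Fintype.card d : ℝ) ≠ 0 := by exact_mod_cast Fintype.card_ne_zero
  field_simp

end Projections

/-! ## The three kernels `φ^ε`, `φ_T^ε`, `φ_L^ε` of a spherically symmetric unit-ball mollifier -/

section KernelInstances

variable {φ : EuclideanSpace ℝ d → ℝ} {ε : ℝ}

/-- A rescaled spherically symmetric kernel is spherically symmetric. [folklore] -/
theorem mollifierScale_radial (hrad : ∀ x y : EuclideanSpace ℝ d, ‖x‖ = ‖y‖ → φ x = φ y) (ε : ℝ)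
    (x y : EuclideanSpace ℝ d) (hxy : ‖x‖ = ‖y‖) :
    FluidPDE.mollifierScale ε φ x = FluidPDE.mollifierScale ε φ y := by
  rw [FluidPDE.mollifierScale_apply, FluidPDE.mollifierScale_apply, hrad (ε⁻¹ • x) (ε⁻¹ • y) ?_]
  rw [norm_smul, norm_smul, hxy]

/-- The rescaled mollifier `φ^ε` of a unit-ball mollifier: integrable, nonnegative, of unit mass and
unit absolute mass, vanishing off the closed ball of radius `ε` (`ε > 0`). [folklore] -/
theorem mollifierScale_kernel_facts (hφ : IsUnitBallMollifier φ) (hε : 0 < ε) :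
    Integrable (FluidPDE.mollifierScale ε φ) volume ∧ (∀ ξ, ε < ‖ξ‖ → FluidPDE.mollifierScale ε φ ξ = 0) ∧
      (∫ ξ, FluidPDE.mollifierScale ε φ ξ = 1) ∧ (∫ ξ, |FluidPDE.mollifierScale ε φ ξ| = 1) := by
  have hm := hφ.1.mollifierScale hε
  have hint : Integrable (FluidPDE.mollifierScale ε φ) volume := hm.1.continuous.integrable_of_hasCompactSupport hm.2.1
  refine ⟨hint, fun ξ hξ => mollifierScale_eq_zero_of_unitBall_lt hφ.2 hε hξ, integral_mollifierScale hφ.1 hε, ?_⟩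
  rw [← integral_mollifierScale hφ.1 hε]
  exact integral_congr_ae (ae_of_all _ fun ξ => abs_of_nonneg (hm.2.2.2.1 ξ))

/-- **Eyink's transverse kernel of a unit-ball mollifier**: `φ_T` is integrable, nonnegative, radial
when `φ` is, vanishes off the closed unit ball, and has mass `(d−1)/d` (`d ≥ 1`). [folklore] -/
theorem eyinkTransverseKernel_facts (hφ : IsUnitBallMollifier φ) (hd : 1 ≤ Fintype.card d) :
    Integrable (eyinkTransverseKernel d φ) volume ∧ (∀ ξ, 0 ≤ eyinkTransverseKernel d φ ξ) ∧
      (∀ ξ, 1 < ‖ξ‖ → eyinkTransverseKernel d φ ξ = 0) ∧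
      ∫ ξ, eyinkTransverseKernel d φ ξ = ((Fintype.card d : ℝ) - 1) / Fintype.card d := by
  have hc : Continuous φ := hφ.1.1.continuous
  obtain ⟨hint, hmass⟩ := integrable_transverseKernel hc hφ.1.2.1 hφ.1.2.2.2.1 hd
  have e : eyinkTransverseKernel d φ = fun ξ => ((Fintype.card d : ℝ) - 1) * ∫ s in Ioi (1 : ℝ), s⁻¹ * φ (s • ξ) := by
    funext ξ; rfl
  refine ⟨by rw [e]; exact hint, fun ξ => transverseKernel_nonneg hφ.1.2.2.2.1 hd ξ,
    fun ξ hξ => transverseKernel_eq_zero_of_lt hφ.2 hξ, ?_⟩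
  rw [e, hmass, hφ.1.2.2.2.2, mul_one]

/-- The transverse kernel of a radial `φ` is radial. [folklore] -/
theorem eyinkTransverseKernel_radial (hrad : ∀ x y : EuclideanSpace ℝ d, ‖x‖ = ‖y‖ → φ x = φ y)
    (x y : EuclideanSpace ℝ d) (hxy : ‖x‖ = ‖y‖) :
    eyinkTransverseKernel d φ x = eyinkTransverseKernel d φ y := by
  rw [eyinkTransverseKernel_apply, eyinkTransverseKernel_apply]
  congr 1
  refine setIntegral_congr_fun measurableSet_Ioi fun s _ => ?_
  rw [hrad (s • x) (s • y) (by rw [norm_smul, norm_smul, hxy])]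

/-- **The rescaled transverse kernel `φ_T^ε`** (`= (φ^ε)_T`): integrable, vanishing off the closed
ball of radius `ε`, of mass and absolute mass `(d−1)/d` (`ε > 0`, `d ≥ 1`). [folklore] -/
theorem transverseKernel_scaled_facts (hφ : IsUnitBallMollifier φ) (hd : 1 ≤ Fintype.card d) (hε : 0 < ε) :
    Integrable (eyinkTransverseKernel d (FluidPDE.mollifierScale ε φ)) volume ∧
      (∀ ξ, ε < ‖ξ‖ → eyinkTransverseKernel d (FluidPDE.mollifierScale ε φ) ξ = 0) ∧
      (∫ ξ, eyinkTransverseKernel d (FluidPDE.mollifierScale ε φ) ξ = ((Fintype.card d : ℝ) - 1) / Fintype.card d) ∧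
      (∫ ξ, |eyinkTransverseKernel d (FluidPDE.mollifierScale ε φ) ξ| = ((Fintype.card d : ℝ) - 1) / Fintype.card d) := by
  obtain ⟨hint, hnn, hsupp, hmass⟩ := eyinkTransverseKernel_facts hφ hd
  have e : eyinkTransverseKernel d (FluidPDE.mollifierScale ε φ) = FluidPDE.mollifierScale ε (eyinkTransverseKernel d φ) := by
    funext ξ; exact eyinkTransverseKernel_mollifierScale φ ε ξ
  rw [e]
  refine ⟨integrable_mollifierScale hint hε, fun ξ hξ => mollifierScale_eq_zero_of_unitBall_lt hsupp hε hξ, ?_, ?_⟩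
  · rw [integral_mollifierScale_eq _ hε, hmass]
  · rw [integral_abs_mollifierScale _ hε]
    rw [show (fun ξ => |eyinkTransverseKernel d φ ξ|) = eyinkTransverseKernel d φ from funext fun ξ => abs_of_nonneg (hnn ξ)]
    exact hmass

/-- **The rescaled longitudinal kernel `φ_L^ε = φ^ε − φ_T^ε`**: integrable, vanishing off the closed
ball of radius `ε`, of mass `1/d` and absolute mass at most `1 + (d−1)/d` (`ε > 0`, `d ≥ 1`)
(Eyink 2003, (phi-LT): `p_L^ε → ⅓ p`). [folklore] -/
theorem longitudinalKernel_scaled_facts (hφ : IsUnitBallMollifier φ) (hd : 1 ≤ Fintype.card d) (hε : 0 < ε) :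
    Integrable (eyinkLongitudinalKernel d (FluidPDE.mollifierScale ε φ)) volume ∧
      (∀ ξ, ε < ‖ξ‖ → eyinkLongitudinalKernel d (FluidPDE.mollifierScale ε φ) ξ = 0) ∧
      (∫ ξ, eyinkLongitudinalKernel d (FluidPDE.mollifierScale ε φ) ξ = (Fintype.card d : ℝ)⁻¹) ∧
      (∫ ξ, |eyinkLongitudinalKernel d (FluidPDE.mollifierScale ε φ) ξ| ≤ 1 + ((Fintype.card d : ℝ) - 1) / Fintype.card d) := by
  obtain ⟨hk, hksupp, hk1, hkabs⟩ := mollifierScale_kernel_facts hφ hε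
  obtain ⟨hT, hTsupp, hTmass, hTabs⟩ := transverseKernel_scaled_facts hφ hd hε
  have e : eyinkLongitudinalKernel d (FluidPDE.mollifierScale ε φ) =
      fun ξ => FluidPDE.mollifierScale ε φ ξ - eyinkTransverseKernel d (FluidPDE.mollifierScale ε φ) ξ := by
    funext ξ; rfl
  rw [e]
  have hn : (Fintype.card d : ℝ) ≠ 0 := by
    have : (1 : ℝ) ≤ Fintype.card d := by exact_mod_cast hd
    linarith
  refine ⟨hk.sub hT, fun ξ hξ => by simp only [hksupp ξ hξ, hTsupp ξ hξ, sub_zero], ?_, ?_⟩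
  · rw [integral_sub hk hT, hk1, hTmass]
    field_simp
    ring
  · calc ∫ ξ, |FluidPDE.mollifierScale ε φ ξ - eyinkTransverseKernel d (FluidPDE.mollifierScale ε φ) ξ|
        ≤ ∫ ξ, (|FluidPDE.mollifierScale ε φ ξ| + |eyinkTransverseKernel d (FluidPDE.mollifierScale ε φ) ξ|) :=
          integral_mono_of_nonneg (ae_of_all _ fun ξ => abs_nonneg _) (hk.abs.add hT.abs)
            (ae_of_all _ fun ξ => abs_sub _ _)
      _ = 1 + ((Fintype.card d : ℝ) - 1) / Fintype.card d := by
          rw [integral_add hk.abs hT.abs, hkabs, hTabs]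

end KernelInstances

/-! ## Lower exponents on the finite measure space `(0,T) × T^d`; a.e. integrability in `ξ` -/

section LowerExponents

variable {T : ℝ} {F : Type*} [NormedAddCommGroup F]

/-- On `(0,T) × T^d` (finite measure), `∫⁻ ‖f‖ₑ^r < ∞` for `0 < r ≤ q` whenever `∫⁻ ‖f‖ₑ^q < ∞`
(`q ≥ 1`; Lyapunov / `MemLp.mono_exponent`). [folklore] -/
theorem lintegral_enorm_rpow_lt_top_of_le {f : ℝ × UnitAddTorus d → F}
    (hf : AEStronglyMeasurable f (stMeasure d T)) {q : ℝ} (hq : 1 ≤ q)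
    (hfq : ∫⁻ z, ‖f z‖ₑ ^ q ∂(stMeasure d T) < ∞) {r : ℝ} (hr0 : 0 < r) (hr : r ≤ q) :
    ∫⁻ z, ‖f z‖ₑ ^ r ∂(stMeasure d T) < ∞ := by
  have hq0 : 0 < q := one_pos.trans_le hq
  have hMq : MemLp f (ENNReal.ofReal q) (stMeasure d T) := by
    refine ⟨hf, (eLpNorm_lt_top_iff_lintegral_rpow_enorm_lt_top (by simp [hq0]) ENNReal.ofReal_ne_top).2 ?_⟩
    simpa only [ENNReal.toReal_ofReal hq0.le] using hfq
  have hM : MemLp f (ENNReal.ofReal r) (stMeasure d T) :=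
    hMq.mono_exponent (ENNReal.ofReal_le_ofReal hr)
  have h := (eLpNorm_lt_top_iff_lintegral_rpow_enorm_lt_top (p := ENNReal.ofReal r) (by simp [hr0])
    ENNReal.ofReal_ne_top).1 hM.2
  simpa only [ENNReal.toReal_ofReal hr0.le] using h

/-- **A.e. integrability in the separation** of a kernel-weighted translated factor: if
`k ∈ L¹(ℝ^d)` and `a ∈ L¹((0,T) × T^d)`, then for a.e. `(t,x)` the function `ξ ↦ |k(ξ)| ‖a(t, x+ξ)‖`
is integrable (Tonelli: the joint function is integrable). [folklore] -/
theorem ae_integrable_kernel_mul_translate {k : EuclideanSpace ℝ d → ℝ} (hk : Integrable k volume)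
    {a : ℝ × UnitAddTorus d → F} (ha : AEStronglyMeasurable a (stMeasure d T))
    (ha1 : ∫⁻ q, ‖a q‖ₑ ∂(stMeasure d T) < ∞) :
    Integrable (fun q : (ℝ × UnitAddTorus d) × EuclideanSpace ℝ d => ‖k q.2‖ * ‖a (stTranslate d q.2 q.1)‖)
        ((stMeasure d T).prod volume) ∧
      ∀ᵐ q ∂(stMeasure d T), Integrable (fun ξ : EuclideanSpace ℝ d => ‖k ξ‖ * ‖a (stTranslate d ξ q)‖) volume := by
  have h := integrable_kernel_mul_translate_mul (T := T) hk ha (aestronglyMeasurable_const (b := (1 : ℝ)))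
    (K := ∫⁻ q, ‖a q‖ₑ ∂(stMeasure d T)) ha1.ne (fun ξ => by
      have e : ∫⁻ q, ‖a (stTranslate d ξ q)‖ₑ * ‖(1 : ℝ)‖ₑ ∂(stMeasure d T) = ∫⁻ q, ‖a q‖ₑ ^ (1 : ℝ) ∂(stMeasure d T) := by
        rw [← lintegral_enorm_rpow_comp_stTranslate a 1 ξ]
        exact lintegral_congr fun q => by simp
      rw [e]
      exact le_of_eq (lintegral_congr fun q => by simp))
  have h' : Integrable (fun q : (ℝ × UnitAddTorus d) × EuclideanSpace ℝ d => ‖k q.2‖ * ‖a (stTranslate d q.2 q.1)‖)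
      ((stMeasure d T).prod volume) := by
    refine h.congr (ae_of_all _ fun q => ?_)
    simp
  exact ⟨h', h'.prod_right_ae⟩

end LowerExponents

/-! ## Pairings of the kernel-defined objects: moving `⟪·, c⟫` inside the `ξ`-integral -/

section Unfold

variable {T : ℝ}

/-- **Velocity pairings unfold** (a.e.): for `k ∈ L¹`, a bounded continuous projection family `A`
and `u ∈ L¹((0,T) × T^d)`, at a.e. `(t,x)` the `ξ`-integrand `k(ξ) A(ξ̂) u(t,x+ξ)` is integrable and
`⟪∫ k(ξ) A(ξ̂) u(t,x+ξ) dξ, c⟫ = ∫ k(ξ) ⟪A(ξ̂) u(t,x+ξ), c⟫ dξ`. [folklore] -/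
theorem ae_inner_integral_kernel_smul_eq {k : EuclideanSpace ℝ d → ℝ} (hk : Integrable k volume)
    (A : EuclideanSpace ℝ d → EuclideanSpace ℝ d →L[ℝ] EuclideanSpace ℝ d) {CA : ℝ}
    (hA : ∀ ξ v : EuclideanSpace ℝ d, ‖A (‖ξ‖⁻¹ • ξ) v‖ ≤ CA * ‖v‖)
    (hAc : Continuous fun z : EuclideanSpace ℝ d × EuclideanSpace ℝ d => A z.1 z.2)
    {u' : ℝ × UnitAddTorus d → EuclideanSpace ℝ d} (hu : AEStronglyMeasurable u' (stMeasure d T))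
    (hu1 : ∫⁻ q, ‖u' q‖ₑ ∂(stMeasure d T) < ∞) (c : ℝ × UnitAddTorus d → EuclideanSpace ℝ d) :
    ∀ᵐ q ∂(stMeasure d T),
      Integrable (fun ξ : EuclideanSpace ℝ d => k ξ • A (‖ξ‖⁻¹ • ξ) (u' (stTranslate d ξ q))) volume ∧
      ⟪(∫ ξ, k ξ • A (‖ξ‖⁻¹ • ξ) (u' (stTranslate d ξ q))), c q⟫ =
        ∫ ξ, k ξ * ⟪A (‖ξ‖⁻¹ • ξ) (u' (stTranslate d ξ q)), c q⟫ := by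
  set ν := stMeasure d T with hν
  obtain ⟨hdom, -⟩ := ae_integrable_kernel_mul_translate (T := T) hk hu hu1
  have hunit : Measurable fun ξ : EuclideanSpace ℝ d => ‖ξ‖⁻¹ • ξ := measurable_unitDir
  have hAτm : AEStronglyMeasurable (fun q : (ℝ × UnitAddTorus d) × EuclideanSpace ℝ d =>
      A (‖q.2‖⁻¹ • q.2) (u' (stTranslate d q.2 q.1))) (ν.prod volume) :=
    hAc.comp_aestronglyMeasurable ((hunit.comp measurable_snd).aestronglyMeasurable.prodMk
      (aestronglyMeasurable_comp_stTranslate hu))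
  have hkm : AEStronglyMeasurable (fun q : (ℝ × UnitAddTorus d) × EuclideanSpace ℝ d => k q.2) (ν.prod volume) :=
    hk.aestronglyMeasurable.comp_snd
  have hvec : Integrable (fun q : (ℝ × UnitAddTorus d) × EuclideanSpace ℝ d =>
      k q.2 • A (‖q.2‖⁻¹ • q.2) (u' (stTranslate d q.2 q.1))) (ν.prod volume) := by
    refine (hdom.const_mul CA).mono' (hkm.smul hAτm) (ae_of_all _ fun q => ?_)
    rw [norm_smul]
    calc ‖k q.2‖ * ‖A (‖q.2‖⁻¹ • q.2) (u' (stTranslate d q.2 q.1))‖ ≤ ‖k q.2‖ * (CA * ‖u' (stTranslate d q.2 q.1)‖) := by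
          gcongr; exact hA _ _
      _ = CA * (‖k q.2‖ * ‖u' (stTranslate d q.2 q.1)‖) := by ring
  filter_upwards [hvec.prod_right_ae] with q hq
  refine ⟨hq, ?_⟩
  rw [real_inner_comm, ← integral_inner hq (c q)]
  refine integral_congr_ae (ae_of_all _ fun ξ => ?_)
  simp only
  rw [real_inner_smul_right, real_inner_comm]

/-- **Energy-flux pairings unfold** (a.e.): for `k ∈ L¹`, `A` as above and `u ∈ L³((0,T) × T^d)`, at
a.e. `(t,x)`: `⟪∫ k(ξ)‖A(ξ̂)u₊‖² u₊ dξ, H⟫ = ∫ k(ξ) ‖A(ξ̂)u₊‖² ⟪u₊, H⟫ dξ` (`u₊ = u(t,x+ξ)`). [folklore] -/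
theorem ae_inner_integral_kernel_normSq_smul_eq {k : EuclideanSpace ℝ d → ℝ} (hk : Integrable k volume)
    (A : EuclideanSpace ℝ d → EuclideanSpace ℝ d →L[ℝ] EuclideanSpace ℝ d) {CA : ℝ}
    (hA : ∀ ξ v : EuclideanSpace ℝ d, ‖A (‖ξ‖⁻¹ • ξ) v‖ ≤ CA * ‖v‖)
    (hAc : Continuous fun z : EuclideanSpace ℝ d × EuclideanSpace ℝ d => A z.1 z.2)
    {u' : ℝ × UnitAddTorus d → EuclideanSpace ℝ d} (hu : AEStronglyMeasurable u' (stMeasure d T))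
    (hu3 : ∫⁻ q, ‖u' q‖ₑ ^ (3 : ℝ) ∂(stMeasure d T) < ∞) (H : ℝ × UnitAddTorus d → EuclideanSpace ℝ d) :
    ∀ᵐ q ∂(stMeasure d T),
      Integrable (fun ξ : EuclideanSpace ℝ d =>
        (k ξ * ‖A (‖ξ‖⁻¹ • ξ) (u' (stTranslate d ξ q))‖ ^ 2) • u' (stTranslate d ξ q)) volume ∧
      ⟪(∫ ξ, (k ξ * ‖A (‖ξ‖⁻¹ • ξ) (u' (stTranslate d ξ q))‖ ^ 2) • u' (stTranslate d ξ q)), H q⟫ =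
        ∫ ξ, k ξ * (‖A (‖ξ‖⁻¹ • ξ) (u' (stTranslate d ξ q))‖ ^ 2 * ⟪u' (stTranslate d ξ q), H q⟫) := by
  set ν := stMeasure d T with hν
  -- `‖u‖³ ∈ L¹`
  have hcubem : AEStronglyMeasurable (fun q : ℝ × UnitAddTorus d => ‖u' q‖ ^ 3) ν := hu.norm.pow 3
  have hcube1 : ∫⁻ q, ‖‖u' q‖ ^ 3‖ₑ ∂ν < ∞ := by
    have e : ∫⁻ q, ‖‖u' q‖ ^ 3‖ₑ ∂ν = ∫⁻ q, ‖u' q‖ₑ ^ (3 : ℝ) ∂ν :=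
      lintegral_congr fun q => by rw [enorm_norm_pow, ENNReal.pow_three_eq_rpow]
    rw [e]; exact hu3
  obtain ⟨hdom, -⟩ := ae_integrable_kernel_mul_translate (T := T) hk hcubem hcube1
  have hunit : Measurable fun ξ : EuclideanSpace ℝ d => ‖ξ‖⁻¹ • ξ := measurable_unitDir
  have huτm : AEStronglyMeasurable (fun q : (ℝ × UnitAddTorus d) × EuclideanSpace ℝ d =>
      u' (stTranslate d q.2 q.1)) (ν.prod volume) := aestronglyMeasurable_comp_stTranslate hu
  have hAτm : AEStronglyMeasurable (fun q : (ℝ × UnitAddTorus d) × EuclideanSpace ℝ d =>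
      A (‖q.2‖⁻¹ • q.2) (u' (stTranslate d q.2 q.1))) (ν.prod volume) :=
    hAc.comp_aestronglyMeasurable ((hunit.comp measurable_snd).aestronglyMeasurable.prodMk huτm)
  have hkm : AEStronglyMeasurable (fun q : (ℝ × UnitAddTorus d) × EuclideanSpace ℝ d => k q.2) (ν.prod volume) :=
    hk.aestronglyMeasurable.comp_snd
  have hvec : Integrable (fun q : (ℝ × UnitAddTorus d) × EuclideanSpace ℝ d =>
      (k q.2 * ‖A (‖q.2‖⁻¹ • q.2) (u' (stTranslate d q.2 q.1))‖ ^ 2) • u' (stTranslate d q.2 q.1)) (ν.prod volume) := by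
    refine (hdom.const_mul (CA ^ 2)).mono' ((hkm.mul (hAτm.norm.pow 2)).smul huτm) (ae_of_all _ fun q => ?_)
    rw [norm_smul, norm_mul, Real.norm_eq_abs, Real.norm_eq_abs,
      abs_of_nonneg (sq_nonneg ‖A (‖q.2‖⁻¹ • q.2) (u' (stTranslate d q.2 q.1))‖)]
    have hq : ‖A (‖q.2‖⁻¹ • q.2) (u' (stTranslate d q.2 q.1))‖ ^ 2 ≤ CA ^ 2 * ‖u' (stTranslate d q.2 q.1)‖ ^ 2 := by
      rw [← mul_pow]; exact pow_le_pow_left₀ (norm_nonneg _) (hA _ _) 2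
    calc |k q.2| * ‖A (‖q.2‖⁻¹ • q.2) (u' (stTranslate d q.2 q.1))‖ ^ 2 * ‖u' (stTranslate d q.2 q.1)‖
        ≤ |k q.2| * (CA ^ 2 * ‖u' (stTranslate d q.2 q.1)‖ ^ 2) * ‖u' (stTranslate d q.2 q.1)‖ := by gcongr
      _ = CA ^ 2 * (‖k q.2‖ * ‖‖u' (stTranslate d q.2 q.1)‖ ^ 3‖) := by
          rw [Real.norm_eq_abs, Real.norm_eq_abs, abs_of_nonneg (pow_nonneg (norm_nonneg _) 3)]; ring
  filter_upwards [hvec.prod_right_ae] with q hq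
  refine ⟨hq, ?_⟩
  rw [real_inner_comm, ← integral_inner hq (H q)]
  refine integral_congr_ae (ae_of_all _ fun ξ => ?_)
  simp only
  rw [real_inner_smul_right, real_inner_comm]
  ring

end Unfold

/-! ## Test-function data: global bounds for `∂ₜψ`, `∇ψ` of a test function supported in `(0,T)` -/

section TestData

variable {T : ℝ} {ψ : ℝ → UnitAddTorus d → ℝ}

/-- The spatial gradient of the zero function vanishes (local copy of the tree's
`Torus.torusGradient_zero`, `ClassicalOpenStripEnergy`, kept private to avoid the import). [folklore] -/
private theorem torusGradient_zero_apply (x : UnitAddTorus d) : FunctionSpaces.Torus.gradient (0 : UnitAddTorus d → ℝ) x = 0 := by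
  have : FunctionSpaces.Torus.liftAt (0 : UnitAddTorus d → ℝ) x = Function.const _ (0 : ℝ) := by
    funext v; rfl
  rw [FunctionSpaces.Torus.gradient, this, gradient_const]

/-- The time derivative of a test function supported in `(0,T)` is again supported in `(0,T)`
(it vanishes for `t ≤ ε/2` when `ψ` vanishes for `t ≤ ε`). [folklore] -/
theorem _root_.Literature.Analysis.FunctionSpaces.Torus.IsSpaceTimeTestIoo.timeDeriv_Ioo
    (hψ : FunctionSpaces.Torus.IsSpaceTimeTestIoo T ψ) :
    FunctionSpaces.Torus.IsSpaceTimeTestIoo T (FunctionSpaces.Torus.timeDeriv ψ) := by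
  obtain ⟨h1, ε, hε, h0⟩ := hψ
  refine ⟨h1.timeDeriv, ε / 2, half_pos hε, fun t ht => ?_⟩
  funext x
  have h : (fun τ => ψ τ x) =ᶠ[𝓝 t] fun _ => (0 : ℝ) := by
    filter_upwards [Iio_mem_nhds (show t < ε by linarith)] with τ hτ
    rw [h0 τ (le_of_lt hτ), Pi.zero_apply]
  change deriv (fun τ => ψ τ x) t = 0
  rw [h.deriv_eq, deriv_const]

/-- **Global bounds and measurability of the test data**: for `ψ` a test function supported in
`(0,T) × T^d` there is `C ≥ 0` with `|∂ₜψ| ≤ C` and `‖∇ψ‖ ≤ C` everywhere, and both fields are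
jointly measurable on `(0,T) × T^d`. [folklore] -/
theorem _root_.Literature.Analysis.FunctionSpaces.Torus.IsSpaceTimeTestIoo.testData_bound
    (hψ : FunctionSpaces.Torus.IsSpaceTimeTestIoo T ψ) :
    ∃ C : ℝ, 0 ≤ C ∧ (∀ t x, |FunctionSpaces.Torus.timeDeriv ψ t x| ≤ C) ∧
      (∀ t x, ‖FunctionSpaces.Torus.gradient (ψ t) x‖ ≤ C) ∧
      AEStronglyMeasurable (uncurry (FunctionSpaces.Torus.timeDeriv ψ)) (stMeasure d T) ∧
      AEStronglyMeasurable (fun z : ℝ × UnitAddTorus d => FunctionSpaces.Torus.gradient (ψ z.1) z.2) (stMeasure d T) := by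
  obtain ⟨Cdt, hdt⟩ := hψ.timeDeriv_Ioo.exists_abs_le
  obtain ⟨-, hdt', hgr, -⟩ := hψ.1.isSmoothSpaceTimeOn_derived
  obtain ⟨⟨Cgr, hCgr0, hCgr⟩, hgrm⟩ := hgr.bound_and_measurable T
  obtain ⟨-, hdtm⟩ := hdt'.bound_and_measurable T
  obtain ⟨⟨-, T', hT', hψT'⟩, ε, hε, hψε⟩ := hψ
  refine ⟨max Cdt Cgr, le_max_of_le_right hCgr0, fun t x => (hdt t x).trans (le_max_left _ _), fun t x => ?_,
    hdtm, hgrm⟩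
  by_cases ht : t ∈ Icc 0 T
  · exact (hCgr t ht x).trans (le_max_right _ _)
  · have hz : ψ t = 0 := by
      simp only [mem_Icc, not_and_or, not_le] at ht
      rcases ht with ht | ht
      · exact hψε t (ht.le.trans hε.le)
      · exact hψT' t (hT'.le.trans ht.le)
    rw [hz, torusGradient_zero_apply, norm_zero]
    exact le_max_of_le_right hCgr0

end TestData

/-! ## The master estimate: the four terms of a balance pairing against their limits -/

section Master

variable {T : ℝ}

/-- Cube-integrability of a velocity-weighted bounded field: `|G| ≤ C‖u‖` pointwise gives
`∫⁻ ‖G‖ₑ³ ≤ C³ ∫⁻ ‖u‖ₑ³ < ∞`. [folklore] -/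
theorem lintegral_enorm_rpow_three_lt_top_of_le {α : Type*} [MeasurableSpace α] {μ : Measure α}
    {u' : α → EuclideanSpace ℝ d} {G : α → ℝ} {C : ℝ} (hC : 0 ≤ C) (hG : ∀ a, |G a| ≤ C * ‖u' a‖)
    (hu3 : ∫⁻ a, ‖u' a‖ₑ ^ (3 : ℝ) ∂μ < ∞) : ∫⁻ a, ‖G a‖ₑ ^ (3 : ℝ) ∂μ < ∞ := by
  calc ∫⁻ a, ‖G a‖ₑ ^ (3 : ℝ) ∂μ ≤ ∫⁻ a, (ENNReal.ofReal C * ‖u' a‖ₑ) ^ (3 : ℝ) ∂μ := by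
        refine lintegral_mono fun a => ENNReal.rpow_le_rpow ?_ (by norm_num)
        rw [Real.enorm_eq_ofReal_abs, ← ofReal_norm, ← ENNReal.ofReal_mul hC]
        exact ENNReal.ofReal_le_ofReal (hG a)
    _ = ENNReal.ofReal C ^ (3 : ℝ) * ∫⁻ a, ‖u' a‖ₑ ^ (3 : ℝ) ∂μ := by
        rw [← lintegral_const_mul' _ _ (ENNReal.rpow_ne_top_of_nonneg (by norm_num) ENNReal.ofReal_ne_top)]
        exact lintegral_congr fun a => ENNReal.mul_rpow_of_nonneg _ _ (by norm_num)
    _ < ∞ := ENNReal.mul_lt_top (ENNReal.rpow_lt_top_of_nonneg (by norm_num) ENNReal.ofReal_ne_top) hu3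

/-- `L^{3/2}`-integrability of the Type-I weight `c = 2(∂ₜψ + ⟪u,∇ψ⟫) u + 2p ∇ψ`:
`‖c‖ ≤ 2C‖u‖ + 2C‖u‖² + 2C|p|`, each piece in `L^{3/2}((0,T) × T^d)`. [folklore] -/
theorem lintegral_enorm_typeIWeight_lt_top {u' : ℝ × UnitAddTorus d → EuclideanSpace ℝ d}
    (hu : AEStronglyMeasurable u' (stMeasure d T)) (hu3 : ∫⁻ q, ‖u' q‖ₑ ^ (3 : ℝ) ∂(stMeasure d T) < ∞)
    {p' : ℝ × UnitAddTorus d → ℝ} (hp : AEStronglyMeasurable p' (stMeasure d T))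
    (hp32 : ∫⁻ q, ‖p' q‖ₑ ^ (3 / 2 : ℝ) ∂(stMeasure d T) < ∞)
    {θ : ℝ × UnitAddTorus d → ℝ} {H : ℝ × UnitAddTorus d → EuclideanSpace ℝ d} {Cψ : ℝ} (hCψ : 0 ≤ Cψ)
    (hθb : ∀ q, |θ q| ≤ Cψ) (hHb : ∀ q, ‖H q‖ ≤ Cψ) :
    ∫⁻ q, ‖(2 * (θ q + ⟪u' q, H q⟫)) • u' q + (2 * p' q) • H q‖ₑ ^ (3 / 2 : ℝ) ∂(stMeasure d T) < ∞ := by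
  set ν := stMeasure d T with hν
  have hu32 : ∫⁻ q, ‖u' q‖ₑ ^ (3 / 2 : ℝ) ∂ν < ∞ :=
    lintegral_enorm_rpow_lt_top_of_le hu (by norm_num) hu3 (by norm_num) (by norm_num)
  set C2 : ℝ≥0∞ := ENNReal.ofReal (2 * Cψ) with hC2
  -- pointwise: `‖c‖ ≤ 2C (‖u‖ + ‖u‖² + |p|)`
  have hpt : ∀ q, ‖(2 * (θ q + ⟪u' q, H q⟫)) • u' q + (2 * p' q) • H q‖ₑ ≤
      C2 * (‖u' q‖ₑ + (‖u' q‖ₑ ^ 2 + ‖p' q‖ₑ)) := by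
    intro q
    have hreal : ‖(2 * (θ q + ⟪u' q, H q⟫)) • u' q + (2 * p' q) • H q‖ ≤
        2 * Cψ * (‖u' q‖ + (‖u' q‖ ^ 2 + |p' q|)) := by
      calc ‖(2 * (θ q + ⟪u' q, H q⟫)) • u' q + (2 * p' q) • H q‖
          ≤ ‖(2 * (θ q + ⟪u' q, H q⟫)) • u' q‖ + ‖(2 * p' q) • H q‖ := norm_add_le _ _
        _ = 2 * |θ q + ⟪u' q, H q⟫| * ‖u' q‖ + 2 * |p' q| * ‖H q‖ := by
            rw [norm_smul, norm_smul, Real.norm_eq_abs, Real.norm_eq_abs, abs_mul, abs_mul, abs_two]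
        _ ≤ 2 * (Cψ + ‖u' q‖ * Cψ) * ‖u' q‖ + 2 * |p' q| * Cψ := by
            gcongr
            · calc |θ q + ⟪u' q, H q⟫| ≤ |θ q| + |⟪u' q, H q⟫| := abs_add_le _ _
                _ ≤ Cψ + ‖u' q‖ * ‖H q‖ := add_le_add (hθb q) (abs_real_inner_le_norm _ _)
                _ ≤ Cψ + ‖u' q‖ * Cψ := by gcongr; exact hHb q
            · exact hHb q
        _ = 2 * Cψ * (‖u' q‖ + (‖u' q‖ ^ 2 + |p' q|)) := by ring
    rw [← ofReal_norm]
    refine (ENNReal.ofReal_le_ofReal hreal).trans (le_of_eq ?_)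
    rw [ENNReal.ofReal_mul (by positivity), ENNReal.ofReal_add (norm_nonneg _) (by positivity),
      ENNReal.ofReal_add (sq_nonneg _) (abs_nonneg _), ENNReal.ofReal_pow (norm_nonneg _), ofReal_norm,
      ← Real.enorm_eq_ofReal_abs]
  have h32 : (1 : ℝ) ≤ 3 / 2 := by norm_num
  calc ∫⁻ q, ‖(2 * (θ q + ⟪u' q, H q⟫)) • u' q + (2 * p' q) • H q‖ₑ ^ (3 / 2 : ℝ) ∂ν
      ≤ ∫⁻ q, (C2 * (‖u' q‖ₑ + (‖u' q‖ₑ ^ 2 + ‖p' q‖ₑ))) ^ (3 / 2 : ℝ) ∂ν :=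
        lintegral_mono fun q => ENNReal.rpow_le_rpow (hpt q) (by norm_num)
    _ ≤ ∫⁻ q, C2 ^ (3 / 2 : ℝ) * (2 ^ (3 / 2 - 1 : ℝ) * (‖u' q‖ₑ ^ (3 / 2 : ℝ) +
          2 ^ (3 / 2 - 1 : ℝ) * ((‖u' q‖ₑ ^ 2) ^ (3 / 2 : ℝ) + ‖p' q‖ₑ ^ (3 / 2 : ℝ)))) ∂ν := by
        refine lintegral_mono fun q => ?_
        rw [ENNReal.mul_rpow_of_nonneg _ _ (by norm_num)]
        gcongr
        refine (ENNReal.rpow_add_le_mul_rpow_add_rpow _ _ h32).trans ?_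
        gcongr
        exact ENNReal.rpow_add_le_mul_rpow_add_rpow _ _ h32
    _ = C2 ^ (3 / 2 : ℝ) * (2 ^ (3 / 2 - 1 : ℝ) * ((∫⁻ q, ‖u' q‖ₑ ^ (3 / 2 : ℝ) ∂ν) +
          2 ^ (3 / 2 - 1 : ℝ) * ((∫⁻ q, ‖u' q‖ₑ ^ (3 : ℝ) ∂ν) + ∫⁻ q, ‖p' q‖ₑ ^ (3 / 2 : ℝ) ∂ν))) := by
        have hmeas1 : AEMeasurable (fun q => ‖u' q‖ₑ ^ (3 / 2 : ℝ)) ν := hu.enorm.pow_const _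
        have hmeas2 : AEMeasurable (fun q => ‖u' q‖ₑ ^ (3 : ℝ)) ν := hu.enorm.pow_const _
        have hmeas3 : AEMeasurable (fun q => ‖p' q‖ₑ ^ (3 / 2 : ℝ)) ν := hp.enorm.pow_const _
        simp only [ENNReal.sq_rpow_three_halves]
        rw [lintegral_const_mul'' _ ?_, lintegral_const_mul'' _ ?_, lintegral_add_left' hmeas1,
          lintegral_const_mul'' _ ?_, lintegral_add_left' hmeas2]
        · exact hmeas2.add hmeas3
        · exact hmeas1.add ((hmeas2.add hmeas3).const_mul _)
        · exact (hmeas1.add ((hmeas2.add hmeas3).const_mul _)).const_mul _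
    _ < ∞ := by
        have h2 : (2 : ℝ≥0∞) ^ (3 / 2 - 1 : ℝ) < ∞ := ENNReal.rpow_lt_top_of_nonneg (by norm_num) (by simp)
        refine ENNReal.mul_lt_top (ENNReal.rpow_lt_top_of_nonneg (by norm_num) ENNReal.ofReal_ne_top) ?_
        refine ENNReal.mul_lt_top h2 (ENNReal.add_lt_top.2 ⟨hu32, ?_⟩)
        exact ENNReal.mul_lt_top h2 (ENNReal.add_lt_top.2 ⟨hu3, hp32⟩)

/-- **The master estimate.** Fix the data: `u ∈ L³`, `p ∈ L^{3/2}` on `(0,T) × T^d` (product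
forms `u'`, `p'`), bounded measurable test data `θ = ∂ₜψ`, `H = ∇ψ` (`|θ|, ‖H‖ ≤ C_ψ`). There are
constants `K₁, K₂ ≥ 0` such that for **every** velocity kernel `k` (integrable, unit absolute mass,
vanishing off the ball of radius `ε`), pressure kernel `k_P` (integrable, same support, mass `c_X`,
absolute mass `≤ 2`), projection family `A` (`‖A(ω)v‖ ≤ 2‖v‖`, jointly continuous) with the angular
identities `∫ k⟪A(ξ̂)a, c⟫ = c_X⟪a,c⟫`, `∫ k‖A(ξ̂)a‖² = c_X|a|²`, and all translation moduli `m`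
(of `u'` in `L³`) and `m_P` (of `p'` in `L^{3/2}`) on that ball, the **balance pairing built from
`k, k_P, A`** — `∫ ⟪V, c⟫ − E G + ⟪F, H⟫ + 2 P G` with `V = ∫ k A(ξ̂)u₊`, `E = ∫ k‖A(ξ̂)u₊‖²`,
`F = ∫ k‖A(ξ̂)u₊‖² u₊`, `P = ∫ k_P p₊`, `G = ⟪u, H⟫`, `c = 2(θ + G)u + 2pH` — is integrable and differs
from `c_X · 4 · ∫ [½|u|²θ + (½|u|² + p)G]` by at most `K₁ m + K₂ m_P`. (Eyink 2003, proof of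
Thm. 1: "the lefthand side of (uuL-eq) converges … to `(4/3){∂ₜ(½|u|²) + ∇·[(½|u|²+p)u]}`",
`X = L`: `c_L = 1/3`; `X = T`: `c_T = 2/3`.) [folklore] -/
theorem master_estimate {u' : ℝ × UnitAddTorus d → EuclideanSpace ℝ d}
    (hu : AEStronglyMeasurable u' (stMeasure d T)) (hu3 : ∫⁻ q, ‖u' q‖ₑ ^ (3 : ℝ) ∂(stMeasure d T) < ∞)
    {p' : ℝ × UnitAddTorus d → ℝ} (hp : AEStronglyMeasurable p' (stMeasure d T))
    (hp32 : ∫⁻ q, ‖p' q‖ₑ ^ (3 / 2 : ℝ) ∂(stMeasure d T) < ∞)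
    {θ : ℝ × UnitAddTorus d → ℝ} {H : ℝ × UnitAddTorus d → EuclideanSpace ℝ d}
    (hθm : AEStronglyMeasurable θ (stMeasure d T)) (hHm : AEStronglyMeasurable H (stMeasure d T))
    {Cψ : ℝ} (hCψ : 0 ≤ Cψ) (hθb : ∀ q, |θ q| ≤ Cψ) (hHb : ∀ q, ‖H q‖ ≤ Cψ) :
    ∃ K₁ K₂ : ℝ, 0 ≤ K₁ ∧ 0 ≤ K₂ ∧
      ∀ {k kP : EuclideanSpace ℝ d → ℝ} {ε cX : ℝ} {m mP : ℝ≥0∞}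
        (A : EuclideanSpace ℝ d → EuclideanSpace ℝ d →L[ℝ] EuclideanSpace ℝ d),
        Integrable k volume → (∀ ξ, ε < ‖ξ‖ → k ξ = 0) → (∫ ξ, |k ξ| = 1) →
        Integrable kP volume → (∀ ξ, ε < ‖ξ‖ → kP ξ = 0) → (∫ ξ, kP ξ = cX) → (∫ ξ, |kP ξ| ≤ 2) →
        (∀ ξ v : EuclideanSpace ℝ d, ‖A (‖ξ‖⁻¹ • ξ) v‖ ≤ 2 * ‖v‖) →
        (Continuous fun z : EuclideanSpace ℝ d × EuclideanSpace ℝ d => A z.1 z.2) →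
        (∀ a c : EuclideanSpace ℝ d, ∫ ξ, k ξ * ⟪A (‖ξ‖⁻¹ • ξ) a, c⟫ = cX * ⟪a, c⟫) →
        (∀ a : EuclideanSpace ℝ d, ∫ ξ, k ξ * ‖A (‖ξ‖⁻¹ • ξ) a‖ ^ 2 = cX * ‖a‖ ^ 2) →
        m ≠ ∞ → mP ≠ ∞ →
        (∀ ξ : EuclideanSpace ℝ d, ‖ξ‖ ≤ ε →
          (∫⁻ q, ‖u' (stTranslate d ξ q) - u' q‖ₑ ^ (3 : ℝ) ∂(stMeasure d T)) ^ (1 / 3 : ℝ) ≤ m) →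
        (∀ ξ : EuclideanSpace ℝ d, ‖ξ‖ ≤ ε →
          (∫⁻ q, ‖p' (stTranslate d ξ q) - p' q‖ₑ ^ (3 / 2 : ℝ) ∂(stMeasure d T)) ^ (2 / 3 : ℝ) ≤ mP) →
        Integrable (fun q : ℝ × UnitAddTorus d =>
            ⟪(∫ ξ, k ξ • A (‖ξ‖⁻¹ • ξ) (u' (stTranslate d ξ q))),
                (2 * (θ q + ⟪u' q, H q⟫)) • u' q + (2 * p' q) • H q⟫ -
              (∫ ξ, k ξ * ‖A (‖ξ‖⁻¹ • ξ) (u' (stTranslate d ξ q))‖ ^ 2) * ⟪u' q, H q⟫ +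
              ⟪(∫ ξ, (k ξ * ‖A (‖ξ‖⁻¹ • ξ) (u' (stTranslate d ξ q))‖ ^ 2) • u' (stTranslate d ξ q)), H q⟫ +
              2 * (∫ ξ, kP ξ * p' (stTranslate d ξ q)) * ⟪u' q, H q⟫) (stMeasure d T) ∧
          |(∫ q, (⟪(∫ ξ, k ξ • A (‖ξ‖⁻¹ • ξ) (u' (stTranslate d ξ q))),
                (2 * (θ q + ⟪u' q, H q⟫)) • u' q + (2 * p' q) • H q⟫ -
              (∫ ξ, k ξ * ‖A (‖ξ‖⁻¹ • ξ) (u' (stTranslate d ξ q))‖ ^ 2) * ⟪u' q, H q⟫ +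
              ⟪(∫ ξ, (k ξ * ‖A (‖ξ‖⁻¹ • ξ) (u' (stTranslate d ξ q))‖ ^ 2) • u' (stTranslate d ξ q)), H q⟫ +
              2 * (∫ ξ, kP ξ * p' (stTranslate d ξ q)) * ⟪u' q, H q⟫) ∂(stMeasure d T)) -
            cX * (4 * ∫ q, (2⁻¹ * ‖u' q‖ ^ 2 * θ q + (2⁻¹ * ‖u' q‖ ^ 2 + p' q) * ⟪u' q, H q⟫) ∂(stMeasure d T))| ≤
            K₁ * m.toReal + K₂ * mP.toReal := by
  set ν := stMeasure d T with hν
  -- the weight `G = ⟪u, H⟫` and its variants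
  set G : ℝ × UnitAddTorus d → ℝ := fun q => ⟪u' q, H q⟫ with hGdef
  have hGm : AEStronglyMeasurable G ν := hu.inner hHm
  have hGb : ∀ q, |G q| ≤ Cψ * ‖u' q‖ := fun q => by
    calc |⟪u' q, H q⟫| ≤ ‖u' q‖ * ‖H q‖ := abs_real_inner_le_norm _ _
      _ ≤ ‖u' q‖ * Cψ := by gcongr; exact hHb q
      _ = Cψ * ‖u' q‖ := mul_comm _ _
  have hnegGm : AEStronglyMeasurable (fun q => -G q) ν := hGm.neg
  have hnegGb : ∀ q, |-G q| ≤ Cψ * ‖u' q‖ := fun q => by rw [abs_neg]; exact hGb q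
  have h2Gm : AEStronglyMeasurable (fun q => 2 * G q) ν := hGm.const_mul 2
  have h2Gb : ∀ q, |2 * G q| ≤ (2 * Cψ) * ‖u' q‖ := fun q => by
    rw [abs_mul, abs_two, mul_assoc]; exact mul_le_mul_of_nonneg_left (hGb q) zero_le_two
  have hG3 : ∫⁻ q, ‖G q‖ₑ ^ (3 : ℝ) ∂ν < ∞ := lintegral_enorm_rpow_three_lt_top_of_le hCψ hGb hu3
  have hnegG3 : ∫⁻ q, ‖-G q‖ₑ ^ (3 : ℝ) ∂ν < ∞ := lintegral_enorm_rpow_three_lt_top_of_le hCψ hnegGb hu3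
  have h2G3 : ∫⁻ q, ‖2 * G q‖ₑ ^ (3 : ℝ) ∂ν < ∞ :=
    lintegral_enorm_rpow_three_lt_top_of_le (by positivity) h2Gb hu3
  -- the Type-I weight `c`
  set cf : ℝ × UnitAddTorus d → EuclideanSpace ℝ d := fun q => (2 * (θ q + ⟪u' q, H q⟫)) • u' q + (2 * p' q) • H q
    with hcfdef
  have hcm : AEStronglyMeasurable cf ν :=
    ((((hθm.add hGm).const_mul 2)).smul hu).add ((hp.const_mul 2).smul hHm)
  have hc32 : ∫⁻ q, ‖cf q‖ₑ ^ (3 / 2 : ℝ) ∂ν < ∞ := lintegral_enorm_typeIWeight_lt_top hu hu3 hp hp32 hCψ hθb hHb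
  have hu1 : ∫⁻ q, ‖u' q‖ₑ ∂ν < ∞ := by
    have := lintegral_enorm_rpow_lt_top_of_le hu (by norm_num) hu3 (r := 1) one_pos (by norm_num)
    simpa only [ENNReal.rpow_one] using this
  -- the norms entering the constants
  set Nc : ℝ≥0∞ := (∫⁻ q, ‖cf q‖ₑ ^ (3 / 2 : ℝ) ∂ν) ^ (2 / 3 : ℝ) with hNc
  set Nu : ℝ≥0∞ := (∫⁻ q, ‖u' q‖ₑ ^ (3 : ℝ) ∂ν) ^ (1 / 3 : ℝ) with hNu
  set NnG : ℝ≥0∞ := (∫⁻ q, ‖-G q‖ₑ ^ (3 : ℝ) ∂ν) ^ (1 / 3 : ℝ) with hNnG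
  set N2G : ℝ≥0∞ := (∫⁻ q, ‖2 * G q‖ₑ ^ (3 : ℝ) ∂ν) ^ (1 / 3 : ℝ) with hN2G
  refine ⟨2 * Nc.toReal + 4 * (2 * (Nu * NnG).toReal) + 4 * Cψ * (4 * (Nu * Nu).toReal), N2G.toReal * 2,
    by positivity, by positivity, ?_⟩
  intro k kP ε cX m mP A hk hksupp hkabs hkP hkPsupp hkPmass hkPabs hA hAc hAngI hAngII hm hmP hmod hmodP
  have h02 : (0 : ℝ) ≤ 2 := by norm_num
  -- the four generic estimates
  obtain ⟨hintI, hestI⟩ := typeI_estimate (T := T) hk hksupp A h02 hA hAc hAngI hu hu3 hcm hc32 hm hmod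
  obtain ⟨hintII, hestII⟩ := typeII_estimate (T := T) hk hksupp A h02 hA hAc hAngII hu hu3 hnegGm hnegG3 hm hmod
  obtain ⟨hintIII, hestIII⟩ := typeIII_estimate (T := T) hk hksupp A h02 hA hAc hAngII hu hu3 hHm hCψ hHb hm hmod
  obtain ⟨hintIV, hestIV⟩ := typeIV_estimate (T := T) hkP hkPsupp hp hp32 h2Gm h2G3 hmP hmodP
  -- the four terms as `ξ`-integrals (a.e. for I and III, everywhere for II and IV)
  have hIae := ae_inner_integral_kernel_smul_eq (T := T) hk A hA hAc hu hu1 cf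
  have hIIIae := ae_inner_integral_kernel_normSq_smul_eq (T := T) hk A hA hAc hu hu3 H
  have hII : ∀ q : ℝ × UnitAddTorus d, -((∫ ξ, k ξ * ‖A (‖ξ‖⁻¹ • ξ) (u' (stTranslate d ξ q))‖ ^ 2) * G q) =
      ∫ ξ, k ξ * (‖A (‖ξ‖⁻¹ • ξ) (u' (stTranslate d ξ q))‖ ^ 2 * (-G q)) := fun q => by
    rw [neg_mul_eq_mul_neg, ← integral_mul_const]
    exact integral_congr_ae (ae_of_all _ fun ξ => by ring)
  have hIV : ∀ q : ℝ × UnitAddTorus d, 2 * (∫ ξ, kP ξ * p' (stTranslate d ξ q)) * G q =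
      ∫ ξ, kP ξ * (p' (stTranslate d ξ q) * (2 * G q)) := fun q => by
    rw [mul_comm (2 : ℝ), mul_assoc, ← integral_mul_const]
    exact integral_congr_ae (ae_of_all _ fun ξ => by ring)
  -- integrability of the four terms on `(0,T) × T^d`, and their integrals
  have hTI_int : Integrable (fun q => ⟪(∫ ξ, k ξ • A (‖ξ‖⁻¹ • ξ) (u' (stTranslate d ξ q))), cf q⟫) ν :=
    hintI.integral_prod_left.congr (hIae.mono fun q hq => hq.2.symm)
  have hTI_val : ∫ q, ⟪(∫ ξ, k ξ • A (‖ξ‖⁻¹ • ξ) (u' (stTranslate d ξ q))), cf q⟫ ∂ν =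
      ∫ z, k z.2 * ⟪A (‖z.2‖⁻¹ • z.2) (u' (stTranslate d z.2 z.1)), cf z.1⟫ ∂(ν.prod volume) := by
    rw [integral_congr_ae (hIae.mono fun q hq => hq.2), integral_prod _ hintI]
  have hTII_int : Integrable (fun q => -((∫ ξ, k ξ * ‖A (‖ξ‖⁻¹ • ξ) (u' (stTranslate d ξ q))‖ ^ 2) * G q)) ν :=
    hintII.integral_prod_left.congr (ae_of_all _ fun q => (hII q).symm)
  have hTII_val : ∫ q, -((∫ ξ, k ξ * ‖A (‖ξ‖⁻¹ • ξ) (u' (stTranslate d ξ q))‖ ^ 2) * G q) ∂ν =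
      ∫ z, k z.2 * (‖A (‖z.2‖⁻¹ • z.2) (u' (stTranslate d z.2 z.1))‖ ^ 2 * (-G z.1)) ∂(ν.prod volume) := by
    rw [integral_congr_ae (ae_of_all _ hII), integral_prod _ hintII]
  have hTIII_int : Integrable (fun q =>
      ⟪(∫ ξ, (k ξ * ‖A (‖ξ‖⁻¹ • ξ) (u' (stTranslate d ξ q))‖ ^ 2) • u' (stTranslate d ξ q)), H q⟫) ν :=
    hintIII.integral_prod_left.congr (hIIIae.mono fun q hq => hq.2.symm)
  have hTIII_val : ∫ q, ⟪(∫ ξ, (k ξ * ‖A (‖ξ‖⁻¹ • ξ) (u' (stTranslate d ξ q))‖ ^ 2) • u' (stTranslate d ξ q)), H q⟫ ∂ν =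
      ∫ z, k z.2 * (‖A (‖z.2‖⁻¹ • z.2) (u' (stTranslate d z.2 z.1))‖ ^ 2 *
        ⟪u' (stTranslate d z.2 z.1), H z.1⟫) ∂(ν.prod volume) := by
    rw [integral_congr_ae (hIIIae.mono fun q hq => hq.2), integral_prod _ hintIII]
  have hTIV_int : Integrable (fun q => 2 * (∫ ξ, kP ξ * p' (stTranslate d ξ q)) * G q) ν :=
    hintIV.integral_prod_left.congr (ae_of_all _ fun q => (hIV q).symm)
  have hTIV_val : ∫ q, 2 * (∫ ξ, kP ξ * p' (stTranslate d ξ q)) * G q ∂ν =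
      ∫ z, kP z.2 * (p' (stTranslate d z.2 z.1) * (2 * G z.1)) ∂(ν.prod volume) := by
    rw [integral_congr_ae (ae_of_all _ hIV), integral_prod _ hintIV]
  -- the balance pairing is the sum of the four terms
  have hS12 : Integrable (fun q => ⟪(∫ ξ, k ξ • A (‖ξ‖⁻¹ • ξ) (u' (stTranslate d ξ q))), cf q⟫ +
      -((∫ ξ, k ξ * ‖A (‖ξ‖⁻¹ • ξ) (u' (stTranslate d ξ q))‖ ^ 2) * G q)) ν := hTI_int.add hTII_int
  have hS123 : Integrable (fun q => ⟪(∫ ξ, k ξ • A (‖ξ‖⁻¹ • ξ) (u' (stTranslate d ξ q))), cf q⟫ +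
      -((∫ ξ, k ξ * ‖A (‖ξ‖⁻¹ • ξ) (u' (stTranslate d ξ q))‖ ^ 2) * G q) +
      ⟪(∫ ξ, (k ξ * ‖A (‖ξ‖⁻¹ • ξ) (u' (stTranslate d ξ q))‖ ^ 2) • u' (stTranslate d ξ q)), H q⟫) ν :=
    hS12.add hTIII_int
  have hS_int : Integrable (fun q => ⟪(∫ ξ, k ξ • A (‖ξ‖⁻¹ • ξ) (u' (stTranslate d ξ q))), cf q⟫ +
      -((∫ ξ, k ξ * ‖A (‖ξ‖⁻¹ • ξ) (u' (stTranslate d ξ q))‖ ^ 2) * G q) +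
      ⟪(∫ ξ, (k ξ * ‖A (‖ξ‖⁻¹ • ξ) (u' (stTranslate d ξ q))‖ ^ 2) • u' (stTranslate d ξ q)), H q⟫ +
      2 * (∫ ξ, kP ξ * p' (stTranslate d ξ q)) * G q) ν := hS123.add hTIV_int
  have hS_eq : ∀ q : ℝ × UnitAddTorus d,
      ⟪(∫ ξ, k ξ • A (‖ξ‖⁻¹ • ξ) (u' (stTranslate d ξ q))), cf q⟫ -
          (∫ ξ, k ξ * ‖A (‖ξ‖⁻¹ • ξ) (u' (stTranslate d ξ q))‖ ^ 2) * ⟪u' q, H q⟫ +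
          ⟪(∫ ξ, (k ξ * ‖A (‖ξ‖⁻¹ • ξ) (u' (stTranslate d ξ q))‖ ^ 2) • u' (stTranslate d ξ q)), H q⟫ +
          2 * (∫ ξ, kP ξ * p' (stTranslate d ξ q)) * ⟪u' q, H q⟫ =
        ⟪(∫ ξ, k ξ • A (‖ξ‖⁻¹ • ξ) (u' (stTranslate d ξ q))), cf q⟫ +
          -((∫ ξ, k ξ * ‖A (‖ξ‖⁻¹ • ξ) (u' (stTranslate d ξ q))‖ ^ 2) * G q) +
          ⟪(∫ ξ, (k ξ * ‖A (‖ξ‖⁻¹ • ξ) (u' (stTranslate d ξ q))‖ ^ 2) • u' (stTranslate d ξ q)), H q⟫ +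
          2 * (∫ ξ, kP ξ * p' (stTranslate d ξ q)) * G q := fun q => by
    simp only [hGdef]; ring
  refine ⟨hS_int.congr (ae_of_all _ fun q => (hS_eq q).symm), ?_⟩
  have hS_val : ∫ q, (⟪(∫ ξ, k ξ • A (‖ξ‖⁻¹ • ξ) (u' (stTranslate d ξ q))), cf q⟫ -
          (∫ ξ, k ξ * ‖A (‖ξ‖⁻¹ • ξ) (u' (stTranslate d ξ q))‖ ^ 2) * ⟪u' q, H q⟫ +
          ⟪(∫ ξ, (k ξ * ‖A (‖ξ‖⁻¹ • ξ) (u' (stTranslate d ξ q))‖ ^ 2) • u' (stTranslate d ξ q)), H q⟫ +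
          2 * (∫ ξ, kP ξ * p' (stTranslate d ξ q)) * ⟪u' q, H q⟫) ∂ν =
      (∫ z, k z.2 * ⟪A (‖z.2‖⁻¹ • z.2) (u' (stTranslate d z.2 z.1)), cf z.1⟫ ∂(ν.prod volume)) +
        (∫ z, k z.2 * (‖A (‖z.2‖⁻¹ • z.2) (u' (stTranslate d z.2 z.1))‖ ^ 2 * (-G z.1)) ∂(ν.prod volume)) +
        (∫ z, k z.2 * (‖A (‖z.2‖⁻¹ • z.2) (u' (stTranslate d z.2 z.1))‖ ^ 2 *
          ⟪u' (stTranslate d z.2 z.1), H z.1⟫) ∂(ν.prod volume)) +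
        ∫ z, kP z.2 * (p' (stTranslate d z.2 z.1) * (2 * G z.1)) ∂(ν.prod volume) := by
    rw [integral_congr_ae (ae_of_all _ hS_eq), integral_add hS123 hTIV_int, integral_add hS12 hTIII_int,
      integral_add hTI_int hTII_int, hTI_val, hTII_val, hTIII_val, hTIV_val]
  -- the target: `c_X · 4 · ∫ D = c_X(∫ b_I + ∫ b_II + ∫ b_III + ∫ b_IV)`
  have hbI_int : Integrable (fun q => ⟪u' q, cf q⟫) ν := by
    obtain ⟨h1, -⟩ := integrable_norm_mul_norm_of_L3_L32 hu hu3 hcm hc32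
    exact h1.mono' (hu.inner hcm) (ae_of_all _ fun q => by
      rw [Real.norm_eq_abs]; exact abs_real_inner_le_norm _ _)
  have hu3int : Integrable (fun q => ‖u' q‖ ^ 3) ν := by
    refine integrable_norm_pow_three hu ?_
    have e : ∫⁻ q, ‖u' q‖ₑ ^ 3 ∂ν = ∫⁻ q, ‖u' q‖ₑ ^ (3 : ℝ) ∂ν := lintegral_congr fun q => ENNReal.pow_three_eq_rpow _
    rw [e]; exact hu3
  have hbII_int : Integrable (fun q => ‖u' q‖ ^ 2 * (-G q)) ν := by
    refine (hu3int.const_mul Cψ).mono' ((hu.norm.pow 2).mul hnegGm) (ae_of_all _ fun q => ?_)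
    rw [norm_mul, Real.norm_eq_abs, Real.norm_eq_abs, abs_of_nonneg (sq_nonneg _)]
    calc ‖u' q‖ ^ 2 * |-G q| ≤ ‖u' q‖ ^ 2 * (Cψ * ‖u' q‖) := by gcongr; exact hnegGb q
      _ = Cψ * ‖u' q‖ ^ 3 := by ring
  have hbIII_int : Integrable (fun q => ‖u' q‖ ^ 2 * ⟪u' q, H q⟫) ν := by
    refine (hu3int.const_mul Cψ).mono' ((hu.norm.pow 2).mul hGm) (ae_of_all _ fun q => ?_)
    rw [norm_mul, Real.norm_eq_abs, Real.norm_eq_abs, abs_of_nonneg (sq_nonneg _)]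
    calc ‖u' q‖ ^ 2 * |⟪u' q, H q⟫| ≤ ‖u' q‖ ^ 2 * (Cψ * ‖u' q‖) := by gcongr; exact hGb q
      _ = Cψ * ‖u' q‖ ^ 3 := by ring
  have hbIV_int : Integrable (fun q => p' q * (2 * G q)) ν := by
    obtain ⟨h1, -⟩ := integrable_norm_mul_norm_of_L3_L32 h2Gm h2G3 hp hp32
    refine h1.mono' (hp.mul h2Gm) (ae_of_all _ fun q => ?_)
    rw [norm_mul, mul_comm]
  have hb12 : Integrable (fun q => ⟪u' q, cf q⟫ + ‖u' q‖ ^ 2 * (-G q)) ν := hbI_int.add hbII_int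
  have hb123 : Integrable (fun q => ⟪u' q, cf q⟫ + ‖u' q‖ ^ 2 * (-G q) + ‖u' q‖ ^ 2 * ⟪u' q, H q⟫) ν :=
    hb12.add hbIII_int
  have hpt : ∀ q : ℝ × UnitAddTorus d, 4 * (2⁻¹ * ‖u' q‖ ^ 2 * θ q + (2⁻¹ * ‖u' q‖ ^ 2 + p' q) * ⟪u' q, H q⟫) =
      ⟪u' q, cf q⟫ + ‖u' q‖ ^ 2 * (-G q) + ‖u' q‖ ^ 2 * ⟪u' q, H q⟫ + p' q * (2 * G q) := fun q => by
    simp only [hcfdef, hGdef, inner_add_right, real_inner_smul_right, real_inner_self_eq_norm_sq]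
    ring
  have htarget : cX * (4 * ∫ q, (2⁻¹ * ‖u' q‖ ^ 2 * θ q + (2⁻¹ * ‖u' q‖ ^ 2 + p' q) * ⟪u' q, H q⟫) ∂ν) =
      cX * (∫ q, ⟪u' q, cf q⟫ ∂ν) + cX * (∫ q, ‖u' q‖ ^ 2 * (-G q) ∂ν) + cX * (∫ q, ‖u' q‖ ^ 2 * ⟪u' q, H q⟫ ∂ν) +
        cX * ∫ q, p' q * (2 * G q) ∂ν := by
    rw [← integral_const_mul, integral_congr_ae (ae_of_all _ hpt), integral_add hb123 hbIV_int,
      integral_add hb12 hbIII_int, integral_add hbI_int hbII_int]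
    ring
  -- assemble the four estimates
  rw [hS_val, htarget]
  rw [hkabs, mul_one] at hestI hestII hestIII
  rw [hkPmass] at hestIV
  have hestIV' : |(∫ z, kP z.2 * (p' (stTranslate d z.2 z.1) * (2 * G z.1)) ∂(ν.prod volume)) -
      cX * ∫ q, p' q * (2 * G q) ∂ν| ≤ (N2G * mP).toReal * 2 :=
    hestIV.trans (mul_le_mul_of_nonneg_left hkPabs ENNReal.toReal_nonneg)
  have e1 : (m * Nc).toReal = m.toReal * Nc.toReal := ENNReal.toReal_mul
  have e2 : (m * Nu * NnG).toReal = m.toReal * (Nu * NnG).toReal := by rw [mul_assoc, ENNReal.toReal_mul]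
  have e3 : (m * Nu * Nu).toReal = m.toReal * (Nu * Nu).toReal := by rw [mul_assoc, ENNReal.toReal_mul]
  have e4 : (N2G * mP).toReal = N2G.toReal * mP.toReal := ENNReal.toReal_mul
  rw [e1] at hestI
  rw [e2] at hestII
  rw [e3] at hestIII
  rw [e4] at hestIV'
  have hsplit : ∀ a b c e a' b' c' e' : ℝ, |a + b + c + e - (a' + b' + c' + e')| ≤
      |a - a'| + |b - b'| + |c - c'| + |e - e'| := by
    intro a b c e a' b' c' e'
    have : a + b + c + e - (a' + b' + c' + e') = (a - a') + (b - b') + (c - c') + (e - e') := by ring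
    rw [this]
    exact (abs_add_le _ _).trans (add_le_add ((abs_add_le _ _).trans (add_le_add (abs_add_le _ _) le_rfl)) le_rfl)
  refine (hsplit _ _ _ _ _ _ _ _).trans ?_
  nlinarith [hestI, hestII, hestIII, hestIV', ENNReal.toReal_nonneg (a := m), ENNReal.toReal_nonneg (a := mP),
    ENNReal.toReal_nonneg (a := Nc), ENNReal.toReal_nonneg (a := Nu * NnG), ENNReal.toReal_nonneg (a := Nu * Nu),
    ENNReal.toReal_nonneg (a := N2G)]

end Master

/-! ## Eyink's balance pairings: identification with the master form and the uniform limits -/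

section Eyink

variable {T : ℝ} {u : ℝ → UnitAddTorus d → EuclideanSpace ℝ d} {p : ℝ → UnitAddTorus d → ℝ}
  {ψ : ℝ → UnitAddTorus d → ℝ}

/-- Product-measure form of the joint measurability of a scalar space–time field. [folklore] -/
theorem aestronglyMeasurable_uncurry_prod_of_stLift_Ioo' {F : Type*} [TopologicalSpace F]
    {q : ℝ → UnitAddTorus d → F}
    (hqm : AEStronglyMeasurable (FunctionSpaces.Torus.stLift q) (volume.restrict (Ioo 0 T ×ˢ univ))) :
    AEStronglyMeasurable (uncurry q) (stMeasure d T) := by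
  have h := FunctionSpaces.Torus.aestronglyMeasurable_uncurry_of_stLift_restrict hqm
  rwa [Measure.volume_eq_prod, ← Measure.prod_restrict, Measure.restrict_univ] at h

/-- **Eyink's longitudinal objects in master form.** For a kernel-free description: with
`k = φ^ε`, `k_L = φ_L^ε`, `A = P_L`, at every `(t,x)`:
`u_L^ε = ∫ k P_L(ξ̂) u₊`, `(u_L·u_L)^ε = ∫ k ‖P_L(ξ̂)u₊‖²`, `((u_L·u_L)u)^ε = ∫ k‖P_L(ξ̂)u₊‖² u₊`,
`p_L^ε = ∫ k_L p₊` (the middle two through `⟪u₊, ξ̂⟫² = ‖P_L(ξ̂)u₊‖²` off the null set `ξ = 0`). [folklore] -/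
theorem eyink_objectsL_eq (φ : EuclideanSpace ℝ d → ℝ) (ε : ℝ) (v : UnitAddTorus d → EuclideanSpace ℝ d)
    (x : UnitAddTorus d) [Nonempty d] :
    eyinkVelocityL φ ε v x = ∫ ξ, FluidPDE.mollifierScale ε φ ξ • projL (‖ξ‖⁻¹ • ξ) (v (x + FunctionSpaces.Torus.proj ξ)) ∧
    eyinkEnergyL φ ε v x = ∫ ξ, FluidPDE.mollifierScale ε φ ξ * ‖projL (‖ξ‖⁻¹ • ξ) (v (x + FunctionSpaces.Torus.proj ξ))‖ ^ 2 ∧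
    eyinkEnergyFluxL φ ε v x = ∫ ξ, (FluidPDE.mollifierScale ε φ ξ *
        ‖projL (‖ξ‖⁻¹ • ξ) (v (x + FunctionSpaces.Torus.proj ξ))‖ ^ 2) • v (x + FunctionSpaces.Torus.proj ξ) := by
  have h0 : ∀ᵐ ξ : EuclideanSpace ℝ d ∂volume, ξ ≠ 0 := by rw [ae_iff]; simp
  have hsq : ∀ ξ : EuclideanSpace ℝ d, ξ ≠ 0 → ∀ w : EuclideanSpace ℝ d,
      ‖projL (‖ξ‖⁻¹ • ξ) w‖ ^ 2 = ⟪w, ‖ξ‖⁻¹ • ξ⟫ ^ 2 := fun ξ hξ w => by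
    rw [projL_apply, norm_smul, norm_inv_norm_smul hξ, mul_one, Real.norm_eq_abs, sq_abs, real_inner_comm]
  refine ⟨?_, ?_, ?_⟩
  · rw [eyinkVelocityL]
    refine integral_congr_ae (ae_of_all _ fun ξ => ?_)
    simp only
    rw [projL_apply, ← smul_smul, real_inner_comm]
  · rw [eyinkEnergyL]
    refine integral_congr_ae ?_
    filter_upwards [h0] with ξ hξ
    rw [hsq ξ hξ]
  · rw [eyinkEnergyFluxL]
    refine integral_congr_ae ?_
    filter_upwards [h0] with ξ hξ
    rw [hsq ξ hξ]

/-- **Eyink's transverse objects in master form**: with `A = P_T`,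
`u_T^ε = ∫ k P_T(ξ̂) u₊`, `(u_T·u_T)^ε = ∫ k ‖P_T(ξ̂)u₊‖²`, `((u_T·u_T)u)^ε = ∫ k‖P_T(ξ̂)u₊‖² u₊`. [folklore] -/
theorem eyink_objectsT_eq (φ : EuclideanSpace ℝ d → ℝ) (ε : ℝ) (v : UnitAddTorus d → EuclideanSpace ℝ d)
    (x : UnitAddTorus d) :
    eyinkVelocityT φ ε v x = ∫ ξ, FluidPDE.mollifierScale ε φ ξ • projT (‖ξ‖⁻¹ • ξ) (v (x + FunctionSpaces.Torus.proj ξ)) ∧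
    eyinkEnergyT φ ε v x = ∫ ξ, FluidPDE.mollifierScale ε φ ξ * ‖projT (‖ξ‖⁻¹ • ξ) (v (x + FunctionSpaces.Torus.proj ξ))‖ ^ 2 ∧
    eyinkEnergyFluxT φ ε v x = ∫ ξ, (FluidPDE.mollifierScale ε φ ξ *
        ‖projT (‖ξ‖⁻¹ • ξ) (v (x + FunctionSpaces.Torus.proj ξ))‖ ^ 2) • v (x + FunctionSpaces.Torus.proj ξ) := by
  have hT : ∀ ξ w : EuclideanSpace ℝ d, projT (‖ξ‖⁻¹ • ξ) w = w - ⟪w, ‖ξ‖⁻¹ • ξ⟫ • (‖ξ‖⁻¹ • ξ) := fun ξ w => by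
    rw [projT_apply, real_inner_comm]
  refine ⟨?_, ?_, ?_⟩
  · rw [eyinkVelocityT]
    exact integral_congr_ae (ae_of_all _ fun ξ => by simp only; rw [hT])
  · rw [eyinkEnergyT]
    exact integral_congr_ae (ae_of_all _ fun ξ => by simp only; rw [hT])
  · rw [eyinkEnergyFluxT]
    exact integral_congr_ae (ae_of_all _ fun ξ => by simp only; rw [hT])

/-- The value `∫₀ᵀ∫ ½|u|²∂ₜψ + (½|u|² + p)⟪u,∇ψ⟫` of the local energy flux functional (the
right-hand side of `Torus.HasLocalEnergyBalance` for Euler) as a product integral. [folklore] -/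
theorem energyFluxFunctional_eq_integral_prod
    (hu : AEStronglyMeasurable (uncurry u) (stMeasure d T)) (hu3 : ∫⁻ t in Ioo 0 T, ∫⁻ x, ‖u t x‖ₑ ^ (3 : ℕ) < ∞)
    (hp : AEStronglyMeasurable (uncurry p) (stMeasure d T))
    (hp32 : ∫⁻ t in Ioo 0 T, ∫⁻ x, ‖p t x‖ₑ ^ (3 / 2 : ℝ) < ∞)
    (hψ : FunctionSpaces.Torus.IsSpaceTimeTest T ψ) :
    Integrable (fun z : ℝ × UnitAddTorus d =>
        2⁻¹ * ‖u z.1 z.2‖ ^ 2 * FunctionSpaces.Torus.timeDeriv ψ z.1 z.2 +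
          (2⁻¹ * ‖u z.1 z.2‖ ^ 2 + p z.1 z.2) * ⟪u z.1 z.2, FunctionSpaces.Torus.gradient (ψ z.1) z.2⟫) (stMeasure d T) ∧
      (∫ t in Ioo 0 T, ∫ x, (2⁻¹ * ‖u t x‖ ^ 2 * FunctionSpaces.Torus.timeDeriv ψ t x +
          (2⁻¹ * ‖u t x‖ ^ 2 + p t x) * ⟪u t x, FunctionSpaces.Torus.gradient (ψ t) x⟫)) =
        ∫ z, (2⁻¹ * ‖u z.1 z.2‖ ^ 2 * FunctionSpaces.Torus.timeDeriv ψ z.1 z.2 +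
          (2⁻¹ * ‖u z.1 z.2‖ ^ 2 + p z.1 z.2) * ⟪u z.1 z.2, FunctionSpaces.Torus.gradient (ψ z.1) z.2⟫) ∂(stMeasure d T) := by
  have h := integrable_energyFluxIntegrand (T := T) 0 hu hu3 hp hp32 hψ
  have hint : Integrable (fun z : ℝ × UnitAddTorus d =>
      2⁻¹ * ‖u z.1 z.2‖ ^ 2 * FunctionSpaces.Torus.timeDeriv ψ z.1 z.2 +
        (2⁻¹ * ‖u z.1 z.2‖ ^ 2 + p z.1 z.2) * ⟪u z.1 z.2, FunctionSpaces.Torus.gradient (ψ z.1) z.2⟫) (stMeasure d T) := by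
    refine h.congr (ae_of_all _ fun z => ?_)
    simp only [mul_zero, zero_mul, add_zero]
  exact ⟨hint, (integral_prod _ hint).symm⟩

/-- `(d−1)/d ≤ 1`, whence the absolute mass bound `∫|φ_L^ε| ≤ 2`. [folklore] -/
theorem one_add_pred_div_le_two (hd : 1 ≤ Fintype.card d) : 1 + ((Fintype.card d : ℝ) - 1) / Fintype.card d ≤ 2 := by
  have hn : (1 : ℝ) ≤ Fintype.card d := by exact_mod_cast hd
  have hn0 : (0 : ℝ) < Fintype.card d := by linarith
  have : ((Fintype.card d : ℝ) - 1) / Fintype.card d ≤ 1 := by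
    rw [div_le_one hn0]; linarith
  linarith

/-- **The limit `ε → 0⁺` of Eyink's longitudinal balance pairing, uniformly in the mollifier.**
For `u ∈ L³((0,T) × T^d)`, `p ∈ L^{3/2}((0,T) × T^d)` (jointly measurable) and a test function `ψ`
supported in `(0,T) × T^d`: for every `η > 0` there is `ε₀ > 0` such that for **all** spherically
symmetric unit-ball mollifiers `φ` and all `ε ∈ (0, ε₀)`,
`|𝓔_L^{ε,φ}(ψ) − (4/d) ∫₀ᵀ∫ [½|u|²∂ₜψ + (½|u|² + p)⟪u,∇ψ⟫]| < η`.
This is Eyink 2003, §2: "`u_L^ε → ⅓u` strong in `L³`", "`p_L^ε → ⅓p` strong in `L^{3/2}`",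
"`((u_L·u_L)u)^ε − (u_L·u_L)^ε u → 0` strong in `L¹`", "the lefthand side of (uuL-eq) converges as
`ε → 0` to `(4/3){∂ₜ(½|u|²) + ∇·[(½|u|²+p)u]}`", with the rate read off from (norm-uL-thirdu),
(norm-pT-twothirdp): it depends on `φ` only through its support radius, whence the uniformity. [cite: Eyink2003, §2 proof of Thm. 1] -/
theorem eyinkBalanceL_sub_lt [Nonempty d]
    (hum : AEStronglyMeasurable (FunctionSpaces.Torus.stLift u) (volume.restrict (Ioo 0 T ×ˢ univ)))
    (hu3 : ∫⁻ t in Ioo 0 T, ∫⁻ x, ‖u t x‖ₑ ^ 3 < ∞)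
    (hpm : AEStronglyMeasurable (FunctionSpaces.Torus.stLift p) (volume.restrict (Ioo 0 T ×ˢ univ)))
    (hp32 : ∫⁻ t in Ioo 0 T, ∫⁻ x, ‖p t x‖ₑ ^ (3 / 2 : ℝ) < ∞)
    (hψ : FunctionSpaces.Torus.IsSpaceTimeTestIoo T ψ) {η : ℝ} (hη : 0 < η) :
    ∃ ε₀ > 0, ∀ φ : EuclideanSpace ℝ d → ℝ, IsUnitBallMollifier φ → (∀ x y, ‖x‖ = ‖y‖ → φ x = φ y) →
      ∀ ε ∈ Ioo 0 ε₀,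
        |eyinkBalanceL T u p φ ε ψ -
          4 / (Fintype.card d : ℝ) * ∫ t in Ioo 0 T, ∫ x, (2⁻¹ * ‖u t x‖ ^ 2 * FunctionSpaces.Torus.timeDeriv ψ t x +
            (2⁻¹ * ‖u t x‖ ^ 2 + p t x) * ⟪u t x, FunctionSpaces.Torus.gradient (ψ t) x⟫)| < η := by
  set ν := stMeasure d T with hν
  -- product forms of the data
  have hu : AEStronglyMeasurable (uncurry u) ν := aestronglyMeasurable_uncurry_prod_of_stLift_Ioo hum
  have hu3' : ∫⁻ q, ‖uncurry u q‖ₑ ^ (3 : ℝ) ∂ν < ∞ := by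
    have h := lintegral_prod_enorm_pow_three_lt_top hu hu3
    have e : ∫⁻ q, ‖uncurry u q‖ₑ ^ 3 ∂ν = ∫⁻ q, ‖uncurry u q‖ₑ ^ (3 : ℝ) ∂ν :=
      lintegral_congr fun q => ENNReal.pow_three_eq_rpow _
    rw [← e]; exact h
  have hp : AEStronglyMeasurable (uncurry p) ν := aestronglyMeasurable_uncurry_prod_of_stLift_Ioo' hpm
  have hp32' : ∫⁻ q, ‖uncurry p q‖ₑ ^ (3 / 2 : ℝ) ∂ν < ∞ := by
    have e := lintegral_Ioo_lintegral_eq_lintegral_prod (T := T) (g := fun t x => ‖p t x‖ₑ ^ (3 / 2 : ℝ))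
      (hp.enorm.pow_const _)
    rw [e] at hp32
    exact hp32
  -- test data
  obtain ⟨Cψ, hCψ, hθb, hHb, hθm, hHm⟩ := hψ.testData_bound
  have hθm' : AEStronglyMeasurable (fun q : ℝ × UnitAddTorus d => FunctionSpaces.Torus.timeDeriv ψ q.1 q.2) ν := hθm
  -- the master constants
  obtain ⟨K₁, K₂, hK₁, hK₂, hM⟩ := master_estimate (T := T) hu hu3' hp hp32' hθm' hHm hCψ
    (fun q => hθb q.1 q.2) (fun q => hHb q.1 q.2)
  -- moduli of continuity of translation
  set m : ℝ≥0∞ := ENNReal.ofReal (η / (4 * (K₁ + 1))) with hmdef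
  set mP : ℝ≥0∞ := ENNReal.ofReal (η / (4 * (K₂ + 1))) with hmPdef
  have hm0 : 0 < m := ENNReal.ofReal_pos.2 (by positivity)
  have hmP0 : 0 < mP := ENNReal.ofReal_pos.2 (by positivity)
  obtain ⟨δu, hδu, hmodu⟩ := exists_forall_lintegral_translate_sub_lt (T := T) (r := 3) (by norm_num) hu hu3' hm0
  obtain ⟨δp, hδp, hmodp⟩ := exists_forall_lintegral_translate_sub_lt (T := T) (r := 3 / 2) (by norm_num) hp hp32' hmP0
  have e13 : (1 : ℝ) / 3 = 1 / 3 := rfl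
  have e23 : (1 : ℝ) / (3 / 2) = 2 / 3 := by norm_num
  simp only [e23] at hmodp
  refine ⟨min δu δp, lt_min hδu hδp, fun φ hφ hrad ε hε => ?_⟩
  have hε0 : 0 < ε := hε.1
  have hεu : ε < δu := hε.2.trans_le (min_le_left _ _)
  have hεp : ε < δp := hε.2.trans_le (min_le_right _ _)
  -- kernels and projections
  have hd1 : 1 ≤ Fintype.card d := Fintype.card_pos
  obtain ⟨hk, hksupp, hk1, hkabs⟩ := mollifierScale_kernel_facts hφ hε0
  have hkrad := mollifierScale_radial hrad ε
  obtain ⟨hkL, hkLsupp, hkLmass, hkLabs⟩ := longitudinalKernel_scaled_facts hφ hd1 hε0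
  have hkLabs2 : ∫ ξ, |eyinkLongitudinalKernel d (FluidPDE.mollifierScale ε φ) ξ| ≤ 2 :=
    hkLabs.trans (one_add_pred_div_le_two hd1)
  have hAL : ∀ ξ v : EuclideanSpace ℝ d, ‖projL (‖ξ‖⁻¹ • ξ) v‖ ≤ 2 * ‖v‖ := fun ξ v =>
    (norm_projL_unit_le ξ v).trans (by rw [one_mul]; linarith [norm_nonneg v])
  have hAngI : ∀ a c : EuclideanSpace ℝ d, ∫ ξ, FluidPDE.mollifierScale ε φ ξ * ⟪projL (‖ξ‖⁻¹ • ξ) a, c⟫ =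
      (Fintype.card d : ℝ)⁻¹ * ⟪a, c⟫ := fun a c => by
    rw [integral_mul_inner_projL hk hkrad, hk1, mul_one]
  have hAngII : ∀ a : EuclideanSpace ℝ d, ∫ ξ, FluidPDE.mollifierScale ε φ ξ * ‖projL (‖ξ‖⁻¹ • ξ) a‖ ^ 2 =
      (Fintype.card d : ℝ)⁻¹ * ‖a‖ ^ 2 := fun a => by
    rw [integral_mul_norm_projL_sq hk hkrad, hk1, mul_one]
  -- the master estimate for this kernel pair
  obtain ⟨hSint, hSest⟩ := hM projL hk hksupp hkabs hkL hkLsupp hkLmass hkLabs2 hAL continuous_projL hAngI hAngII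
    ENNReal.ofReal_ne_top ENNReal.ofReal_ne_top
    (fun ξ hξ => (hmodu ξ (hξ.trans_lt hεu)).le) (fun ξ hξ => (hmodp ξ (hξ.trans_lt hεp)).le)
  -- identify `𝓔_L^{ε,φ}(ψ)` with the master pairing
  have hpt : ∀ (t : ℝ) (x : UnitAddTorus d),
      2 * ⟪u t x, eyinkVelocityL φ ε (u t) x⟫ * FunctionSpaces.Torus.timeDeriv ψ t x +
        (2 * ⟪u t x, eyinkVelocityL φ ε (u t) x⟫ - eyinkEnergyL φ ε (u t) x +
            2 * eyinkPressureL φ ε (p t) x) * ⟪u t x, FunctionSpaces.Torus.gradient (ψ t) x⟫ +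
        ⟪eyinkEnergyFluxL φ ε (u t) x, FunctionSpaces.Torus.gradient (ψ t) x⟫ +
        2 * p t x * ⟪eyinkVelocityL φ ε (u t) x, FunctionSpaces.Torus.gradient (ψ t) x⟫ =
      ⟪(∫ ξ, FluidPDE.mollifierScale ε φ ξ • projL (‖ξ‖⁻¹ • ξ) (u t (x + FunctionSpaces.Torus.proj ξ))),
          (2 * (FunctionSpaces.Torus.timeDeriv ψ t x + ⟪u t x, FunctionSpaces.Torus.gradient (ψ t) x⟫)) • u t x +
            (2 * p t x) • FunctionSpaces.Torus.gradient (ψ t) x⟫ -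
        (∫ ξ, FluidPDE.mollifierScale ε φ ξ * ‖projL (‖ξ‖⁻¹ • ξ) (u t (x + FunctionSpaces.Torus.proj ξ))‖ ^ 2) *
          ⟪u t x, FunctionSpaces.Torus.gradient (ψ t) x⟫ +
        ⟪(∫ ξ, (FluidPDE.mollifierScale ε φ ξ * ‖projL (‖ξ‖⁻¹ • ξ) (u t (x + FunctionSpaces.Torus.proj ξ))‖ ^ 2) •
          u t (x + FunctionSpaces.Torus.proj ξ)), FunctionSpaces.Torus.gradient (ψ t) x⟫ +
        2 * (∫ ξ, eyinkLongitudinalKernel d (FluidPDE.mollifierScale ε φ) ξ * p t (x + FunctionSpaces.Torus.proj ξ)) *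
          ⟪u t x, FunctionSpaces.Torus.gradient (ψ t) x⟫ := by
    intro t x
    obtain ⟨eV, eE, eF⟩ := eyink_objectsL_eq φ ε (u t) x
    rw [eV, eE, eF, eyinkPressureL_apply, inner_add_right, real_inner_smul_right, real_inner_smul_right,
      real_inner_comm (u t x)]
    ring
  have hBL : eyinkBalanceL T u p φ ε ψ =
      ∫ q, (⟪(∫ ξ, FluidPDE.mollifierScale ε φ ξ • projL (‖ξ‖⁻¹ • ξ) (uncurry u (stTranslate d ξ q))),
          (2 * (FunctionSpaces.Torus.timeDeriv ψ q.1 q.2 + ⟪uncurry u q, FunctionSpaces.Torus.gradient (ψ q.1) q.2⟫)) •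
              uncurry u q + (2 * uncurry p q) • FunctionSpaces.Torus.gradient (ψ q.1) q.2⟫ -
        (∫ ξ, FluidPDE.mollifierScale ε φ ξ * ‖projL (‖ξ‖⁻¹ • ξ) (uncurry u (stTranslate d ξ q))‖ ^ 2) *
          ⟪uncurry u q, FunctionSpaces.Torus.gradient (ψ q.1) q.2⟫ +
        ⟪(∫ ξ, (FluidPDE.mollifierScale ε φ ξ * ‖projL (‖ξ‖⁻¹ • ξ) (uncurry u (stTranslate d ξ q))‖ ^ 2) •
          uncurry u (stTranslate d ξ q)), FunctionSpaces.Torus.gradient (ψ q.1) q.2⟫ +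
        2 * (∫ ξ, eyinkLongitudinalKernel d (FluidPDE.mollifierScale ε φ) ξ * uncurry p (stTranslate d ξ q)) *
          ⟪uncurry u q, FunctionSpaces.Torus.gradient (ψ q.1) q.2⟫) ∂ν := by
    rw [integral_prod _ hSint, eyinkBalanceL]
    refine setIntegral_congr_fun measurableSet_Ioo fun t _ => ?_
    refine integral_congr_ae (ae_of_all _ fun x => ?_)
    exact hpt t x
  obtain ⟨-, hDval⟩ := energyFluxFunctional_eq_integral_prod (T := T) hu hu3 hp hp32 hψ.1
  rw [hBL, hDval]
  have hconst : 4 / (Fintype.card d : ℝ) *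
      (∫ z, (2⁻¹ * ‖u z.1 z.2‖ ^ 2 * FunctionSpaces.Torus.timeDeriv ψ z.1 z.2 +
        (2⁻¹ * ‖u z.1 z.2‖ ^ 2 + p z.1 z.2) * ⟪u z.1 z.2, FunctionSpaces.Torus.gradient (ψ z.1) z.2⟫) ∂ν) =
      (Fintype.card d : ℝ)⁻¹ * (4 * ∫ q, (2⁻¹ * ‖uncurry u q‖ ^ 2 * FunctionSpaces.Torus.timeDeriv ψ q.1 q.2 +
        (2⁻¹ * ‖uncurry u q‖ ^ 2 + uncurry p q) * ⟪uncurry u q, FunctionSpaces.Torus.gradient (ψ q.1) q.2⟫) ∂ν) := by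
    rw [div_eq_mul_inv, mul_comm (4 : ℝ), mul_assoc]
    rfl
  rw [hconst]
  refine hSest.trans_lt ?_
  -- `K₁ m + K₂ m_P < η`
  have hm : m.toReal = η / (4 * (K₁ + 1)) := ENNReal.toReal_ofReal (by positivity)
  have hmP : mP.toReal = η / (4 * (K₂ + 1)) := ENNReal.toReal_ofReal (by positivity)
  rw [hm, hmP]
  have h1 : K₁ * (η / (4 * (K₁ + 1))) ≤ η / 4 := by
    rw [mul_div_assoc', div_le_div_iff₀ (by positivity) (by positivity)]
    nlinarith
  have h2 : K₂ * (η / (4 * (K₂ + 1))) ≤ η / 4 := by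
    rw [mul_div_assoc', div_le_div_iff₀ (by positivity) (by positivity)]
    nlinarith
  linarith

/-- **The limit `ε → 0⁺` of Eyink's transverse balance pairing, uniformly in the mollifier.**
For `u ∈ L³((0,T) × T^d)`, `p ∈ L^{3/2}((0,T) × T^d)` (jointly measurable) and a test function `ψ`
supported in `(0,T) × T^d`: for every `η > 0` there is `ε₀ > 0` such that for **all** spherically
symmetric unit-ball mollifiers `φ` and all `ε ∈ (0, ε₀)`,
`|𝓔_T^{ε,φ}(ψ) − (4(d−1)/d) ∫₀ᵀ∫ [½|u|²∂ₜψ + (½|u|² + p)⟪u,∇ψ⟫]| < η`.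
This is Eyink 2003, §2: "`u_T^ε → ⅔u`", "`p_T^ε → ⅔p` strong in `L^{3/2}`" ((pT-eq)–(norm-pT-twothirdp)),
"the lefthand side of (uuT-eq) converges to `8/3` times the same quantity", with the rate depending
on `φ` only through its support radius, whence the uniformity. [cite: Eyink2003, §2 proof of Thm. 1] -/
theorem eyinkBalanceT_sub_lt [Nonempty d]
    (hum : AEStronglyMeasurable (FunctionSpaces.Torus.stLift u) (volume.restrict (Ioo 0 T ×ˢ univ)))
    (hu3 : ∫⁻ t in Ioo 0 T, ∫⁻ x, ‖u t x‖ₑ ^ 3 < ∞)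
    (hpm : AEStronglyMeasurable (FunctionSpaces.Torus.stLift p) (volume.restrict (Ioo 0 T ×ˢ univ)))
    (hp32 : ∫⁻ t in Ioo 0 T, ∫⁻ x, ‖p t x‖ₑ ^ (3 / 2 : ℝ) < ∞)
    (hψ : FunctionSpaces.Torus.IsSpaceTimeTestIoo T ψ) {η : ℝ} (hη : 0 < η) :
    ∃ ε₀ > 0, ∀ φ : EuclideanSpace ℝ d → ℝ, IsUnitBallMollifier φ → (∀ x y, ‖x‖ = ‖y‖ → φ x = φ y) →
      ∀ ε ∈ Ioo 0 ε₀,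
        |eyinkBalanceT T u p φ ε ψ -
          4 * ((Fintype.card d : ℝ) - 1) / Fintype.card d * ∫ t in Ioo 0 T, ∫ x, (2⁻¹ * ‖u t x‖ ^ 2 * FunctionSpaces.Torus.timeDeriv ψ t x +
            (2⁻¹ * ‖u t x‖ ^ 2 + p t x) * ⟪u t x, FunctionSpaces.Torus.gradient (ψ t) x⟫)| < η := by
  set ν := stMeasure d T with hν
  -- product forms of the data
  have hu : AEStronglyMeasurable (uncurry u) ν := aestronglyMeasurable_uncurry_prod_of_stLift_Ioo hum
  have hu3' : ∫⁻ q, ‖uncurry u q‖ₑ ^ (3 : ℝ) ∂ν < ∞ := by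
    have h := lintegral_prod_enorm_pow_three_lt_top hu hu3
    have e : ∫⁻ q, ‖uncurry u q‖ₑ ^ 3 ∂ν = ∫⁻ q, ‖uncurry u q‖ₑ ^ (3 : ℝ) ∂ν :=
      lintegral_congr fun q => ENNReal.pow_three_eq_rpow _
    rw [← e]; exact h
  have hp : AEStronglyMeasurable (uncurry p) ν := aestronglyMeasurable_uncurry_prod_of_stLift_Ioo' hpm
  have hp32' : ∫⁻ q, ‖uncurry p q‖ₑ ^ (3 / 2 : ℝ) ∂ν < ∞ := by
    have e := lintegral_Ioo_lintegral_eq_lintegral_prod (T := T) (g := fun t x => ‖p t x‖ₑ ^ (3 / 2 : ℝ))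
      (hp.enorm.pow_const _)
    rw [e] at hp32
    exact hp32
  -- test data
  obtain ⟨Cψ, hCψ, hθb, hHb, hθm, hHm⟩ := hψ.testData_bound
  have hθm' : AEStronglyMeasurable (fun q : ℝ × UnitAddTorus d => FunctionSpaces.Torus.timeDeriv ψ q.1 q.2) ν := hθm
  -- the master constants
  obtain ⟨K₁, K₂, hK₁, hK₂, hM⟩ := master_estimate (T := T) hu hu3' hp hp32' hθm' hHm hCψ
    (fun q => hθb q.1 q.2) (fun q => hHb q.1 q.2)
  -- moduli of continuity of translation
  set m : ℝ≥0∞ := ENNReal.ofReal (η / (4 * (K₁ + 1))) with hmdef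
  set mP : ℝ≥0∞ := ENNReal.ofReal (η / (4 * (K₂ + 1))) with hmPdef
  have hm0 : 0 < m := ENNReal.ofReal_pos.2 (by positivity)
  have hmP0 : 0 < mP := ENNReal.ofReal_pos.2 (by positivity)
  obtain ⟨δu, hδu, hmodu⟩ := exists_forall_lintegral_translate_sub_lt (T := T) (r := 3) (by norm_num) hu hu3' hm0
  obtain ⟨δp, hδp, hmodp⟩ := exists_forall_lintegral_translate_sub_lt (T := T) (r := 3 / 2) (by norm_num) hp hp32' hmP0
  have e13 : (1 : ℝ) / 3 = 1 / 3 := rfl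
  have e23 : (1 : ℝ) / (3 / 2) = 2 / 3 := by norm_num
  simp only [e23] at hmodp
  refine ⟨min δu δp, lt_min hδu hδp, fun φ hφ hrad ε hε => ?_⟩
  have hε0 : 0 < ε := hε.1
  have hεu : ε < δu := hε.2.trans_le (min_le_left _ _)
  have hεp : ε < δp := hε.2.trans_le (min_le_right _ _)
  -- kernels and projections
  have hd1 : 1 ≤ Fintype.card d := Fintype.card_pos
  obtain ⟨hk, hksupp, hk1, hkabs⟩ := mollifierScale_kernel_facts hφ hε0
  have hkrad := mollifierScale_radial hrad ε
  obtain ⟨hkT, hkTsupp, hkTmass, hkTabs⟩ := transverseKernel_scaled_facts hφ hd1 hε0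
  have hkTabs2 : ∫ ξ, |eyinkTransverseKernel d (FluidPDE.mollifierScale ε φ) ξ| ≤ 2 := by
    rw [hkTabs]; linarith [one_add_pred_div_le_two hd1]
  have hAT : ∀ ξ v : EuclideanSpace ℝ d, ‖projT (‖ξ‖⁻¹ • ξ) v‖ ≤ 2 * ‖v‖ := fun ξ v => norm_projT_unit_le ξ v
  have hAngI : ∀ a c : EuclideanSpace ℝ d, ∫ ξ, FluidPDE.mollifierScale ε φ ξ * ⟪projT (‖ξ‖⁻¹ • ξ) a, c⟫ =
      ((Fintype.card d : ℝ) - 1) / Fintype.card d * ⟪a, c⟫ := fun a c => by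
    rw [integral_mul_inner_projT hk hkrad, hk1, mul_one]
  have hAngII : ∀ a : EuclideanSpace ℝ d, ∫ ξ, FluidPDE.mollifierScale ε φ ξ * ‖projT (‖ξ‖⁻¹ • ξ) a‖ ^ 2 =
      ((Fintype.card d : ℝ) - 1) / Fintype.card d * ‖a‖ ^ 2 := fun a => by
    rw [integral_mul_norm_projT_sq hk hkrad, hk1, mul_one]
  -- the master estimate for this kernel pair
  obtain ⟨hSint, hSest⟩ := hM projT hk hksupp hkabs hkT hkTsupp hkTmass hkTabs2 hAT continuous_projT hAngI hAngII
    ENNReal.ofReal_ne_top ENNReal.ofReal_ne_top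
    (fun ξ hξ => (hmodu ξ (hξ.trans_lt hεu)).le) (fun ξ hξ => (hmodp ξ (hξ.trans_lt hεp)).le)
  -- identify `𝓔_T^{ε,φ}(ψ)` with the master pairing
  have hpt : ∀ (t : ℝ) (x : UnitAddTorus d),
      2 * ⟪u t x, eyinkVelocityT φ ε (u t) x⟫ * FunctionSpaces.Torus.timeDeriv ψ t x +
        (2 * ⟪u t x, eyinkVelocityT φ ε (u t) x⟫ - eyinkEnergyT φ ε (u t) x +
            2 * eyinkPressureT φ ε (p t) x) * ⟪u t x, FunctionSpaces.Torus.gradient (ψ t) x⟫ +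
        ⟪eyinkEnergyFluxT φ ε (u t) x, FunctionSpaces.Torus.gradient (ψ t) x⟫ +
        2 * p t x * ⟪eyinkVelocityT φ ε (u t) x, FunctionSpaces.Torus.gradient (ψ t) x⟫ =
      ⟪(∫ ξ, FluidPDE.mollifierScale ε φ ξ • projT (‖ξ‖⁻¹ • ξ) (u t (x + FunctionSpaces.Torus.proj ξ))),
          (2 * (FunctionSpaces.Torus.timeDeriv ψ t x + ⟪u t x, FunctionSpaces.Torus.gradient (ψ t) x⟫)) • u t x +
            (2 * p t x) • FunctionSpaces.Torus.gradient (ψ t) x⟫ -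
        (∫ ξ, FluidPDE.mollifierScale ε φ ξ * ‖projT (‖ξ‖⁻¹ • ξ) (u t (x + FunctionSpaces.Torus.proj ξ))‖ ^ 2) *
          ⟪u t x, FunctionSpaces.Torus.gradient (ψ t) x⟫ +
        ⟪(∫ ξ, (FluidPDE.mollifierScale ε φ ξ * ‖projT (‖ξ‖⁻¹ • ξ) (u t (x + FunctionSpaces.Torus.proj ξ))‖ ^ 2) •
          u t (x + FunctionSpaces.Torus.proj ξ)), FunctionSpaces.Torus.gradient (ψ t) x⟫ +
        2 * (∫ ξ, eyinkTransverseKernel d (FluidPDE.mollifierScale ε φ) ξ * p t (x + FunctionSpaces.Torus.proj ξ)) *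
          ⟪u t x, FunctionSpaces.Torus.gradient (ψ t) x⟫ := by
    intro t x
    obtain ⟨eV, eE, eF⟩ := eyink_objectsT_eq φ ε (u t) x
    rw [eV, eE, eF, eyinkPressureT_apply, inner_add_right, real_inner_smul_right, real_inner_smul_right,
      real_inner_comm (u t x)]
    ring
  have hBL : eyinkBalanceT T u p φ ε ψ =
      ∫ q, (⟪(∫ ξ, FluidPDE.mollifierScale ε φ ξ • projT (‖ξ‖⁻¹ • ξ) (uncurry u (stTranslate d ξ q))),
          (2 * (FunctionSpaces.Torus.timeDeriv ψ q.1 q.2 + ⟪uncurry u q, FunctionSpaces.Torus.gradient (ψ q.1) q.2⟫)) •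
              uncurry u q + (2 * uncurry p q) • FunctionSpaces.Torus.gradient (ψ q.1) q.2⟫ -
        (∫ ξ, FluidPDE.mollifierScale ε φ ξ * ‖projT (‖ξ‖⁻¹ • ξ) (uncurry u (stTranslate d ξ q))‖ ^ 2) *
          ⟪uncurry u q, FunctionSpaces.Torus.gradient (ψ q.1) q.2⟫ +
        ⟪(∫ ξ, (FluidPDE.mollifierScale ε φ ξ * ‖projT (‖ξ‖⁻¹ • ξ) (uncurry u (stTranslate d ξ q))‖ ^ 2) •
          uncurry u (stTranslate d ξ q)), FunctionSpaces.Torus.gradient (ψ q.1) q.2⟫ +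
        2 * (∫ ξ, eyinkTransverseKernel d (FluidPDE.mollifierScale ε φ) ξ * uncurry p (stTranslate d ξ q)) *
          ⟪uncurry u q, FunctionSpaces.Torus.gradient (ψ q.1) q.2⟫) ∂ν := by
    rw [integral_prod _ hSint, eyinkBalanceT]
    refine setIntegral_congr_fun measurableSet_Ioo fun t _ => ?_
    refine integral_congr_ae (ae_of_all _ fun x => ?_)
    exact hpt t x
  obtain ⟨-, hDval⟩ := energyFluxFunctional_eq_integral_prod (T := T) hu hu3 hp hp32 hψ.1
  rw [hBL, hDval]
  have hI : (∫ z, (2⁻¹ * ‖u z.1 z.2‖ ^ 2 * FunctionSpaces.Torus.timeDeriv ψ z.1 z.2 +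
        (2⁻¹ * ‖u z.1 z.2‖ ^ 2 + p z.1 z.2) * ⟪u z.1 z.2, FunctionSpaces.Torus.gradient (ψ z.1) z.2⟫) ∂ν) =
      ∫ q, (2⁻¹ * ‖uncurry u q‖ ^ 2 * FunctionSpaces.Torus.timeDeriv ψ q.1 q.2 +
        (2⁻¹ * ‖uncurry u q‖ ^ 2 + uncurry p q) * ⟪uncurry u q, FunctionSpaces.Torus.gradient (ψ q.1) q.2⟫) ∂ν := rfl
  have hconst : 4 * ((Fintype.card d : ℝ) - 1) / Fintype.card d *
      (∫ z, (2⁻¹ * ‖u z.1 z.2‖ ^ 2 * FunctionSpaces.Torus.timeDeriv ψ z.1 z.2 +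
        (2⁻¹ * ‖u z.1 z.2‖ ^ 2 + p z.1 z.2) * ⟪u z.1 z.2, FunctionSpaces.Torus.gradient (ψ z.1) z.2⟫) ∂ν) =
      ((Fintype.card d : ℝ) - 1) / Fintype.card d * (4 * ∫ q, (2⁻¹ * ‖uncurry u q‖ ^ 2 * FunctionSpaces.Torus.timeDeriv ψ q.1 q.2 +
        (2⁻¹ * ‖uncurry u q‖ ^ 2 + uncurry p q) * ⟪uncurry u q, FunctionSpaces.Torus.gradient (ψ q.1) q.2⟫) ∂ν) := by
    rw [hI]
    ring
  rw [hconst]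
  refine hSest.trans_lt ?_
  -- `K₁ m + K₂ m_P < η`
  have hm : m.toReal = η / (4 * (K₁ + 1)) := ENNReal.toReal_ofReal (by positivity)
  have hmP : mP.toReal = η / (4 * (K₂ + 1)) := ENNReal.toReal_ofReal (by positivity)
  rw [hm, hmP]
  have h1 : K₁ * (η / (4 * (K₁ + 1))) ≤ η / 4 := by
    rw [mul_div_assoc', div_le_div_iff₀ (by positivity) (by positivity)]
    nlinarith
  have h2 : K₂ * (η / (4 * (K₂ + 1))) ≤ η / 4 := by
    rw [mul_div_assoc', div_le_div_iff₀ (by positivity) (by positivity)]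
    nlinarith
  linarith

end Eyink

end Literature.Analysis.FluidPDE.Torus
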